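import Literature.MathematicalPhysics.QuantumFieldTheory.Balaban1983to89.Setup

/-!
# Bałaban's renormalization group for 4-d lattice Yang–Mills — the inductive step `k → k+1` (`Step`)

CITATION HEADER (lean-in-tree rule 2026-08-18). This module is a TYPED SKELETON, at statement level, of the INDUCTIVE STEP of the
published series T. Bałaban, *Renormalization group approach to lattice gauge field theories. I*, Comm. Math. Phys. **109** 249–301
(1987) [Balaban1987RG1] (§0 (0.17)–(0.31), §1 (1.1)–(1.22), §2 (2.1)–(2.15), Thms 1–3); *Convergent renormalization expansions for
lattice gauge theories*, Comm. Math. Phys. **119** 243–285 (1988) [Balaban1988Convergent] (§2 (2.1)–(2.50), Thm 1, Thm 2, Cor 3); *Large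
field renormalization. I*, **122** 175–202 (1989) [Balaban1989LargeFieldI] (§0 (0.1)–(0.6), §1 (1.1)–(1.2), (1.99)–(1.102)); *Large field
renormalization. II*, **122** 355–392 (1989) [Balaban1989LargeFieldII] (Thm 1, (0.1), (1.89), (1.100)–(1.102)); *Ultraviolet stability of
three-dimensional lattice pure gauge field theories*, **102** 255–275 (1985) [Balaban1985UV3] ((1), (6) pp.256–257, the density-level
bookkeeping); and, FOR COMPARISON ONLY, J. Dimock, *The renormalization group according to Balaban. I*, arXiv:1108.1335 [arXiv11081335]
(Thms `lanky`, `gsf`). WHAT IS REPRODUCED: (A) kernel-checked ELEMENTARY real analysis of the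
printed coupling-constant recursion (what follows from what among (0.20), (0.31), B14 (2.6), (2.46)); (B) the SHAPES of the inductive
data and bounds as structures / `Prop`s over the vocabulary of `Setup` (same directory); (C) the shapes of Dimock's two φ⁴₃ theorems;
(D) the density-level step `ρ_{k+1} = 𝐑(Tρ_k)` with its kernel-checked bookkeeping (integral invariant, (2.18) ↔ (0.2), (2.20) ⇒ (2.22), the small factors);
(E) the per-step NEW-TERM OBLIGATIONS (the clauses a step `k → k+1` must deliver at the new index, incl. the coupling renormalization
condition defining `g_{k+1}`) and their kernel-checked equivalence with the theorem shapes of (B); (F) the kernel-checked ARITHMETIC of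
[Balaban1989LargeFieldII]'s auxiliary induction over scales (1.79)–(1.89) — the small-factor budget `κ_j(Z)` carried from scale to scale —
with its geometric inputs and located constant restrictions as explicit hypotheses (Dimock's analogue: [Dimock2013BalabanIII] §convergence)
— the one combinatorial input, the endpoint of a maximal tree of the graph of the domains p.386, kernel-checked from Mathlib's spanning trees (F4, v5),
and the index bookkeeping `j(Z) = min(j(X), j(Y))` with the inequality `hP` of the binary step PROVED from B14 (2.7) (F5, v6);
(G) the remaining clauses of [Balaban1988Convergent] §2 — (2.41)(i),(iii) and the component localization p.262 for the boundary terms,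
the Euclidean covariance (2.29), (2.32)–(2.33) — as predicates over separate symmetry data, and the vacuum-energy constant `E` of the
Wilson start pinned against the Wilson partition function by the UV bounds (kernel-checked bookkeeping). (H) the bookkeeping of the one displayed
discrepancy between [Balaban1989LargeFieldII] (1.101) (the new 𝐑-terms entering the action UNSUBTRACTED) and [Balaban1988Convergent]
(2.23)/(2.30) (subtracted at U = 1): the two forms differ by a U-independent constant absorbed into `E_k`, bounded by the (2.31)
majorants; and (2.19) derived from (2.20) given one-step locality (v7).
NO theorem of the series is asserted: [Balaban1987RG1] Thm 2 (announced there for a paper that did not appear) and the series'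
end-statement are CLAIMS UNDER ADJUDICATION by the audit cell `pub-balaban`; they and Thm 3 / [Balaban1988Convergent] Thm 1 enter only
as `def … : Prop`. The theorems below whose docstring cites a printed formula are statements ABOUT that formula proved here from
stated hypotheses (e.g. "(2.46) follows from a running lower bound", "(2.46) does not follow from the interval hypothesis"), never
restatements of it as fact. Staged byte-identically in the cell package `run/shared/lean/pub/pub-balaban/lean/BalabanYm4/Literature/…`.

# `Step` — the inductive step `k → k+1` of Bałaban's 4D renormalization group (FOUNDATIONS 2, unit b2b-balaban-f2)

Cell `pub-balaban` (near-miss cell 7), unit `b2b-balaban-f2`.  Prose companion with the VERBATIM quotations and the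
Dimock ↔ Bałaban alignment table: the cell's `STEP.md` (HOME top level, next to `NOTATION.md`).  This module is the SPINE every
sub-cell types against: it fixes (A) the elementary real analysis of the coupling-constant flow in `d = 4`,
(B) the data carried from scale `k` to `k+1` and the inductive bounds exactly as printed, as STRUCTURES and
`Prop`-valued predicates over the vocabulary of `Setup` (unit f1), and (C) Dimock's φ⁴₃ template at the
same level.  NOTHING here asserts that Bałaban's theorems hold: theorem SHAPES are `def … : Prop`, the per-paper
verbatim statements are the per-paper modules `B12`/`B14`/`B16` of this directory (`*.Thm…Printed`, unit r2), and
the only `theorem`s are kernel-checked facts of elementary analysis / bookkeeping (no `sorry`, no `axiom`;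
`#print axioms` ⊆ {propext, Classical.choice, Quot.sound}).  VALUE = typed skeleton + gap census, not summit progress.

IMPORTS AND SIBLINGS.  This module imports `Setup` ONLY, so that the per-paper modules and the phase-2 binding
modules of the cell can import it without cycles (it is upstream of `B12`/`B14`/`B16`/`Dag` bindings, downstream of
nothing but `Setup`).  Consequently it does not restate what the already-landed siblings carry: the two cell
instantiations of the dangling hypothesis "(I.0.33)" are `B14.H033Interval` / `B14.H033LogRunning` (module `B14`),
the geometric-series step of B12 (0.30) / B14 (2.45) is `B14.geomStep_245`, the printed statement of [I] Thm 2 is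
`B12.Thm2Printed` (its `Params`-based variant `Missing.B12Thm2Shape`), and (2.28) `α_{0,j}, α_{1,j}` as a bare
function is `B14.alphaJ` (here: the projections `LFConsts.alpha0/alpha1` of the constants record, same formula).
Where Part A re-derives an inequality that `B14` also re-derives over `Setup.Flow` ((2.6): `B14.flow26_*_of_rg`),
the version here is over raw sequences `ℕ → ℝ` and `Mathlib` alone (a second engine), bridged to `Flow` by
`rgEq_iff` / `inInterval_iff` / `logRunning_iff_discrete031`.

Sources (journal pages; PDF page = journal page − 248 for B12 = CMP 109:249–301 "(IR) I" [B12], − 242 for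
B14 = CMP 119:243–285 [B14], − 174 for B15 = CMP 122:175–202 [B15], − 354 for B16 = CMP 122:355–392 [B16];
Dimock: arXiv:1108.1335 [D1], 1212.5562 [D2], 1304.0705 [D3], TeX line numbers of the archive copies).

## Part A — the coupling-constant flow (d = 4), on raw sequences `g : ℕ → ℝ`, `β : ℕ → ℝ → ℝ`
* (0.18)/(0.20) B12 p.255–256: `1/g_k² = 1/g_{k+1}² + β_{k+1}(g_k)`, k = 0,…,K−1      ↦ `RGEq` (= `Flow.SatisfiesRG`, `rgEq_iff`)
* hypothesis of B12 Thm 1/3, B14 Thm 1, B16 Thm 1: `0 < g_k ≤ γ`, k = 0,…,K                ↦ `InInterval` (= `Flow.InInterval`)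
* (0.31) B12 p.259 (Thm 2): `1/g² + β log(L^kε)⁻¹ ≤ 1/g_k² ≤ 1/g² + β' log(L^kε)⁻¹`          ↦ `Ineq031`, `Discrete031` (= `Flow.LogRunning`, `logRunning_iff_discrete031`)
* B14 (2.6) p.255: the four coupling inequalities of the inductive assumption                ↦ `B14_2_6a/b/c/d` (cf. r2's `B14.flow26_*_of_rg`)
* B12 Thm 2 reduced to elementary analysis: `couplingTrajectory_exists` (IVT), GIVEN continuity and `0 < b ≤ β_j ≤ β'`
  on `]0,γ]` — the positive lower bound `b` is printed NOWHERE in B12–B16 (GAPS G1, G-f2.2)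
* B14 (2.46): `sum_sixth_powers_le` (what the running lower bound gives) and `interval_hyp_not_sufficient_for_2_46`
  (the interval hypothesis alone does NOT give it — bears on the dangling "(I.0.33)", GAPS G2, DIVERGENCE D-f2.2)

## Part B — the data carried from scale k to k+1 and the inductive bounds
* B1 `SFTower`, `SFTower.action13/16`, `SFHyp` — B12 §1 (1.3), (1.6)–(1.7), (1.18)–(1.19), p.264 (β smooth, bounded)
* B2 `GeneratedBySmallFieldRT`, `B12Thm3Shape` — B12 (0.17)–(0.20), (2.1), (2.12)–(2.15), Thm 3 p.264
* B3 `LFConsts` (2.4), (2.28); `LFTower`, `LFHyp` ((I.1.18), (2.31), (2.42)), `LFHypImproved` (p.262), `LFActionData.action23` (2.23)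
* B4 `B14Thm1Shape` (the hypothesis "(I.0.33)" a PARAMETER `H033`; instantiations `B14.H033Interval`/`B14.H033LogRunning`), `RootTemplate` (REFEREE R1.1)
* B5 `DimockData`, `LankyStepShape` (D1 Thm lanky), `GsfShape` (D1 Thm gsf) — the template, statement level

## Part D — the density level (v2): where the per-paper statements meet
* D1 `DensityRG` (ρ_{k+1} = 𝐑_k(T_kρ_k), B14 Thm 1 p.262), `IsWilsonStart`, `partitionFn` (B10 (6)); `integral_RT_eq`,
  `DensityRG.integral_invariant` (∫dV_kρ_k = Z given the normalization (0.4)/(1.102) of every 𝐑, kernel-checked),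
  `fieldMeasure_isProbabilityMeasure`, `DensityRG.partitionFn_le_exp` (pointwise UV upper bound ⇒ Z ≤ e^c),
  `DensityRG.MapsSpaces` / `inSpace_all` (B14 p.262 "𝐑T transforms the space with the index k into the space with the index k+1")
* D2 `Repr218` (B14 (2.17)–(2.18)), `Repr218.piece` / `sum_piece` ((2.18) regrouped by the last region Z_k IS B15 (0.2), kernel-checked)
* D3 `TkOps`, `TkOps.Laws` (B14 (2.19)–(2.20): factorization, commutation, ordered one-step product), `TkOps.prod222`
  ((2.22) DERIVED from (2.20) under the nesting of the large-field regions, kernel-checked)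
* D4 `exp_neg_p0Profile_eq_rpow` / `_le_printed` (B15 (0.1): the printed exponent is off by a factor 2, safe direction;
  DIVERGENCE D-f2.10), `exp_neg_p0Profile_le_pow` (B16 (1.100)'s `exp(−p₀(g_k))` ⇒ (2.31)'s `g_k^{κ₀}` under a smallness
  condition on g_k — one of the restrictions on γ, GAPS G-r2.3), `FundIneq189` (B16 (1.89), the "fundamental inequality")

## Part E — the forward step obligations (v3): what ONE step must deliver at the new index
* E1 `SFNewTerm` (B12 §2: (2.13)–(2.15) with (1.7), (1.18), (1.19), p.264), `SFHyp.zero` / `.succ` / `.newTerm` / `.succ_iff`,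
  `sfHyp_all_of_steps`, `SFStepObligation`, `B12Thm3Shape_iff_obligation` (Thm 3 shape ⟺ every step discharges the obligation)
* E2 `improved_le_weak`, `LFHypImproved.toWeak_R` / `toWeak_B`, `LFNewTerms` (B14 p.262, B16 p.390), `LFSigns`, `LFHyp.zero`,
  `LFHypImproved.zero`, `LFHyp.succ`, `lfHyp_all_of_steps`, `LFStepObligation`, `B14Thm1Shape_of_obligation` / `obligation_of_B14Thm1Shape`

## Part F — the auxiliary induction over scales (v3): the small-factor budget `κ_j(Z)` of B16 pp.383–387, (1.79)–(1.89)
* `Budget.Consts`, `Budget.Consts.cost` (the cost `O(1)M^dR_n^{d+1}d′` of (1.79)/(1.80)), `Budget.Controls` ((1.80)), `Budget.ScaleData` /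
  `ScaleData.Invariant` (the data carried `j → j+1`: components, creation index `j(Z)`, budget `κ_j(Z)`, size profile of the `S`-iterates,
  horizon `K`), `Budget.controls_zero_iff`
* F1 `Budget.L_iter_lt_63` (p.384; needs `L ≥ 3`), `Budget.sqrt_scaling_le_half_pow` (p.384–385; needs `L ≥ 4`), `Budget.geom_sum_Ioc`,
  `Budget.majorant_181` ((1.81) GIVEN `R_n^{d+1} ≤ ρ` on the range — the undisplayed input `R_n ≤ LR_j`)
* F2 `Budget.base_182` ((1.82) + the located base-case condition), `Budget.case1_183` ((1.83)), `Budget.reset_p386` (p.386 top),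
  `Budget.merge` ((1.85)), `Budget.merge_eq_186` ((1.86)), `Budget.merge_step` ((1.87)–(1.88)), `Budget.merge_controls` (the induction on
  the number of pieces p.386 from the endpoint property + three local inequalities + ONE budget condition)
* F3 `Budget.fundIneq189_of_budget` (`K = 0` ⇒ `κ_k(X) ≥ 0` ⇒ (1.89) = `FundIneq189` of D4)
* F4 (v5, appended at the end of the file) `Budget.GConn` (p.386: the graph `G` of the domains, "a line in G if … the corresponding
  domains intersect, or touch each other"; a family is connected iff its induced subgraph is), `Budget.gconn_singleton` / `gconn_nonempty` /
  `eraseIso` / `gconn_adj` (p.387 "The domains X, Y intersect, or at least touch each other"), `Budget.gconn_leaf` (THE ENDPOINT OF A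
  MAXIMAL TREE p.386 = the hypothesis `hleaf` of `merge_controls`, PROVED from Mathlib's spanning-tree / degree-one-vertex lemmas),
  `Budget.merge_controls_graph` (`merge_controls` with `hleaf` discharged)
* F5 (v6, appended at the end of the file) `Budget.LogPowMono` (B14 (2.7a) as a raw-sequence property), `profile_slack_le`,
  `Budget.firstIndex` (p.384 `j(Z)` = the index of the first region; `firstIndex_erase`: `j(Z) = min(j(X), j(Y))`, p.386), `Budget.pFam`
  (`2p₀(g_{j(Z)})`), `Budget.hP_of_logPowMono` (the hypothesis `hP` of `merge_step` PROVED from (2.7a)), `merge_controls_index`,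
  `fundIneq189_of_budget_index` (F2/F4 and F3 with `hP` discharged)

## Part G — the remaining clauses of B14 §2 (v4): symmetry data, (2.41)(i),(iii) + p.262, (2.29), (2.32)–(2.33); `E` pinned
* G1 `LFSymm` (restriction / adjoint gauge action on the fluctuation fields, `G`-valued transformations, the essential part of a domain
  p.262, Euclidean transformations of `T^{(j)}` with their actions, regular configurations, incidence, admissible domains), `LFSymm.Ez`
  (the point function `𝐄^{(j)}(U_j, z)` of (2.27) with the unrestricted sum, p.260), `LFSymm.Rtot` (`𝐑^{(j)}(U_j)` of (2.33))
* G2 `LFHypB` ((2.41)(i), (iii) p.261; p.262), `LFHypB.ofCompLoc` (p.262 refines (i)), `.mono` / `.zero` / `.succ` / `.newTerm` / `.succ_iff`,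
  `LFNewTermsB`, `lfHypB_all_of_steps`
* G3 `LFCov` ((2.29), (2.32) p.260), `LFCov.inv229_of_fix` (the sentence after (2.29)), `LFCov.inv233` ((2.33) from (2.32) by re-indexing),
  `.mono` / `.zero` / `.succ` / `.newTerm` / `.succ_iff`, `LFNewCov`, `lfCov_all_of_steps`; `LFStepObligationG`, `all_of_obligationG`,
  `obligationG_of_parts` (the complete per-step obligation = Part E's + the Part G clauses)
* G4 `wilsonZ` (B10 (1), (6)), `DensityRG.partitionFn_eq_of_wilsonStart`, `DensityRG.exp_neg_mul_wilsonZ_le` / `log_wilsonZ_sub_le`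
  (upper half of B16 (0.1) ⇒ `E ≥ log Z_W(g₀) − E₊|T_η|`), `DensityRG.integral_minorant_le` (lower half); (v5, appended at the end of
  the file) `wilsonZ_pos_of_integrable` (the hypothesis `0 < Z_W(g₀)` of `log_wilsonZ_sub_le` from integrability of the Wilson weight)

## Part H — (1.101) [B16] versus (2.23)/(2.30) [III] (v7): the unsubtracted 𝐑-sum and the shift of `E_k`; (2.19) from (2.20)
* H1 (v7, appended at the end of the file) `LFActionData.rConst` (the constant `Σ_{j≤k}Σ_X Re 𝐑^{(j)}(X,1)`), `LFActionData.action1101`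
  ((2.23) with the 𝐑-part in the printed form (1.101) p.390, unsubtracted), `LFActionData.shiftE` (`E_k ↦ E_k + c`), `rSum_sub`,
  `action23_eq_action1101_sub` / `action23_eq_action1101_shift` / `action1101_eq_action23_unshift` (the two forms are the same family
  of actions, differing in the datum `E_k` only), `LFHyp.norm_R_sub_R_one_le` (a subtracted term obeys twice (2.31), given `(1,0)` in
  the space), `LFActionData.abs_rConst_le` / `abs_action23_sub_action1101_le` (the constant is bounded by the (2.31) majorants)
* H2 `prod_map_mul_of_commute`, `TkOps.ofOneStep` (the operations DEFINED by (2.20) from one-step operations), `TkOps.laws_ofOneStep`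
  ((2.19) — factorization and commutation for disjoint regions — DERIVED from (2.20), given one-step multiplicativity on disjoint unions
  and commutation of one-step operations of disjoint regions; a construction template / non-vacuity witness for `TkOps.Laws`),
  `TkOps.ofOneStep_T`

Schematic simplifications are listed in DIVERGENCE.md (rows D-f2.*) and STEP.md §9; names absent from Setup are
introduced HERE under the sub-namespace `Step` (never under a Setup name).
-/
namespace Literature.MathematicalPhysics.QuantumFieldTheory.Balaban1983to89.Step


open _root_.Finset _root_.Real

/-! ## Definitions -/

/-- B12 (0.18), (0.20), p.255–256: "1/g_k² = 1/g²_{k+1} + β_{k+1}(g_k)", for k = 0,1,…,K−1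
("the sequence of actions and coupling constants is defined for k = 0, 1, …, K", p.256).
`β (k+1)` is the (k+1)-st β-function, a real function "defined on the interval [0,γ]" (p.255). [cite: Balaban1987RG1, (0.18)/(0.20) p.255–256] -/
def RGEq (K : ℕ) (β : ℕ → ℝ → ℝ) (g : ℕ → ℝ) : Prop :=
  ∀ k, k < K → 1 / (g k) ^ 2 = 1 / (g (k + 1)) ^ 2 + β (k + 1) (g k)

/-- The interval hypothesis: "0 < g_k ≤ γ for k = 0,1,…,K" (B12 Thm 3 p.264; B12 Thm 1 p.259 and B16 Thm 1
p.355: "contained in an interval ]0,γ]"). [cite: Balaban1987RG1, Thm 1 p.259] -/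
def InInterval (γ : ℝ) (K : ℕ) (g : ℕ → ℝ) : Prop :=
  ∀ k, k ≤ K → 0 < g k ∧ g k ≤ γ

/-- Upper bound on a family of β-functions on ]0,γ]: B12 p.264 "uniformly bounded on this interval". [cite: Balaban1987RG1, §1 p.264] -/
def BetaUpper (β' γ : ℝ) (β : ℕ → ℝ → ℝ) : Prop :=
  ∀ j x, 0 < x → x ≤ γ → β j x ≤ β'

/-- Lower bound `b ≤ β_j(x)` on ]0,γ].  With `b > 0` this is (discrete) ASYMPTOTIC FREEDOM; it is NOT asserted in
print anywhere in B12–B16 (B12 p.264: "We will investigate other properties in a separate paper") — it is the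
load-bearing unpublished input behind B12 Thm 2 (GAPS G1), see `couplingTrajectory_exists`. [cite: Balaban1987RG1, Thm 2 / (0.31) p.259] -/
def BetaLower (b γ : ℝ) (β : ℕ → ℝ → ℝ) : Prop :=
  ∀ j x, 0 < x → x ≤ γ → b ≤ β j x

/-- B12 (0.31) p.259, verbatim shape: "1/g² + β log(L^kε)⁻¹ ≤ 1/g_k² ≤ 1/g² + β' log(L^kε)⁻¹", k = 0,…,K,
with renormalized coupling `g = g_K`, lattice spacing `ε`, block size `L`. [cite: Balaban1987RG1, (0.31) p.259] -/
def Ineq031 (L : ℕ) (ε : ℝ) (K : ℕ) (βlo βhi g : ℝ) (gs : ℕ → ℝ) : Prop :=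
  ∀ k, k ≤ K →
    1 / g ^ 2 + βlo * Real.log ((L : ℝ) ^ k * ε)⁻¹ ≤ 1 / (gs k) ^ 2 ∧
      1 / (gs k) ^ 2 ≤ 1 / g ^ 2 + βhi * Real.log ((L : ℝ) ^ k * ε)⁻¹

/-- (0.31) with `ε = L^{-K}` rewritten per step: `log(L^kε)⁻¹ = (K−k) log L`, so with `b = β log L`,
`β'' = β' log L` it reads `1/g² + b (K−k) ≤ 1/g_k² ≤ 1/g² + β'' (K−k)` (`Ineq031_iff_discrete`). [cite: Balaban1987RG1, (0.31) p.259] -/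
def Discrete031 (b β' : ℝ) (K : ℕ) (g : ℝ) (gs : ℕ → ℝ) : Prop :=
  ∀ k, k ≤ K →
    1 / g ^ 2 + b * ((K : ℝ) - k) ≤ 1 / (gs k) ^ 2 ∧ 1 / (gs k) ^ 2 ≤ 1 / g ^ 2 + β' * ((K : ℝ) - k)

/-! ## Telescoping the RG equations -/

/-- Telescoping the RG equations (0.20): `1/g_m² = 1/g_n² + Σ_{j ∈ [m,n)} β_{j+1}(g_j)` for `m ≤ n ≤ K`. [cite: Balaban1987RG1, (0.20) p.256] -/
theorem inv_sq_telescope {K : ℕ} {β : ℕ → ℝ → ℝ} {g : ℕ → ℝ} (h : RGEq K β g) {m n : ℕ}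
    (hmn : m ≤ n) (hn : n ≤ K) :
    1 / (g m) ^ 2 = 1 / (g n) ^ 2 + ∑ j ∈ Finset.Ico m n, β (j + 1) (g j) := by
  induction n, hmn using Nat.le_induction with
  | base => simp
  | succ n hmn ih =>
    have hn' : n ≤ K := Nat.le_of_succ_le hn
    rw [ih hn', Finset.sum_Ico_succ_top hmn, h n (Nat.lt_of_succ_le hn)]
    ring

/-! ## B14 (2.6) from the RG equations and β-function bounds -/

/-- B14 (2.6), first inequality in squared form: `1/g_m² ≤ 1/g_n² + β'(n−m)` for m ≤ n ≤ K, from (0.20) and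
`β_j ≤ β'` on ]0,γ] (B12 p.264 "uniformly bounded"). [cite: Balaban1987RG1, (0.20) p.256] -/
theorem inv_sq_le_of_betaUpper {K : ℕ} {β : ℕ → ℝ → ℝ} {g : ℕ → ℝ} {β' γ : ℝ} (h : RGEq K β g)
    (hI : InInterval γ K g) (hU : BetaUpper β' γ β) {m n : ℕ} (hmn : m ≤ n) (hn : n ≤ K) :
    1 / (g m) ^ 2 ≤ 1 / (g n) ^ 2 + β' * ((n : ℝ) - m) := by
  rw [inv_sq_telescope h hmn hn]
  have hsum : ∑ j ∈ Finset.Ico m n, β (j + 1) (g j) ≤ ∑ _j ∈ Finset.Ico m n, β' := by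
    apply Finset.sum_le_sum
    intro j hj
    have hjK : j ≤ K := le_trans (le_of_lt (Finset.mem_Ico.mp hj).2) hn
    exact hU (j + 1) (g j) (hI j hjK).1 (hI j hjK).2
  have hcard : ∑ _j ∈ Finset.Ico m n, β' = β' * ((n : ℝ) - m) := by
    rw [Finset.sum_const, Nat.card_Ico, nsmul_eq_mul, Nat.cast_sub hmn]
    ring
  linarith

/-- B14 (2.6) p.255, first inequality as printed: `g_n ≤ (1 + g_n² β'(n−m))^{1/2} g_m` (n > m; here m ≤ n ≤ K). [cite: Balaban1988Convergent, (2.6) p.255] -/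
theorem B14_2_6a {K : ℕ} {β : ℕ → ℝ → ℝ} {g : ℕ → ℝ} {β' γ : ℝ} (h : RGEq K β g)
    (hI : InInterval γ K g) (hU : BetaUpper β' γ β) {m n : ℕ} (hmn : m ≤ n) (hn : n ≤ K) :
    g n ≤ Real.sqrt (1 + (g n) ^ 2 * β' * ((n : ℝ) - m)) * g m := by
  have hgm : 0 < g m := (hI m (le_trans hmn hn)).1
  have hgn : 0 < g n := (hI n hn).1
  have key := inv_sq_le_of_betaUpper h hI hU hmn hn
  -- squared form: g_n² ≤ (1 + g_n² β' (n-m)) g_m²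
  have hsq : (g n) ^ 2 ≤ (1 + (g n) ^ 2 * β' * ((n : ℝ) - m)) * (g m) ^ 2 := by
    have hm2 : 0 < (g m) ^ 2 := by positivity
    have hn2 : 0 < (g n) ^ 2 := by positivity
    rw [div_le_iff₀ hm2] at key
    have : 1 ≤ (1 / (g n) ^ 2 + β' * ((n : ℝ) - m)) * (g m) ^ 2 := key
    have h2 : (g n) ^ 2 * 1 ≤ (g n) ^ 2 * ((1 / (g n) ^ 2 + β' * ((n : ℝ) - m)) * (g m) ^ 2) :=
      mul_le_mul_of_nonneg_left this (le_of_lt hn2)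
    have h3 : (g n) ^ 2 * ((1 / (g n) ^ 2 + β' * ((n : ℝ) - m)) * (g m) ^ 2)
        = (1 + (g n) ^ 2 * β' * ((n : ℝ) - m)) * (g m) ^ 2 := by
      field_simp
    linarith [h2, h3]
  have hpos : 0 ≤ 1 + (g n) ^ 2 * β' * ((n : ℝ) - m) := by
    by_contra hneg
    have hneg' : 1 + (g n) ^ 2 * β' * ((n : ℝ) - m) < 0 := lt_of_not_ge hneg
    have : (1 + (g n) ^ 2 * β' * ((n : ℝ) - m)) * (g m) ^ 2 < 0 :=
      mul_neg_of_neg_of_pos hneg' (by positivity)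
    linarith [sq_nonneg (g n)]
  calc g n = Real.sqrt ((g n) ^ 2) := (Real.sqrt_sq (le_of_lt hgn)).symm
    _ ≤ Real.sqrt ((1 + (g n) ^ 2 * β' * ((n : ℝ) - m)) * (g m) ^ 2) := Real.sqrt_le_sqrt hsq
    _ = Real.sqrt (1 + (g n) ^ 2 * β' * ((n : ℝ) - m)) * Real.sqrt ((g m) ^ 2) :=
        Real.sqrt_mul hpos _
    _ = Real.sqrt (1 + (g n) ^ 2 * β' * ((n : ℝ) - m)) * g m := by rw [Real.sqrt_sq (le_of_lt hgm)]

/-- B14 (2.6), second inequality: `(1 + g_n²β'(n−m))^{1/2} ≤ (1 + g_n²β')^{1/2} (n−m)^{1/2}` for n − m ≥ 1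
(pure arithmetic, `β' ≥ 0`). [cite: Balaban1988Convergent, (2.6) p.255] -/
theorem B14_2_6b {c β' d : ℝ} (hc : 0 ≤ c) (hβ : 0 ≤ β') (hd : 1 ≤ d) :
    Real.sqrt (1 + c * β' * d) ≤ Real.sqrt (1 + c * β') * Real.sqrt d := by
  rw [← Real.sqrt_mul (by positivity)]
  apply Real.sqrt_le_sqrt
  nlinarith [mul_nonneg hc hβ]

/-- B14 (2.6), third inequality: `(1 + g_n²β')^{1/2} ≤ 1 + β_0` as soon as `g_n² β' ≤ β_0 (2 + β_0)`
("β_0 > 0 can be chosen arbitrarily small, if g is sufficiently small", p.255). [cite: Balaban1988Convergent, (2.6) p.255] -/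
theorem B14_2_6c {c β' β₀ : ℝ} (hβ₀ : 0 ≤ β₀) (hsmall : c * β' ≤ β₀ * (2 + β₀)) :
    Real.sqrt (1 + c * β') ≤ 1 + β₀ := by
  rw [show (1 : ℝ) + β₀ = Real.sqrt ((1 + β₀) ^ 2) by rw [Real.sqrt_sq (by linarith)]]
  apply Real.sqrt_le_sqrt
  nlinarith

/-- B14 (2.6), fourth inequality, from NONNEGATIVITY of the β-functions: `β_j ≥ 0` on ]0,γ] and (0.20) give
`g_m ≤ g_n` for m ≤ n ≤ K, hence `g_m ≤ (1+β_0) g_n` for every `β_0 ≥ 0`.  (From the interval hypothesis and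
`|β_j| ≤ β'` alone it does NOT follow uniformly in n − m; see STEP.md §9.) [cite: Balaban1988Convergent, (2.6) p.255] -/
theorem B14_2_6d_of_betaNonneg {K : ℕ} {β : ℕ → ℝ → ℝ} {g : ℕ → ℝ} {γ : ℝ} (h : RGEq K β g)
    (hI : InInterval γ K g) (hL : BetaLower 0 γ β) {m n : ℕ} (hmn : m ≤ n) (hn : n ≤ K) :
    g m ≤ g n := by
  have hgm : 0 < g m := (hI m (le_trans hmn hn)).1
  have hgn : 0 < g n := (hI n hn).1
  have hsum : 0 ≤ ∑ j ∈ Finset.Ico m n, β (j + 1) (g j) := by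
    apply Finset.sum_nonneg
    intro j hj
    have hjK : j ≤ K := le_trans (le_of_lt (Finset.mem_Ico.mp hj).2) hn
    exact hL (j + 1) (g j) (hI j hjK).1 (hI j hjK).2
  have key : 1 / (g n) ^ 2 ≤ 1 / (g m) ^ 2 := by
    rw [inv_sq_telescope h hmn hn]; linarith
  have hsq : (g m) ^ 2 ≤ (g n) ^ 2 := by
    rwa [one_div_le_one_div (by positivity) (by positivity)] at key
  exact (pow_le_pow_iff_left₀ (le_of_lt hgm) (le_of_lt hgn) (by norm_num : (2:ℕ) ≠ 0)).1 hsq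

/-! ## (0.31) in discrete form from two-sided β-bounds; the interval hypothesis from (0.31) -/

/-- With `g_K = g`, (0.20) and two-sided bounds `b ≤ β_j ≤ β'` on ]0,γ] give the discrete (0.31):
`1/g² + b(K−k) ≤ 1/g_k² ≤ 1/g² + β'(K−k)` for k ≤ K.  (B12 Thm 2's inequality is exactly this with
`b = β log L`, `β' ↦ β' log L`, see `Ineq031_iff_discrete031`.) [cite: Balaban1987RG1, (0.31) p.259] -/
theorem discrete031_of_betaBounds {K : ℕ} {β : ℕ → ℝ → ℝ} {g : ℕ → ℝ} {b β' γ : ℝ} (h : RGEq K β g)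
    (hI : InInterval γ K g) (hL : BetaLower b γ β) (hU : BetaUpper β' γ β) :
    Discrete031 b β' K (g K) g := by
  intro k hk
  have tel := inv_sq_telescope h hk le_rfl
  have hlo : ∑ _j ∈ Finset.Ico k K, b ≤ ∑ j ∈ Finset.Ico k K, β (j + 1) (g j) := by
    apply Finset.sum_le_sum
    intro j hj
    have hjK : j ≤ K := le_of_lt (Finset.mem_Ico.mp hj).2
    exact hL (j + 1) (g j) (hI j hjK).1 (hI j hjK).2
  have hhi : ∑ j ∈ Finset.Ico k K, β (j + 1) (g j) ≤ ∑ _j ∈ Finset.Ico k K, β' := by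
    apply Finset.sum_le_sum
    intro j hj
    have hjK : j ≤ K := le_of_lt (Finset.mem_Ico.mp hj).2
    exact hU (j + 1) (g j) (hI j hjK).1 (hI j hjK).2
  have hc1 : ∑ _j ∈ Finset.Ico k K, b = b * ((K : ℝ) - k) := by
    rw [Finset.sum_const, Nat.card_Ico, nsmul_eq_mul, Nat.cast_sub hk]; ring
  have hc2 : ∑ _j ∈ Finset.Ico k K, β' = β' * ((K : ℝ) - k) := by
    rw [Finset.sum_const, Nat.card_Ico, nsmul_eq_mul, Nat.cast_sub hk]; ring
  constructor <;> linarith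

/-- B16 p.355: "This assumption [g_k ∈ ]0,γ]] follows from the basic inequality (0.31)": indeed the LOWER half of
(0.31) with a nonnegative running coefficient and `0 < g ≤ γ` forces `g_k ≤ γ` (given `g_k > 0`). [cite: Balaban1987RG1, Thm 2 p.259] -/
theorem inInterval_of_discrete031 {K : ℕ} {g : ℕ → ℝ} {b β' gK γ : ℝ} (hb : 0 ≤ b) (hg : 0 < gK)
    (hgγ : gK ≤ γ) (hpos : ∀ k, k ≤ K → 0 < g k) (h : Discrete031 b β' K gK g) :
    InInterval γ K g := by
  intro k hk
  refine ⟨hpos k hk, ?_⟩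
  have hk0 : 0 < g k := hpos k hk
  have hKk : (0 : ℝ) ≤ (K : ℝ) - k := by
    have : (k : ℝ) ≤ K := by exact_mod_cast hk
    linarith
  have h1 : 1 / gK ^ 2 ≤ 1 / (g k) ^ 2 := by
    have := (h k hk).1
    nlinarith [mul_nonneg hb hKk]
  have h2 : (g k) ^ 2 ≤ gK ^ 2 := by
    rwa [one_div_le_one_div (by positivity) (by positivity)] at h1
  have h3 : g k ≤ gK := (pow_le_pow_iff_left₀ (le_of_lt hk0) (le_of_lt hg) (by norm_num : (2:ℕ) ≠ 0)).1 h2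
  linarith

/-- For `ε = L^{-K}` and `k ≤ K`: `log (L^k ε)⁻¹ = (K − k) log L` (B12 p.259: K = log_L ε⁻¹). [folklore] -/
theorem log_scale_eq {L : ℕ} (hL : 1 < L) {K k : ℕ} (hk : k ≤ K) :
    Real.log (((L : ℝ) ^ k * ((L : ℝ) ^ K)⁻¹)⁻¹) = ((K : ℝ) - k) * Real.log L := by
  have hL0 : (0 : ℝ) < L := by exact_mod_cast (lt_trans Nat.zero_lt_one hL)
  have hLk : (0 : ℝ) < (L : ℝ) ^ k := pow_pos hL0 k
  have hrew : ((L : ℝ) ^ k * ((L : ℝ) ^ K)⁻¹)⁻¹ = (L : ℝ) ^ (K - k) := by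
    rw [mul_inv, inv_inv, pow_sub₀ _ (ne_of_gt hL0) hk]
    ring
  rw [hrew, Real.log_pow, Nat.cast_sub hk]

/-- (0.31) as printed, with `ε = L^{-K}`, is the discrete form with coefficients `β log L`, `β' log L`. [cite: Balaban1987RG1, (0.31) p.259] -/
theorem Ineq031_iff_discrete031 {L : ℕ} (hL : 1 < L) (K : ℕ) (βlo βhi g : ℝ) (gs : ℕ → ℝ) :
    Ineq031 L (((L : ℝ) ^ K)⁻¹) K βlo βhi g gs ↔
      Discrete031 (βlo * Real.log L) (βhi * Real.log L) K g gs := by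
  unfold Ineq031 Discrete031
  constructor
  · intro h k hk
    have := h k hk
    rw [log_scale_eq hL hk] at this
    constructor <;> nlinarith [this.1, this.2]
  · intro h k hk
    have := h k hk
    rw [log_scale_eq hL hk]
    constructor <;> nlinarith [this.1, this.2]

/-! ## The geometric sum behind B12 (0.30) and B14 (2.45)

`Σ_{i<n} r^i ≤ (1 − r)⁻¹` for `0 ≤ r < 1` — the step `Σ_{j=1}^{n} (L^{j−n})^β < (1 − L^{−β})^{−1}` of B14 (2.45) p.263 and
`Σ_j L^{-α(k-j)} ≤ (1−L^{-α})^{-1}` of B12 (0.30) p.258 — is the landed sibling lemma `B14.geomStep_245` (module `B14` of this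
directory); it is not restated here (see IMPORTS AND SIBLINGS in the module docstring). -/

/-! ## B12 Theorem 2 reduced to properties of the β-functions (elementary real analysis)

B12 Thm 2 (p.259, d = 4, G = SU(2)) asserts: for γ, g small there is a bare coupling g₀ = g₀(ε,g) with all
g_k ∈ ]0,γ], g_K = g, and (0.31).  Its proof is not in print (GAPS G1).  The two theorems below show, at the
kernel level, that the WHOLE statement follows from (0.20) read as the definition of the flow plus three
properties of the family β_{k+1} on ]0,γ]: continuity, an upper bound β' (both asserted on B12 p.264 as part of
the inductive hypotheses (1.22) covered by Thm 3), and a POSITIVE LOWER BOUND b (asymptotic freedom) — which is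
the one input nowhere asserted in B12–B16.  So the unpublished content of Thm 2 is localized to `BetaLower b γ β`
with b > 0 (STEP.md §4, §9). -/

/-- One backward step of (0.20): given `y₁ = 1/g_{k+1}² ≥ 1/γ²`, a continuous `βf` with `b ≤ βf ≤ β'` on ]0,γ]
(b > 0) admits `y₀ ∈ [y₁ + b, y₁ + β']` with `y₀ = y₁ + βf(y₀^{-1/2})`, i.e. `1/g_k² = 1/g_{k+1}² + βf(g_k)`
with `g_k = y₀^{-1/2}` (intermediate value theorem). [folklore] -/
theorem exists_prev_inv_sq {βf : ℝ → ℝ} {γ b β' y₁ : ℝ} (hγ : 0 < γ) (hb : 0 < b) (hbβ : b ≤ β')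
    (hcont : ContinuousOn βf (Set.Ioc 0 γ))
    (hlo : ∀ x, 0 < x → x ≤ γ → b ≤ βf x) (hhi : ∀ x, 0 < x → x ≤ γ → βf x ≤ β')
    (hy₁ : 1 / γ ^ 2 ≤ y₁) :
    ∃ y₀, y₁ + b ≤ y₀ ∧ y₀ ≤ y₁ + β' ∧ y₀ = y₁ + βf (1 / Real.sqrt y₀) := by
  set F : ℝ → ℝ := fun y => y - βf (1 / Real.sqrt y) with hF
  have hy₁pos : 0 < y₁ := lt_of_lt_of_le (by positivity) hy₁
  have dom : ∀ y, y₁ ≤ y → 0 < 1 / Real.sqrt y ∧ 1 / Real.sqrt y ≤ γ := by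
    intro y hy
    have hypos : 0 < y := lt_of_lt_of_le hy₁pos hy
    have hs : 0 < Real.sqrt y := Real.sqrt_pos.mpr hypos
    refine ⟨by positivity, ?_⟩
    rw [div_le_iff₀ hs]
    have h1 : 1 / γ ≤ Real.sqrt y := by
      rw [show 1 / γ = Real.sqrt ((1 / γ) ^ 2) by rw [Real.sqrt_sq (by positivity)]]
      apply Real.sqrt_le_sqrt
      calc (1 / γ) ^ 2 = 1 / γ ^ 2 := by ring
        _ ≤ y₁ := hy₁
        _ ≤ y := hy
    calc (1 : ℝ) = γ * (1 / γ) := by field_simp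
      _ ≤ γ * Real.sqrt y := mul_le_mul_of_nonneg_left h1 (le_of_lt hγ)
  have hcF : ContinuousOn F (Set.Icc (y₁ + b) (y₁ + β')) := by
    apply ContinuousOn.sub continuousOn_id
    have hinner : ContinuousOn (fun y : ℝ => 1 / Real.sqrt y) (Set.Icc (y₁ + b) (y₁ + β')) := by
      apply ContinuousOn.div continuousOn_const Real.continuous_sqrt.continuousOn
      intro y hy
      have : 0 < y := by linarith [hy.1]
      exact ne_of_gt (Real.sqrt_pos.mpr this)
    refine hcont.comp hinner ?_
    intro y hy
    have hy' : y₁ ≤ y := by linarith [hy.1]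
    exact ⟨(dom y hy').1, (dom y hy').2⟩
  have hab : y₁ + b ≤ y₁ + β' := by linarith
  have hFa : F (y₁ + b) ≤ y₁ := by
    have hd := dom (y₁ + b) (by linarith)
    have := hlo _ hd.1 hd.2
    simp only [hF]; linarith
  have hFb : y₁ ≤ F (y₁ + β') := by
    have hd := dom (y₁ + β') (by linarith [lt_of_lt_of_le hb hbβ])
    have := hhi _ hd.1 hd.2
    simp only [hF]; linarith
  obtain ⟨y₀, hy₀mem, hy₀F⟩ := intermediate_value_Icc hab hcF ⟨hFa, hFb⟩
  refine ⟨y₀, hy₀mem.1, hy₀mem.2, ?_⟩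
  simp only [hF] at hy₀F
  linarith

/-- **B12 Thm 2 ⇐ (continuity ∧ b ≤ β_j ≤ β' on ]0,γ], b > 0).**  For every number of steps K and every
renormalized coupling `g ∈ ]0,γ]` there is a trajectory `g_0,…,g_K` with `g_K = g` solving (0.20), contained in
]0,γ], and obeying the discrete (0.31) with coefficients b, β'.  (g₀ = g_0 is "g₀(ε,g)", ε = L^{-K}.)
Uniqueness is not claimed (nor is it in B12). [cite: Balaban1987RG1, Thm 2 p.259] -/
theorem couplingTrajectory_exists (β : ℕ → ℝ → ℝ) {γ b β' : ℝ} (hγ : 0 < γ) (hb : 0 < b) (hbβ : b ≤ β')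
    (hcont : ∀ j, ContinuousOn (β j) (Set.Ioc 0 γ)) (hL : BetaLower b γ β) (hU : BetaUpper β' γ β) :
    ∀ (K : ℕ) (g : ℝ), 0 < g → g ≤ γ →
      ∃ gs : ℕ → ℝ, gs K = g ∧ RGEq K β gs ∧ InInterval γ K gs ∧ Discrete031 b β' K g gs := by
  intro K
  induction K with
  | zero =>
    intro g hg hgγ
    refine ⟨fun _ => g, rfl, ?_, ?_, ?_⟩
    · intro k hk; exact absurd hk (Nat.not_lt_zero k)
    · intro k _; exact ⟨hg, hgγ⟩
    · intro k hk
      have hk0 : k = 0 := Nat.le_zero.mp hk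
      subst hk0
      simp
  | succ K ih =>
    intro g hg hgγ
    have hy₁ : 1 / γ ^ 2 ≤ 1 / g ^ 2 := by
      apply one_div_le_one_div_of_le (by positivity)
      exact pow_le_pow_left₀ (le_of_lt hg) hgγ 2
    obtain ⟨y₀, hy₀lo, hy₀hi, hy₀eq⟩ :=
      exists_prev_inv_sq (βf := β (K + 1)) hγ hb hbβ (hcont (K + 1)) (hL (K + 1)) (hU (K + 1)) hy₁
    have hg2 : 0 < 1 / g ^ 2 := by positivity
    have hy₀pos : 0 < y₀ := by linarith
    have hsq : 0 < Real.sqrt y₀ := Real.sqrt_pos.mpr hy₀pos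
    set gK : ℝ := 1 / Real.sqrt y₀ with hgK
    have hgKpos : 0 < gK := by rw [hgK]; positivity
    have hgK2 : gK ^ 2 = 1 / y₀ := by rw [hgK, div_pow, one_pow, Real.sq_sqrt (le_of_lt hy₀pos)]
    have hgKsq : 1 / gK ^ 2 = y₀ := by rw [hgK2, one_div_one_div]
    have hgKγ : gK ≤ γ := by
      have h1 : 1 / γ ^ 2 ≤ 1 / gK ^ 2 := by rw [hgKsq]; linarith
      have h2 : gK ^ 2 ≤ γ ^ 2 := by
        rwa [one_div_le_one_div (by positivity) (by positivity)] at h1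
      exact (pow_le_pow_iff_left₀ (le_of_lt hgKpos) (le_of_lt hγ) (by norm_num : (2:ℕ) ≠ 0)).1 h2
    obtain ⟨gs', hK', hRG', hI', hD'⟩ := ih gK hgKpos hgKγ
    refine ⟨fun k => if k ≤ K then gs' k else g, ?_, ?_, ?_, ?_⟩
    · simp
    · intro k hk
      have hkK : k ≤ K := Nat.lt_succ_iff.mp hk
      by_cases hk' : k + 1 ≤ K
      · simp only [hkK, hk', if_true]
        exact hRG' k (Nat.lt_of_succ_le hk')
      · have hkeq : k = K := by omega
        subst hkeq
        simp only [le_refl, if_true, hk', if_false]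
        rw [hK', hgKsq]
        exact hy₀eq
    · intro k hk
      by_cases hkK : k ≤ K
      · simp only [hkK, if_true]; exact hI' k hkK
      · simp only [hkK, if_false]; exact ⟨hg, hgγ⟩
    · intro k hk
      by_cases hkK : k ≤ K
      · simp only [hkK, if_true]
        have hd := hD' k hkK
        rw [hgKsq] at hd
        have e1 : (((K + 1 : ℕ) : ℝ) - k) = ((K : ℝ) - k) + 1 := by push_cast; ring
        rw [e1]
        have e2 : b * (((K : ℝ) - k) + 1) = b * ((K : ℝ) - k) + b := by ring
        have e3 : β' * (((K : ℝ) - k) + 1) = β' * ((K : ℝ) - k) + β' := by ring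
        rw [e2, e3]
        constructor <;> linarith [hd.1, hd.2]
      · have hkeq : k = K + 1 := by omega
        subst hkeq
        simp only [hkK, if_false, sub_self, mul_zero, add_zero, le_refl, and_self]

/-! ## What (0.31) alone gives for B14 (2.6d), and the summability behind B14 (2.46) -/

/-- From the discrete (0.31) ALONE (no sign information on individual β_j) one gets only a RATIO bound
`g_m² ≤ (β'/b) g_n²` for m ≤ n ≤ K — not B14's `g_m ≤ (1+β_0) g_n` with β_0 arbitrarily small (that needs
`BetaLower 0`, see `B14_2_6d_of_betaNonneg`). [cite: Balaban1988Convergent, (2.6) p.255] -/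
theorem ratio_bound_of_discrete031 {K : ℕ} {g : ℕ → ℝ} {b β' gK : ℝ} (hb : 0 < b) (hbβ : b ≤ β')
    (hg : 0 < gK) (hpos : ∀ k, k ≤ K → 0 < g k) (h : Discrete031 b β' K gK g) {m n : ℕ} (hmn : m ≤ n)
    (hn : n ≤ K) : b * (g m) ^ 2 ≤ β' * (g n) ^ 2 := by
  have hm := (h m (le_trans hmn hn)).1   -- 1/gK² + b(K-m) ≤ 1/g_m²
  have hn' := (h n hn).2                  -- 1/g_n² ≤ 1/gK² + β'(K-n)
  have hgm : 0 < g m := hpos m (le_trans hmn hn)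
  have hgn : 0 < g n := hpos n hn
  have hmn' : ((m : ℝ)) ≤ n := by exact_mod_cast hmn
  have hKn : (0 : ℝ) ≤ (K : ℝ) - n := by
    have : (n : ℝ) ≤ K := by exact_mod_cast hn
    linarith
  -- b / g_n² ≤ β' / g_m²
  have hβ'0 : 0 ≤ β' := le_trans (le_of_lt hb) hbβ
  have hgK2 : 0 < 1 / gK ^ 2 := by positivity
  have hKm : (K : ℝ) - n ≤ (K : ℝ) - m := by linarith
  have h1 : b * (1 / (g n) ^ 2) ≤ β' * (1 / (g m) ^ 2) :=
    calc b * (1 / (g n) ^ 2) ≤ b * (1 / gK ^ 2 + β' * ((K : ℝ) - n)) :=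
          mul_le_mul_of_nonneg_left hn' (le_of_lt hb)
      _ = b * (1 / gK ^ 2) + β' * (b * ((K : ℝ) - n)) := by ring
      _ ≤ β' * (1 / gK ^ 2) + β' * (b * ((K : ℝ) - n)) := by
          have := mul_le_mul_of_nonneg_right hbβ (le_of_lt hgK2)
          linarith
      _ = β' * (1 / gK ^ 2 + b * ((K : ℝ) - n)) := by ring
      _ ≤ β' * (1 / gK ^ 2 + b * ((K : ℝ) - m)) := by
          apply mul_le_mul_of_nonneg_left _ hβ'0
          have := mul_le_mul_of_nonneg_left hKm (le_of_lt hb)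
          linarith
      _ ≤ β' * (1 / (g m) ^ 2) := mul_le_mul_of_nonneg_left hm hβ'0
  have hgm2 : 0 < (g m) ^ 2 := by positivity
  have hgn2 : 0 < (g n) ^ 2 := by positivity
  have h2 : b * (1 / (g n) ^ 2) * ((g n) ^ 2 * (g m) ^ 2) ≤ β' * (1 / (g m) ^ 2) * ((g n) ^ 2 * (g m) ^ 2) :=
    mul_le_mul_of_nonneg_right h1 (by positivity)
  have e1 : b * (1 / (g n) ^ 2) * ((g n) ^ 2 * (g m) ^ 2) = b * (g m) ^ 2 := by field_simp
  have e2 : β' * (1 / (g m) ^ 2) * ((g n) ^ 2 * (g m) ^ 2) = β' * (g n) ^ 2 := by field_simp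
  linarith [h2, e1, e2]

/-- Termwise telescoping inequality: for `w, b > 0`, `1/(w+b)³ ≤ (1/(2b))·(1/w² − 1/(w+b)²)`. [folklore] -/
theorem inv_cube_le_telescope {w b : ℝ} (hw : 0 < w) (hb : 0 < b) :
    1 / (w + b) ^ 3 ≤ (1 / (2 * b)) * (1 / w ^ 2 - 1 / (w + b) ^ 2) := by
  have hw0 : w ≠ 0 := ne_of_gt hw
  have hb0 : b ≠ 0 := ne_of_gt hb
  have hwb : w + b ≠ 0 := by positivity
  rw [← sub_nonneg]
  have e : (1 / (2 * b)) * (1 / w ^ 2 - 1 / (w + b) ^ 2) - 1 / (w + b) ^ 3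
      = (3 * w * b + b ^ 2) / (2 * w ^ 2 * (w + b) ^ 3) := by
    field_simp
    ring
  rw [e]
  positivity

/-- Summability from ASYMPTOTIC-FREEDOM running: if `1/g_j² ≥ y + b·(n − j)` for j ≤ n (y = 1/g_n², b > 0) —
which is what (0.20) with `β_j ≥ b > 0` gives — then `Σ_{j<n} g_j⁶ ≤ 1/(2 b y²) = g_n⁴/(2b)`.  This (plus
`g_j ≤ (1+β_0) g_n`) is the estimate behind the middle inequality of B14 (2.46) p.263,
`Σ_{j=1}^{n} g_j^{κ_0} < g_n^{κ_0−6}` "for κ_0 ≥ 7 and g sufficiently small". [cite: Balaban1988Convergent, (2.46) p.263] -/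
theorem sum_sixth_powers_le {n : ℕ} {g : ℕ → ℝ} {y b : ℝ} (hy : 0 < y) (hb : 0 < b)
    (hpos : ∀ j, j < n → 0 < g j)
    (hrun : ∀ j, j < n → y + b * ((n : ℝ) - j) ≤ 1 / (g j) ^ 2) :
    ∑ j ∈ Finset.range n, (g j) ^ 6 ≤ 1 / (2 * b * y ^ 2) := by
  -- reindex i = n - 1 - j is awkward; instead bound each term by 1/(y + b(n-j))³ and compare with the
  -- telescoping family f i = 1/(y + b i)², i = n - j - 1 … ; we use the crude monotone re-summation:
  -- Σ_{j<n} 1/(y + b (n-j))³ = Σ_{i<n} 1/(y + b (i+1))³.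
  have hterm : ∀ j ∈ Finset.range n, (g j) ^ 6 ≤ 1 / (y + b * ((n : ℝ) - j)) ^ 3 := by
    intro j hj
    have hjn : j < n := Finset.mem_range.mp hj
    have hgj : 0 < g j := hpos j hjn
    have hr := hrun j hjn
    have hq : 0 < y + b * ((n : ℝ) - j) := by
      have : (j : ℝ) < n := by exact_mod_cast hjn
      nlinarith
    -- (g j)^2 ≤ 1/(y + b(n-j))
    have h2 : (g j) ^ 2 ≤ 1 / (y + b * ((n : ℝ) - j)) := by
      rw [le_div_iff₀ hq]
      have := mul_le_mul_of_nonneg_left hr (le_of_lt (pow_pos hgj 2))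
      have e : (g j) ^ 2 * (1 / (g j) ^ 2) = 1 := by field_simp
      nlinarith [this, e]
    calc (g j) ^ 6 = ((g j) ^ 2) ^ 3 := by ring
      _ ≤ (1 / (y + b * ((n : ℝ) - j))) ^ 3 :=
          pow_le_pow_left₀ (by positivity) h2 3
      _ = 1 / (y + b * ((n : ℝ) - j)) ^ 3 := by rw [one_div_pow]
  have hreindex : ∑ j ∈ Finset.range n, 1 / (y + b * ((n : ℝ) - j)) ^ 3
      = ∑ i ∈ Finset.range n, 1 / (y + b * ((i : ℝ) + 1)) ^ 3 := by
    rw [← Finset.sum_range_reflect]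
    apply Finset.sum_congr rfl
    intro i hi
    have hin : i < n := Finset.mem_range.mp hi
    have : ((n - 1 - i : ℕ) : ℝ) = (n : ℝ) - 1 - i := by
      rw [Nat.cast_sub (by omega), Nat.cast_sub (by omega)]; push_cast; ring
    rw [this]
    ring_nf
  set f : ℕ → ℝ := fun i => 1 / (y + b * (i : ℝ)) ^ 2 with hf
  have hstep : ∀ i ∈ Finset.range n,
      1 / (y + b * ((i : ℝ) + 1)) ^ 3 ≤ (1 / (2 * b)) * (f i - f (i + 1)) := by
    intro i _
    have hw : 0 < y + b * (i : ℝ) := by positivity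
    have := inv_cube_le_telescope hw hb
    simp only [hf]
    push_cast
    have e : y + b * ((i : ℝ) + 1) = (y + b * (i : ℝ)) + b := by ring
    rw [e]
    exact this
  calc ∑ j ∈ Finset.range n, (g j) ^ 6
      ≤ ∑ j ∈ Finset.range n, 1 / (y + b * ((n : ℝ) - j)) ^ 3 := Finset.sum_le_sum hterm
    _ = ∑ i ∈ Finset.range n, 1 / (y + b * ((i : ℝ) + 1)) ^ 3 := hreindex
    _ ≤ ∑ i ∈ Finset.range n, (1 / (2 * b)) * (f i - f (i + 1)) := Finset.sum_le_sum hstep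
    _ = (1 / (2 * b)) * (f 0 - f n) := by rw [← Finset.mul_sum, Finset.sum_range_sub']
    _ ≤ (1 / (2 * b)) * f 0 := by
        have : 0 ≤ f n := by simp only [hf]; positivity
        have : 0 ≤ 1 / (2 * b) := by positivity
        nlinarith
    _ = 1 / (2 * b * y ^ 2) := by
        simp only [hf, Nat.cast_zero, mul_zero, add_zero]
        field_simp

/-- NEGATIVE bookkeeping fact (census): the interval hypothesis ALONE does not give the middle inequality of
B14 (2.46), `Σ_{j=1}^{n} g_j^{κ_0} < g_n^{κ_0−6}`, uniformly in n: the constant sequence g_j = 1/2 ∈ ]0, 1/2]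
violates it with κ_0 = 7 at n = 65 (65·2⁻⁷ > 2⁻¹).  Hence (2.46) consumes running/summability information
on {g_j} — i.e. (2.6) together with (0.31)-type decay — not only `g_j ∈ ]0,γ]` (STEP.md §6, §9). [cite: Balaban1988Convergent, (2.46) p.263] -/
theorem interval_hyp_not_sufficient_for_2_46 :
    ¬ (∀ (g : ℕ → ℝ) (n : ℕ), (∀ j, 0 < g j ∧ g j ≤ 1 / 2) →
        ∑ j ∈ Finset.Icc 1 n, (g j) ^ 7 < (g n) ^ (7 - 6)) := by
  intro h
  have := h (fun _ => 1 / 2) 65 (fun _ => ⟨by norm_num, le_rfl⟩)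
  simp only [Finset.sum_const, Nat.card_Icc, nsmul_eq_mul] at this
  norm_num at this


/-! ## A′. Agreement with `Flow` (Setup §9): the raw-sequence predicates ARE the Setup ones -/

section Bridge

/-- The raw-sequence predicate `RGEq` IS Setup's `Flow.SatisfiesRG` (by `Iff.rfl`). [folklore] -/
theorem rgEq_iff (F : Flow) (K : ℕ) : F.SatisfiesRG K ↔ RGEq K F.β F.g := Iff.rfl

/-- The raw-sequence predicate `InInterval` IS Setup's `Flow.InInterval` (by `Iff.rfl`). [folklore] -/
theorem inInterval_iff (F : Flow) (γ : ℝ) (K : ℕ) : F.InInterval γ K ↔ InInterval γ K F.g := Iff.rfl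

/-- `ε = L^{-K}`, i.e. `Params.eps = ((L:ℝ)^K)⁻¹` ("hence ε = L^{−K}", B12 p.256). [cite: Balaban1987RG1, §0 p.256] -/
theorem eps_eq_inv_pow (P : Params) : P.eps = ((P.L : ℝ) ^ P.K)⁻¹ := by
  simp [Params.eps, inv_pow]

/-- Setup's `Flow.LogRunning F P g β β'` (B12 (0.31) verbatim, with `ε = L^{-K}`) is the per-step form
`Discrete031 (β log L) (β' log L) K g F.g`. [cite: Balaban1987RG1, (0.31) p.259] -/
theorem logRunning_iff_discrete031 (F : Flow) (P : Params) (g β β' : ℝ) :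
    F.LogRunning P g β β' ↔ Discrete031 (β * Real.log P.L) (β' * Real.log P.L) P.K g F.g := by
  have hL : 1 < P.L := P.hL.2
  have h1 : F.LogRunning P g β β' ↔ Ineq031 P.L (((P.L : ℝ) ^ P.K)⁻¹) P.K β β' g F.g := by
    unfold Flow.LogRunning Ineq031
    rw [eps_eq_inv_pow]
  rw [h1]
  exact Ineq031_iff_discrete031 hL P.K β β' g F.g

/-- B12 Thm 2, elementary core, in Setup vocabulary: continuity and `0 < b ≤ β_j ≤ β'` on `]0,γ]` give, for every
`K` and renormalized `g ∈ ]0,γ]`, a flow with `g_K = g` satisfying the RG equations, the interval condition and the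
discrete two-sided running (0.31). [cite: Balaban1987RG1, Thm 2 p.259] -/
theorem flow_exists_of_betaBounds (β : ℕ → ℝ → ℝ) {γ b β' : ℝ} (hγ : 0 < γ) (hb : 0 < b) (hbβ : b ≤ β')
    (hcont : ∀ j, ContinuousOn (β j) (Set.Ioc 0 γ)) (hL : BetaLower b γ β) (hU : BetaUpper β' γ β)
    (K : ℕ) (g : ℝ) (hg : 0 < g) (hgγ : g ≤ γ) :
    ∃ F : Flow, F.β = β ∧ F.g K = g ∧ F.SatisfiesRG K ∧ F.InInterval γ K ∧ Discrete031 b β' K g F.g := by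
  obtain ⟨gs, hK, hrg, hI, hD⟩ := couplingTrajectory_exists β hγ hb hbβ hcont hL hU K g hg hgγ
  exact ⟨⟨gs, β⟩, rfl, hK, hrg, hI, hD⟩

end Bridge

/-!
# Part B — the data carried from scale `k` to `k+1` and the inductive bounds
-/


/-! ## B1. The small-field tower (B12 §1, (1.1)–(1.22)) -/

/-- The data of ALL scales of the small-field induction (B12 §1), indexed by `j : ℕ` (only `j ≤ k` is
meaningful after `k` steps — "In the second step a new expression of this type is created, in the old only a
background field is changed" B12 p.256 (0.23), so the data is CUMULATIVE and one record serves every `k`):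
* `flow` : the couplings `g_j` and β-functions `β_j` (B12 (0.18), (0.20), (1.22));
* `sys j` : the localization domains `D_j` with tree length `d_j` (B12 p.257);
* `E j X g φ` : the localized term `E^{(j)}(X, g_{j-1}, 𝐔, 𝐉)` (B12 (1.7)–(1.9)), a function of the coupling
  `g = g_{j-1} ∈ [0,γ]` and of a (complex) configuration pair `φ = (𝐔, 𝐉)` of the abstract type `Φ`
  (the `η`-lattice `T_η` carries all of them: DIVERGENCE D-f2.1);
* `space j X α₀ α₁` : the analyticity domain `U^c_j(X, α₀, α₁)` (B12 p.262 (i)–(iv), with `γ₀ = α₀`, p.263);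
* `ofBackground` : `U ↦ (U, J(U))`, `J_j = D^{ξ*}_{U_j} ξ^{-2} π Im ∂U_j` (B12 (1.8)–(1.9)), so that
  `E^{(j)}(X, g_{j-1}, U_j) = E^{(j)}(X, g_{j-1}, U_j, J_j)`;
* `act` : the action of (`Gᶜ`-valued) gauge transformations `u` on pairs, `(𝐔,𝐉)^u = (𝐔^u, R(u)𝐉)` (B12 (1.10)),
  over an abstract group `𝒢`;
* `logZ j` : `log Z^{(j)}(U)` of the Gaussian normalization (B12 (1.4)–(1.5)), `j = 0, …, k-1`. [cite: Balaban1987RG1, (1.3)–(1.10) p.260–262] -/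
structure SFTower (P : Params) (G : Type*) [GaugeGroup G] (Φ : Type*) (𝒢 : Type*) where
  flow : Flow
  sys : ℕ → LocDomainSys
  E : (j : ℕ) → (sys j).Dom → ℝ → Φ → ℂ
  space : (j : ℕ) → (sys j).Dom → ℝ → ℝ → Set Φ
  ofBackground : GaugeField P 0 G → Φ
  act : 𝒢 → Φ → Φ
  agreeOn : (j : ℕ) → (sys j).Dom → Φ → Φ → Prop
  logZ : ℕ → GaugeField P 0 G → ℝ

namespace SFTower

variable {P : Params} {G : Type*} [GaugeGroup G] {Φ 𝒢 : Type*}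

/-- `𝐄^{(j)}(g_{j-1}, φ) = Σ_{X ∈ D_j} 𝐄^{(j)}(X, g_{j-1}, φ)` (B12 (1.7)). [cite: Balaban1987RG1, (1.7) p.261] -/
noncomputable def Etot (T : SFTower P G Φ 𝒢) (j : ℕ) (g : ℝ) (φ : Φ) : ℂ := ∑ X : (T.sys j).Dom, T.E j X g φ

/-- THE FORM (1.3) of the `k`-th small-field effective action as a function of the background field
`U_k` on `T_η` (B12 p.260, verbatim in STEP.md §3):
`A_k(U_k) = -(1/g_k²) A(U_k) + Σ_{j=0}^{k-1} { -β_{j+1}(g_j) A(U_k) + [log Z^{(j)}(U_k) - log Z^{(j)}(1)]`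
`+ [E^{(j+1)}(g_j, U_k) - E^{(j+1)}(g_j, 1)] }` (the last superscript is printed `(j+k)` in (1.3) and `(j+1)`
in (1.6); typed `(j+1)`, DIVERGENCE D-f2.3).  `A` = the `d = 4` Wilson action `wilsonAction4` (B12 (0.2),
DIVERGENCE F10); real parts are taken because the terms are real on real configurations (B12 p.261). [cite: Balaban1987RG1, (1.3) p.260] -/
noncomputable def action13 (T : SFTower P G Φ 𝒢) (k : ℕ) (U : GaugeField P 0 G) : ℝ :=
  -(1 / (T.flow.g k) ^ 2) * wilsonAction4 U
  + ∑ j ∈ Finset.range k,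
      ( -(T.flow.β (j+1) (T.flow.g j)) * wilsonAction4 U
        + (T.logZ j U - T.logZ j 1)
        + ((T.Etot (j+1) (T.flow.g j) (T.ofBackground U)).re
            - (T.Etot (j+1) (T.flow.g j) (T.ofBackground 1)).re) )

/-- THE FORM (1.6) = (0.22)–(0.23): the same without separating the zeroth-order terms `log Z^{(j)}`
(B12 p.261: "In many considerations it is not necessary to separate the terms of zeroth order"). [cite: Balaban1987RG1, (1.6) p.261] -/
noncomputable def action16 (T : SFTower P G Φ 𝒢) (k : ℕ) (U : GaugeField P 0 G) : ℝ :=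
  -(1 / (T.flow.g k) ^ 2) * wilsonAction4 U
  + ∑ j ∈ Finset.range k,
      ( -(T.flow.β (j+1) (T.flow.g j)) * wilsonAction4 U
        + ((T.Etot (j+1) (T.flow.g j) (T.ofBackground U)).re
            - (T.Etot (j+1) (T.flow.g j) (T.ofBackground 1)).re) )

/-- `𝐄_k(U_k) = Σ_{j=1}^{k} [ -β_j(g_{j-1}) A^η(U_k) + 𝐄^{(j)}(U_k) ]` (B12 (0.23) p.256), in the (1.6) reading
with the vacuum subtraction `𝐄^{(j)}(1) = 0` made explicit (B12 p.258). [cite: Balaban1987RG1, (0.23) p.256] -/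
noncomputable def Ek (T : SFTower P G Φ 𝒢) (k : ℕ) (U : GaugeField P 0 G) : ℝ :=
  ∑ j ∈ Finset.range k,
      ( -(T.flow.β (j+1) (T.flow.g j)) * wilsonAction4 U
        + ((T.Etot (j+1) (T.flow.g j) (T.ofBackground U)).re
            - (T.Etot (j+1) (T.flow.g j) (T.ofBackground 1)).re) )

/-- (0.22)/(1.6): `A_k(U_k) = −(1/g_k²) A(U_k) + 𝐄_k(U_k)` with `𝐄_k` the sum (0.23) — definitional. [cite: Balaban1987RG1, (0.22) p.256] -/
theorem action16_eq (T : SFTower P G Φ 𝒢) (k : ℕ) (U : GaugeField P 0 G) :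
    T.action16 k U = -(1 / (T.flow.g k) ^ 2) * wilsonAction4 U + T.Ek k U := rfl

end SFTower

/-- Constants of the small-field inductive hypotheses (B12 Thm 3 p.264: "There exist positive constants
κ₀, M(κ), γ, ε₀, ε₁, α₀, α₁ …"; `E₀` of (1.18); `β'` = the uniform bound of the β-functions p.264;
`Bc` = "a sufficiently large constant B" of (1.12)).  Roles only; (in)dependences are hypotheses of the theorems. [cite: Balaban1987RG1, Thm 3 p.264] -/
structure SFConsts where
  κ : ℝ
  M : ℕ
  γ : ℝ
  ε₀ : ℝ
  ε₁ : ℝ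
  α₀ : ℝ
  α₁ : ℝ
  E₀ : ℝ
  β' : ℝ
  Bc : ℝ

/-- THE SMALL-FIELD INDUCTIVE HYPOTHESES AT SCALE `k` for the terms `j = 1, …, k` of the tower (B12 §1; the clauses
(1.1)–(1.6), (1.11)–(1.17) concern the background fields / spaces and are carried by `Background`,
`RegularSpace`, `space`; here the clauses ON THE TERMS):
* `localDep` (1.7) p.261 "the term corresponding to a domain X depends on U_j restricted to X";
* `bound118` (1.18) p.263: "|E^{(j)}(X, g_{j-1}, 𝐔, 𝐉)| ≤ E₀ exp(−κ d_j(X)) for M ≥ M(κ), γ sufficiently small, and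
  for all configurations (𝐔,𝐉) ∈ U^c_j(X, α₀, α₁)", for `g_{j-1} ∈ [0, γ]`;
* `gaugeInv119` (1.19) p.263: "E^{(j)}(X, g_{j-1}, 𝐔^u, R(u)𝐉) = E^{(j)}(X, g_{j-1}, 𝐔, 𝐉) for all Gᶜ-valued gauge
  transformations u", and the spaces are gauge invariant;
* `betaSmooth`, `betaBound` p.264: β_{j+1} "is a smooth function defined on the interval [0, γ], (or analytic),
  uniformly bounded on this interval together with all derivatives" (bounds on derivatives not typed: D-f2.5);
* `rg` (2.15) = (0.20): `1/g_j² = 1/g_{j+1}² + β_{j+1}(g_j)`, `j < k` — part of the DEFINITION of the sequence.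
Euclidean covariance (p.263, for the sums over X ∋ z) and analyticity in φ are NOT typed (no complex structure on the
abstract `Φ`; D-f2.1) — they are hypotheses a reader adds by name where a proof consumes them. [cite: Balaban1987RG1, (1.18)–(1.19) p.263] -/
structure SFHyp {P : Params} {G : Type*} [GaugeGroup G] {Φ 𝒢 : Type*} (T : SFTower P G Φ 𝒢) (c : SFConsts)
    (k : ℕ) : Prop where
  rg : ∀ j, j < k → 1 / (T.flow.g j) ^ 2 = 1 / (T.flow.g (j+1)) ^ 2 + T.flow.β (j+1) (T.flow.g j)
  localDep : ∀ j, 1 ≤ j → j ≤ k → ∀ X g φ ψ, T.agreeOn j X φ ψ → T.E j X g φ = T.E j X g ψ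
  bound118 : ∀ j, 1 ≤ j → j ≤ k → ∀ X g φ, 0 ≤ g → g ≤ c.γ → φ ∈ T.space j X c.α₀ c.α₁ →
    ‖T.E j X g φ‖ ≤ c.E₀ * Real.exp (-c.κ * (T.sys j).dj X)
  spaceInv : ∀ j, 1 ≤ j → j ≤ k → ∀ X u φ, φ ∈ T.space j X c.α₀ c.α₁ → T.act u φ ∈ T.space j X c.α₀ c.α₁
  gaugeInv119 : ∀ j, 1 ≤ j → j ≤ k → ∀ X g u φ, T.E j X g (T.act u φ) = T.E j X g φ
  betaSmooth : ∀ j, 1 ≤ j → j ≤ k → ∀ n : ℕ, ContDiffOn ℝ n (T.flow.β j) (Set.Icc 0 c.γ)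
  betaBound : ∀ j, 1 ≤ j → j ≤ k → ∀ x ∈ Set.Icc (0:ℝ) c.γ, |T.flow.β j x| ≤ c.β'

/-- Monotonicity in `k` of the hypotheses (the data is cumulative): `SFHyp T c k → j ≤ k → SFHyp T c j`. [folklore] -/
theorem SFHyp.mono {P : Params} {G : Type*} [GaugeGroup G] {Φ 𝒢 : Type*} {T : SFTower P G Φ 𝒢} {c : SFConsts}
    {k j : ℕ} (h : SFHyp T c k) (hjk : j ≤ k) : SFHyp T c j where
  rg := fun i hi => h.rg i (lt_of_lt_of_le hi hjk)
  localDep := fun i h1 hi => h.localDep i h1 (le_trans hi hjk)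
  bound118 := fun i h1 hi => h.bound118 i h1 (le_trans hi hjk)
  spaceInv := fun i h1 hi => h.spaceInv i h1 (le_trans hi hjk)
  gaugeInv119 := fun i h1 hi => h.gaugeInv119 i h1 (le_trans hi hjk)
  betaSmooth := fun i h1 hi => h.betaSmooth i h1 (le_trans hi hjk)
  betaBound := fun i h1 hi => h.betaBound i h1 (le_trans hi hjk)

/-! ## B2. The step `k → k+1` (B12 §2: (2.1), (2.12)–(2.15)) and the shape of B12 Theorem 3 -/

section StepSF
-- Binders as in the canonical `Setup` (v1.2): `HaarData (G) [GaugeGroup G] [MeasurableSpace G]` takes the measurable structure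
-- as a parameter (review of the Setup proposal p175636, item 2), hence `[MeasurableSpace G] [HaarData G]` below.
variable {P : Params} {G : Type*} [GaugeGroup G] [MeasurableSpace G] [HaarData G] {Φ 𝒢 : Type*}

/-- "The sequence of actions `A_k` defined inductively by the small field renormalization transformations
(0.17)–(0.20)" (B12 Thm 3 p.264), for `k < K`: each `A_{k+1}` is obtained from `A_k` by ONE small-field step
(Setup `SmallFieldStep`: `T_k(χ_k e^{-G/g_k² + A_k}) = N_k e^{A_{k+1}}`, `A_{k+1}(1) = 0`; B12 (0.19)/(2.1)), AND
`A_k` has the form (1.3) of the tower on the background-field domain (B12 (2.12)–(2.14): the step creates exactly one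
new term `E^{(k+1)}` (2.13), `log N''_k = E^{(k+1)}(g_k, 1)` (2.14), followed by the coupling renormalization (2.15)). [cite: Balaban1987RG1, (0.17)–(0.20) p.255–256] -/
structure GeneratedBySmallFieldRT (av : ∀ j, Averaging P j G) (Tk : ∀ k, RTOp P k G (av k))
    (χ GF : ∀ k, Density P k G) (bg : Background P G av) (A : ∀ k, Density P k G)
    (T : SFTower P G Φ 𝒢) (K : ℕ) : Prop where
  step : ∀ k, k < K → SmallFieldStep (Tk k) (χ k) (GF k) (T.flow.g k) (A k) (A (k+1))
  form13 : ∀ k, k ≤ K → ∀ V, V ∈ bg.dom k → A k V = T.action13 k (bg.U k V)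
  rg : T.flow.SatisfiesRG K

/-- SHAPE OF B12 THEOREM 3 (p.264, verbatim in STEP.md §3; the per-paper statement with its constant
dependences is `B12.Thm3Printed`, unit r2): for suitable constants, IF `0 < g_k ≤ γ` for
`k = 0, …, K` THEN the generated sequence satisfies the inductive hypotheses at every `k ≤ K`.  The interval
condition is a HYPOTHESIS (REFEREE R1.1); nothing here asserts the shape is inhabited. [cite: Balaban1987RG1, Thm 3 p.264] -/
def B12Thm3Shape (av : ∀ j, Averaging P j G) (Tk : ∀ k, RTOp P k G (av k)) (χ GF : ∀ k, Density P k G)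
    (bg : Background P G av) (A : ∀ k, Density P k G) (T : SFTower P G Φ 𝒢) (c : SFConsts) (K : ℕ) : Prop :=
  GeneratedBySmallFieldRT av Tk χ GF bg A T K → T.flow.InInterval c.γ K → ∀ k, k ≤ K → SFHyp T c k

end StepSF

/-! ## B3. The complete tower with large fields (B14 §2, (2.1)–(2.42)) -/

/-- Scale-dependent constants of B14 §2: (2.4) `ε_j = g_j A₀ (log g_j⁻²)^{p₀} = g_j p₀(g_j)` (= Setup `epsK`),
(2.28) `α_{0,j} = g_j C₀ (log g_j⁻²)^{q₀}`, `α_{1,j} = g_j C₁ (log g_j⁻²)^{q₁}` ("q₀, q₁ integers greater than 1,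
C₀, C₁ sufficiently large"), and the term constants `κ`, `κ₀` (2.31), `E₀` (I.1.18), `B₀` (2.42); `(2.5) R_j` is
`B14.IsRj` (unit r2). [cite: Balaban1988Convergent, (2.4)/(2.28)/(2.31)/(2.42) p.255–261] -/
structure LFConsts where
  A₀ : ℝ
  p₀ : ℕ
  C₀ : ℝ
  q₀ : ℕ
  C₁ : ℝ
  q₁ : ℕ
  κ : ℝ
  κ₀ : ℕ
  E₀ : ℝ
  B₀ : ℝ
  γ : ℝ

namespace LFConsts
/-- (2.28) `α_{0,j}` as a function of `g_j`. [cite: Balaban1988Convergent, (2.28) p.259] -/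
noncomputable def alpha0 (c : LFConsts) (gj : ℝ) : ℝ := gj * c.C₀ * (Real.log (gj ^ 2)⁻¹) ^ c.q₀
/-- (2.28) `α_{1,j}` as a function of `g_j`. [cite: Balaban1988Convergent, (2.28) p.259] -/
noncomputable def alpha1 (c : LFConsts) (gj : ℝ) : ℝ := gj * c.C₁ * (Real.log (gj ^ 2)⁻¹) ^ c.q₁
end LFConsts

/-- The data of the COMPLETE inductive description (B14 §2) — the three families of localized terms of the
effective action (2.23) `A_k(1/g_k², U_k) = -A(1/g_k², U_k) + 𝐄_k(U_k) + 𝐑_k(U_k) + 𝐁_k(U_k, A) - E_k` (the last-but-one `A` = the system {A_{j-1}} of fluctuation fields, italic in print, not the Wilson action), each scale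
`j` carrying (cumulatively, as in `SFTower`):
* `E j X z g φ` : `E^{(j)}(X, U_k, z)` with the pinning point `z ∈ Λ_j^0` (2.26)–(2.27), coupling `g = g_{j-1}`;
* `R j X φ` : `𝐑^{(j)}(X, U_k)` (2.30);
* `B j X φ a` : `𝐁^{(j)}(X, U_k, A, {S_i ∩ X})` (2.40)–(2.41), `a` = the fluctuation fields and the `S`-data, abstract type `𝔄`;
* `space j X α₀ α₁` : `U^c_j(X, α_{0,j}, α_{1,j})` (p.259 (ii)); `spaceB j X` : `Ũ^c_j(X, α̃₀, α̃₁)` (2.34)–(2.39);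
* `flow`, `sys`, `act`, `agreeOn` as in `SFTower`; `Pt j` = the points `z` of `T_1^{(j)}`.
The admissible sequences of domains `{Ω_j}, {Λ_j}, {S_j}` (2.1)–(2.3), the operations `𝐓_k` (2.18)–(2.22), the
localized coupling `g_j²(x)` (2.24) and the constants `E_k` are READER-LEVEL (unit r2, B14.lean/B15.lean/B16.lean):
they enter the bounds below only through the abstract volumes `|Γ_n ∩ Ω|` (cf. `B14.Sect2Data`, unit r2). [cite: Balaban1988Convergent, (2.23)–(2.42) p.258–261] -/
structure LFTower (P : Params) (G : Type*) [GaugeGroup G] (Φ : Type*) (𝒢 : Type*) (𝔄 : Type*) where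
  flow : Flow
  sys : ℕ → LocDomainSys
  Pt : ℕ → Type
  [finPt : ∀ j, Fintype (Pt j)]
  E : (j : ℕ) → (sys j).Dom → Pt j → ℝ → Φ → ℂ
  R : (j : ℕ) → (sys j).Dom → Φ → ℂ
  B : (j : ℕ) → (sys j).Dom → Φ → 𝔄 → ℂ
  space : (j : ℕ) → (sys j).Dom → ℝ → ℝ → Set Φ
  spaceB : (j : ℕ) → (sys j).Dom → Set Φ
  ofBackground : GaugeField P 0 G → Φ
  act : 𝒢 → Φ → Φ
  agreeOn : (j : ℕ) → (sys j).Dom → Φ → Φ → Prop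

/-- The point sets `T_1^{(j)}`-indices `Pt j` of an `LFTower` are finite (the field `finPt`), registered as an instance so
that the sums `Σ_z` of (2.23) elaborate. [folklore] -/
instance LFTower.instFintypePt {P : Params} {G : Type*} [GaugeGroup G] {Φ 𝒢 𝔄 : Type*} (T : LFTower P G Φ 𝒢 𝔄)
    (j : ℕ) : Fintype (T.Pt j) := T.finPt j

/-- THE INDUCTIVE BOUNDS OF B14 §2 on the terms of scales `j = 1, …, k` (properties (i)–(iv) after (2.27), p.259;
(2.31) p.260; (i)–(iv) after (2.41) and (2.42) p.261), exactly as stated: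
* `boundE` (iv) p.259 = (I.1.18): `|E^{(j)}(X, (𝐔,𝐉), z)| ≤ E₀ exp(−κ d_j(X))` on `U^c_j(X, α_{0,j}, α_{1,j})`;
* `boundR` (2.31): "|𝐑^{(j)}(X, (𝐔,𝐉))| ≤ g_j^{κ₀} exp(−κ d_j(X)). Here κ₀ can be chosen arbitrarily large, similarly as κ";
* `boundB` (2.42): "|𝐁^{(j)}(X, (𝐔,𝐉), A, {S_i ∩ X})| < B₀ exp(−κ d_j(X))" (strict in print; typed `≤`, D-f2.6);
* `gaugeInv` (iii) p.259 / p.261; `localDep` (i);  `rg` (2.24) on the last domain = (I.0.20).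
The IMPROVED bounds for the newly created terms `E^{(k)}, R^{(k)}, B^{(k)}` ("defined on slightly larger spaces …
better decay properties, with the number κ replaced, for example, by (1+4β)κ", p.262) are recorded as the separate
predicate `LFHypImproved`. [cite: Balaban1988Convergent, (2.27)(i)–(iv), (2.31), (2.42) p.259–261] -/
structure LFHyp {P : Params} {G : Type*} [GaugeGroup G] {Φ 𝒢 𝔄 : Type*} (T : LFTower P G Φ 𝒢 𝔄) (c : LFConsts)
    (k : ℕ) : Prop where
  rg : ∀ j, j < k → 1 / (T.flow.g j) ^ 2 = 1 / (T.flow.g (j+1)) ^ 2 + T.flow.β (j+1) (T.flow.g j)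
  localDepE : ∀ j, 1 ≤ j → j ≤ k → ∀ X z g φ ψ, T.agreeOn j X φ ψ → T.E j X z g φ = T.E j X z g ψ
  localDepR : ∀ j, 1 ≤ j → j ≤ k → ∀ X φ ψ, T.agreeOn j X φ ψ → T.R j X φ = T.R j X ψ
  boundE : ∀ j, 1 ≤ j → j ≤ k → ∀ X z g φ, 0 ≤ g → g ≤ c.γ →
    φ ∈ T.space j X (c.alpha0 (T.flow.g j)) (c.alpha1 (T.flow.g j)) →
      ‖T.E j X z g φ‖ ≤ c.E₀ * Real.exp (-c.κ * (T.sys j).dj X)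
  boundR : ∀ j, 1 ≤ j → j ≤ k → ∀ X φ,
    φ ∈ T.space j X (c.alpha0 (T.flow.g j)) (c.alpha1 (T.flow.g j)) →
      ‖T.R j X φ‖ ≤ (T.flow.g j) ^ c.κ₀ * Real.exp (-c.κ * (T.sys j).dj X)
  boundB : ∀ j, 1 ≤ j → j ≤ k → ∀ X φ a, φ ∈ T.spaceB j X →
      ‖T.B j X φ a‖ ≤ c.B₀ * Real.exp (-c.κ * (T.sys j).dj X)
  gaugeInvE : ∀ j, 1 ≤ j → j ≤ k → ∀ X z g u φ, T.E j X z g (T.act u φ) = T.E j X z g φ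
  gaugeInvR : ∀ j, 1 ≤ j → j ≤ k → ∀ X u φ, T.R j X (T.act u φ) = T.R j X φ

/-- The improved bounds for the terms created in the LAST step (B14 p.262): decay rate `(1+4β)κ` instead of `κ`
("for example"), `β` the constant of (2.34)–(2.39) ("e.g., we can take β = 1/4", p.261).  Larger analyticity
spaces are not typed (D-f2.7). [cite: Balaban1988Convergent, §2 p.262] -/
structure LFHypImproved {P : Params} {G : Type*} [GaugeGroup G] {Φ 𝒢 𝔄 : Type*} (T : LFTower P G Φ 𝒢 𝔄)
    (c : LFConsts) (βc : ℝ) (k : ℕ) : Prop where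
  boundE : 1 ≤ k → ∀ X z g φ, 0 ≤ g → g ≤ c.γ →
    φ ∈ T.space k X (c.alpha0 (T.flow.g k)) (c.alpha1 (T.flow.g k)) →
      ‖T.E k X z g φ‖ ≤ c.E₀ * Real.exp (-((1 + 4 * βc) * c.κ) * (T.sys k).dj X)
  boundR : 1 ≤ k → ∀ X φ, φ ∈ T.space k X (c.alpha0 (T.flow.g k)) (c.alpha1 (T.flow.g k)) →
      ‖T.R k X φ‖ ≤ (T.flow.g k) ^ c.κ₀ * Real.exp (-((1 + 4 * βc) * c.κ) * (T.sys k).dj X)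
  boundB : 1 ≤ k → ∀ X φ a, φ ∈ T.spaceB k X →
      ‖T.B k X φ a‖ ≤ c.B₀ * Real.exp (-((1 + 4 * βc) * c.κ) * (T.sys k).dj X)

/-- The improved E-bound at the newest scale (decay rate `(1+4β)κ`, B14 p.262) implies the ordinary one (rate `κ`) when
`β, κ, E₀ ≥ 0` — bookkeeping used when the index `k` becomes an "old" index at the next step. [folklore] -/
theorem LFHypImproved.toWeak_E {P : Params} {G : Type*} [GaugeGroup G] {Φ 𝒢 𝔄 : Type*} {T : LFTower P G Φ 𝒢 𝔄}
    {c : LFConsts} {βc : ℝ} {k : ℕ} (h : LFHypImproved T c βc k) (hβ : 0 ≤ βc) (hκ : 0 ≤ c.κ) (hk : 1 ≤ k)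
    (X : (T.sys k).Dom) (z : T.Pt k) (g : ℝ) (φ : Φ) (hg0 : 0 ≤ g) (hgγ : g ≤ c.γ)
    (hφ : φ ∈ T.space k X (c.alpha0 (T.flow.g k)) (c.alpha1 (T.flow.g k))) (hE₀ : 0 ≤ c.E₀) :
    ‖T.E k X z g φ‖ ≤ c.E₀ * Real.exp (-c.κ * (T.sys k).dj X) := by
  have h1 := h.boundE hk X z g φ hg0 hgγ hφ
  have hd : 0 ≤ (T.sys k).dj X := (T.sys k).dj_nonneg X
  have hexp : Real.exp (-((1 + 4 * βc) * c.κ) * (T.sys k).dj X) ≤ Real.exp (-c.κ * (T.sys k).dj X) := by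
    apply Real.exp_le_exp.mpr
    have : 0 ≤ 4 * βc * c.κ * (T.sys k).dj X := by positivity
    nlinarith
  exact le_trans h1 (mul_le_mul_of_nonneg_left hexp hE₀)

/-- THE FORM (2.23)/(2.25)/(2.30)/(2.40) of the complete effective action, GIVEN the reader-level combinatorial
data abstracted to: the index sets of the sums (which `X`, `z` occur at scale `j` for the given sequences of
domains: `admE j X z`, `admR j X`, `admB j X`, decidable), the smeared Wilson terms `A(φ_j, U)` (2.25) and
`A(1/g_k², U)` with the local coupling (2.24), the fluctuation/`S`-data `a`, and the constant `E_k`: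
`A_k = -A(1/g_k², U_k) + Σ_{j=1}^{k} [Σ_{z,X} (E^{(j)}(X,U_k,z) - E^{(j)}(X,1,z)) - β_j(g_{j-1}) A(φ_j, U_k)]`
`+ Σ_{j=1}^{k} Σ_X [R^{(j)}(X,U_k) - R^{(j)}(X,1)] + Σ_{j=1}^{k} Σ_X B^{(j)}(X, U_k, A, {S_i ∩ X}) - E_k`. [cite: Balaban1988Convergent, (2.23) p.258] -/
structure LFActionData (P : Params) (G : Type*) [GaugeGroup G] {Φ 𝒢 𝔄 : Type*} (T : LFTower P G Φ 𝒢 𝔄) where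
  admE : (j : ℕ) → (T.sys j).Dom → T.Pt j → Bool
  admR : (j : ℕ) → (T.sys j).Dom → Bool
  admB : (j : ℕ) → (T.sys j).Dom → Bool
  wilsonLocal : GaugeField P 0 G → ℝ        -- A(1/g_k², U) with g_k²(x) of (2.24)
  wilsonPhi : ℕ → GaugeField P 0 G → ℝ      -- A(φ_j, U) of (2.25)
  fluct : 𝔄                                 -- (A, {S_i}): fluctuation fields + S-data
  Econst : ℝ                                -- E_k

/-- (2.23) with (2.25), (2.30), (2.40)–(2.41) substituted. [cite: Balaban1988Convergent, (2.23)–(2.25), (2.30), (2.40)–(2.41) p.258–261] -/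
noncomputable def LFActionData.action23 {P : Params} {G : Type*} [GaugeGroup G] {Φ 𝒢 𝔄 : Type*}
    {T : LFTower P G Φ 𝒢 𝔄} (D : LFActionData P G T) (k : ℕ) (U : GaugeField P 0 G) : ℝ :=
  - D.wilsonLocal U
  + ∑ j ∈ Finset.Icc 1 k,
      ( (∑ X : (T.sys j).Dom, ∑ z : T.Pt j,
          if D.admE j X z then ((T.E j X z (T.flow.g (j-1)) (T.ofBackground U)).re
                                - (T.E j X z (T.flow.g (j-1)) (T.ofBackground 1)).re) else 0)
        - T.flow.β j (T.flow.g (j-1)) * D.wilsonPhi j U )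
  + ∑ j ∈ Finset.Icc 1 k, ∑ X : (T.sys j).Dom,
      (if D.admR j X then ((T.R j X (T.ofBackground U)).re - (T.R j X (T.ofBackground 1)).re) else 0)
  + ∑ j ∈ Finset.Icc 1 k, ∑ X : (T.sys j).Dom,
      (if D.admB j X then (T.B j X (T.ofBackground U) D.fluct).re else 0)
  - D.Econst

/-! ## B4. The shapes of B14 Thm 1 / B16 Thm 1 over the tower, and the root template (REFEREE R1.1) -/

section Root
variable {P : Params} {G : Type*} [GaugeGroup G] {Φ 𝒢 𝔄 : Type*}

/-- SHAPE OF B14 THEOREM 1 p.262 / B16 THEOREM 1 p.355 over the tower (per-paper verbatim statements: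
`B14.Thm1Printed`, `B16.Thm1Printed`, unit r2): for suitable constants, IF the couplings
determined by (0.18), (0.20) [I] satisfy the hypothesis "(I.0.33)" — passed as a PARAMETER `H033` because the
reference does not resolve (GAPS G2, DIVERGENCE D2/D2c/D-f2.2: (2.46) consumes more than the interval condition; the
cell's two instantiations are `B14.H033Interval` / `B14.H033LogRunning`, see the note after this definition) — THEN the densities `ρ_k = (𝐑𝐓)^k ρ₀` satisfy the inductive description at every `k ≤ K`; the part of
"the inductive description" that concerns the TERMS is `LFHyp T c k ∧ LFHypImproved T c β k`, the part that
concerns the representation (2.18) of `ρ_k` itself is the reader-level predicate `Repr218 k`. [cite: Balaban1988Convergent, Thm 1 p.262] -/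
def B14Thm1Shape (H033 : Flow → ℕ → Prop) (Repr218 : ℕ → Prop) (T : LFTower P G Φ 𝒢 𝔄) (c : LFConsts)
    (βc : ℝ) (K : ℕ) : Prop :=
  T.flow.SatisfiesRG K → H033 T.flow K → ∀ k, k ≤ K → Repr218 k ∧ LFHyp T c k ∧ LFHypImproved T c βc k

/-! The two candidate readings of "(I.0.33)" (GAPS G2) are the landed sibling instantiations `B14.H033Interval γ`
(the interval condition of B12 Thm 3 / B16 Thm 1) and `B14.H033LogRunning L gR β β'` (the interval condition's source in
print, the two-sided running (0.31) of [I] Thm 2 with `log(L^k ε)⁻¹ = (K−k) log L`; over raw sequences this is Part A's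
`Discrete031 (β log L) (β' log L) K gR F.g`, cf. `logRunning_iff_discrete031`).  They are not restated here (module
docstring, IMPORTS AND SIBLINGS).  Part A's `interval_hyp_not_sufficient_for_2_46` shows the first reading does not
support B14 (2.46); `sum_sixth_powers_le` shows what the second gives (GAPS G-f2.1, DIVERGENCE D-f2.2). -/

/-- ROOT TEMPLATE (REFEREE R1.1; aligned with `Dag.UVStability4D := SmallCouplings → (DensitiesDescribed ∧ UVBoundsHold)`):
the end statement of the series typed CONDITIONALLY on the coupling hypothesis, with the UV bound in the B16 (0.1)
reading `χ_k exp[-(1/g_k²)A(U_k) - E₋|T_η|] ≤ ρ_k ≤ exp E₊|T_η|` abstracted to a predicate `UV01 k`. [cite: Balaban1989LargeFieldII, Thm 1 and (0.1) p.355–356] -/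
def RootTemplate (H033 : Flow → ℕ → Prop) (Repr218 UV01 : ℕ → Prop) (T : LFTower P G Φ 𝒢 𝔄) (c : LFConsts)
    (βc : ℝ) (K : ℕ) : Prop :=
  T.flow.SatisfiesRG K → H033 T.flow K → ∀ k, k ≤ K → (Repr218 k ∧ LFHyp T c k ∧ LFHypImproved T c βc k) ∧ UV01 k

/-- Assembling the root template from a B14-Thm-1-shaped hypothesis and a Cor-3-shaped implication
("representation + inductive bounds at scale k ⇒ UV bound at scale k"): pure logic, the coupling hypothesis stays a binder
(REFEREE R1.1). [folklore] -/
theorem rootTemplate_of (H033 : Flow → ℕ → Prop) (Repr218 UV01 : ℕ → Prop) (T : LFTower P G Φ 𝒢 𝔄)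
    (c : LFConsts) (βc : ℝ) (K : ℕ) (h1 : B14Thm1Shape H033 Repr218 T c βc K)
    (hcor : ∀ k, k ≤ K → Repr218 k ∧ LFHyp T c k → UV01 k) :
    RootTemplate H033 Repr218 UV01 T c βc K := by
  intro hrg h033 k hk
  have h := h1 hrg h033 k hk
  exact ⟨h, hcor k hk ⟨h.1, h.2.1⟩⟩

end Root

/-! ## B5. Dimock's φ⁴₃ template (arXiv:1108.1335 = D1, 1212.5562 = D2, 1304.0705 = D3), statement level -/

/-- The data of Dimock's small-field induction (D1 (basic)–(basic3), TeX l.1902–1921): after `k` steps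
`ρ_k(Φ_k) = Z_k exp(-S_k(Φ_k,φ_k) - V_k(φ_k) + E_k(φ_k))`, `V_k = ε_k Vol + ½ μ_k ‖φ‖² + ¼ λ_k ∫φ⁴`,
`E_k(φ) = Σ_X E_k(X, φ)` with the norm `‖E‖_{k,κ} = sup_X ‖E(X)‖_k e^{κ d_M(X)}` (l.1333).  The polymer functions are
abstracted to their norms: the template's flow is a flow of NUMBERS `(ε_k, μ_k, λ_k, ‖E_k‖)`. [cite: arXiv11081335, eq. (basic) and Thm lanky, TeX l.1902–1953] -/
structure DimockData where
  eps : ℕ → ℝ     -- ε_k (vacuum energy density)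
  mu : ℕ → ℝ      -- μ_k (mass counterterm)
  lam : ℕ → ℝ     -- λ_k = L^{-(N-k)} λ, "λ_{k+1} = L λ_k"
  normE : ℕ → ℝ   -- ‖E_k‖_{k,κ}

/-- SHAPE OF D1 THEOREM `lanky` (TeX l.1924–1953), the small-field step: IF `|μ_k| ≤ λ_k^{1/2}` and `‖E_k‖_{k,κ} ≤ 1`
(and `ρ_k` has the representation on `𝒮_k`) THEN `ρ_{k+1}` has a representation of the same form with
`ε_{k+1} = L³ε_k + 𝓛₁E_k + ε_k^*`, `μ_{k+1} = L²μ_k + 𝓛₂E_k + μ_k^*`, `λ_{k+1} = Lλ_k`, `E_{k+1} = 𝓛₃E_k + E_k^*`,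
`|𝓛₁E_k| ≤ O(1)L^{-ε}‖E_k‖`, `|𝓛₂E_k| ≤ O(1)L^{-ε}λ_k^{1/2+6ε}‖E_k‖`, `‖𝓛₃E_k‖ ≤ O(1)L^{-ε}‖E_k‖`,
`|ε_k^*| ≤ O(1)L³λ_k^{1/4-10ε}`, `|μ_k^*| ≤ O(1)L³λ_k^{3/4-4ε}`, `‖E_k^*‖ ≤ O(1)L³λ_k^{1/4-10ε}` — typed on the numbers,
with `C` for the `O(1)`'s and `e` for Dimock's `ε`.  Balaban analogue: `B12Thm3Shape` (one new term per step with
the bound (1.18); the marginal coupling renormalized by β_{k+1} (2.15) instead of the relevant flow of (ε_k, μ_k)). [cite: arXiv11081335, Thm lanky, TeX l.1924–1953] -/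
def LankyStepShape (D : DimockData) (L C e : ℝ) (k : ℕ) : Prop :=
  |D.mu k| ≤ (D.lam k) ^ (1/2 : ℝ) → D.normE k ≤ 1 →
    D.lam (k+1) = L * D.lam k ∧
    (∃ l₁ l₂ l₃ e₁ m₁ E₁ : ℝ,
      |l₁| ≤ C * L ^ (-e) * D.normE k ∧ |l₂| ≤ C * L ^ (-e) * (D.lam k) ^ (1/2 + 6*e) * D.normE k ∧
      0 ≤ l₃ ∧ l₃ ≤ C * L ^ (-e) * D.normE k ∧
      |e₁| ≤ C * L ^ 3 * (D.lam k) ^ (1/4 - 10*e) ∧ |m₁| ≤ C * L ^ 3 * (D.lam k) ^ (3/4 - 4*e) ∧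
      0 ≤ E₁ ∧ E₁ ≤ C * L ^ 3 * (D.lam k) ^ (1/4 - 10*e) ∧
      D.eps (k+1) = L ^ 3 * D.eps k + l₁ + e₁ ∧ D.mu (k+1) = L ^ 2 * D.mu k + l₂ + m₁ ∧
      D.normE (k+1) ≤ l₃ + E₁)

/-- SHAPE OF D1 THEOREM `gsf` (TeX l.3006–3018), the GLOBAL SMALL-FIELD FLOW: for `λ_K = L^{-Δ}λ` small there is a
unique sequence `(ε_k, μ_k, E_k)`, `k = 0, …, K`, solving the dynamical equations with the boundary conditions and
`|μ_k| ≤ λ_k^{1/2+β}`, `‖E_k‖_{k,κ} ≤ λ_k^β`, `|ε_k| ≤ O(1)λ_k^β`.  This is the template's analogue of B12 THEOREM 2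
(existence of the bare parameters realizing prescribed renormalized ones with two-sided control along the flow) —
PROVED in D1 §4 for φ⁴₃ (relevant couplings, contraction), UNPROVED in print for YM₄ (marginal coupling; GAPS G1). [cite: arXiv11081335, Thm gsf, TeX l.3006–3018] -/
def GsfShape (D : DimockData) (C β : ℝ) (K : ℕ) : Prop :=
  ∀ k, k ≤ K → |D.mu k| ≤ (D.lam k) ^ (1/2 + β) ∧ D.normE k ≤ (D.lam k) ^ β ∧ |D.eps k| ≤ C * (D.lam k) ^ β

/-! ## Part D — THE DENSITY LEVEL (v2): the step `ρ_{k+1} = 𝐑(Tρ_k)` over the product Haar measure of `Setup`, the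
integral invariant `∫dV_kρ_k = Z`, the step on spaces (B14 Thm 1 p.262), the representation (2.18) [III] = the
decomposition (0.2) [B15], the general properties (2.19)–(2.22) [III] of the operations `𝐓_k`, and the large-field
small factor `exp(−p₀(g_k))` of [B15] (0.1) / [B16] (1.89), (1.100) against the `𝐑`-term bound (2.31) [III].
Nothing of `Setup` (`Density`, `fieldMeasure`, `RTOp`, `IsRT`, `PreservesIntegral`, `LargeFieldDecomp`, `p0Profile`)
or of the siblings `B10`/`B14`/`B15`/`B16` (which state the per-paper theorems verbatim over their own carriers) is
restated: this part supplies the LEVEL at which they meet — a sequence of densities on the tower of lattices — and the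
elementary links between the bounds one paper delivers and the next assumes. -/

/-! ### D1. The step, the integral invariant, the step on spaces (B14 p.262; B10 (6) p.257; B15 (0.4) p.176, (1.102) p.201) -/

section DensityLevel
open _root_.MeasureTheory

variable {P : Params} {G : Type*} [GaugeGroup G] [MeasurableSpace G] [HaarData G]

/-- THE SEQUENCE OF EFFECTIVE DENSITIES at the density level (B14 p.262: "All the inductive assumptions are formulated
for the effective density obtained after the k-th operation 𝐑T. It is a composition of the operations T and 𝐑, applied
in this order"; Thm 1 p.262: "the sequence of densities {ρ_k}, generated by successive applications of the operations 𝐑T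
to the density ρ₀ = exp[−(1/g₀²)A − E]"): `ρ k : Density P k G` on the lattice `T^{(k)}`, the renormalization
transformation `T k` of the (k+1)-st step (Setup `RTOp`, push-forward reading, DIVERGENCE F7) and the large-field
operation `R k` applied after it (reader-owned, DIVERGENCE F9; in the small-field papers B12/B13 `R k = id`), with the
step law `ρ_{k+1} = R_k (T_k ρ_k)`. [cite: Balaban1988Convergent, Thm 1 and preceding paragraph p.262] -/
structure DensityRG (P : Params) (G : Type*) [GaugeGroup G] [MeasurableSpace G] [HaarData G]
    (av : ∀ j, Averaging P j G) where
  ρ : (k : ℕ) → Density P k G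
  T : (k : ℕ) → RTOp P k G (av k)
  R : (k : ℕ) → Density P (k+1) G → Density P (k+1) G
  step : ∀ k, ρ (k+1) = R k ((T k).T (ρ k))

variable {av : ∀ j, Averaging P j G}

/-- The Wilson start `ρ₀ = exp[−(1/g₀²)A − E]` (B14 Thm 1 p.262; B10 (1) p.256 in d = 3), with `A` = Setup
`wilsonAction4` (d = 4, weight ε^{d−4} = 1; DIVERGENCE F10) and `E` the vacuum-energy constant. [cite: Balaban1988Convergent, Thm 1 p.262] -/
def DensityRG.IsWilsonStart (D : DensityRG P G av) (g₀ E : ℝ) : Prop :=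
  ∀ U, D.ρ 0 U = Real.exp (-(1 / g₀ ^ 2) * wilsonAction4 U - E)

/-- The partition function `Z = ∫ dU ρ₀(U)` over the product Haar measure of the finest lattice (B10 (6) p.257:
"∫dU ρ_k = ∫dU T^kρ₀ = ∫dU ρ₀ = Z^ε"). [cite: Balaban1985UV3, (6) p.257] -/
noncomputable def DensityRG.partitionFn (D : DensityRG P G av) : ℝ :=
  ∫ U, D.ρ 0 U ∂(fieldMeasure P 0 G)

/-- One renormalization transformation preserves the integral of a density: the push-forward identity of Setup `IsRT`
tested against `f ≡ 1` (B7 (10); B12 p.253 "∫dV t(V,U) = 1"; B10 (6) "∫dU Tρ = ∫dU ρ").  Bookkeeping. [folklore] -/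
theorem integral_RT_eq {j : ℕ} {avg : GaugeField P j G → GaugeField P (j+1) G} {ρ : Density P j G}
    {ρ' : Density P (j+1) G} (h : IsRT avg ρ ρ') :
    ∫ V, ρ' V ∂(fieldMeasure P (j+1) G) = ∫ U, ρ U ∂(fieldMeasure P j G) := by
  have h1 := h (fun _ => (1 : ℝ)) measurable_const ⟨1, fun _ => by simp⟩
  simpa using h1

/-- THE INTEGRAL INVARIANT of the density-level step: if every large-field operation used up to step `K` has the
normalization property `∫dV(𝐑ρ)(V) = ∫dVρ(V)` (Setup `PreservesIntegral`; B15 (0.4) p.176, (1.102) p.201), then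
`∫ dV_K ρ_K = ∫ dU ρ₀ = Z` — the reason bounds on `ρ_K` on the unit lattice are bounds on the partition function
(B10 (6) p.257; B14 p.264 "we estimate the integral ∫dV_kρ_k").  Bookkeeping by induction on `k`. [folklore] -/
theorem DensityRG.integral_invariant (D : DensityRG P G av) (K : ℕ)
    (hR : ∀ k, k < K → PreservesIntegral (D.R k)) :
    ∀ k, k ≤ K → ∫ V, D.ρ k V ∂(fieldMeasure P k G) = D.partitionFn := by
  intro k
  induction k with
  | zero => intro _; rfl
  | succ k ih =>
    intro hk
    have hk' : k < K := Nat.lt_of_succ_le hk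
    rw [D.step k, hR k hk' ((D.T k).T (D.ρ k)), integral_RT_eq ((D.T k).isRT (D.ρ k))]
    exact ih (le_of_lt hk')

/-- The product Haar measure of Setup (`fieldMeasure`) is a probability measure (each factor is, `HaarData.isProb`). [folklore] -/
instance fieldMeasure_isProbabilityMeasure (j : ℕ) : IsProbabilityMeasure (fieldMeasure P j G) := by
  haveI : IsProbabilityMeasure (HaarData.haar : Measure G) := HaarData.isProb
  exact Measure.pi.instIsProbabilityMeasure (fun _ : PBond P j => (HaarData.haar : Measure G))

/-- WHAT THE UPPER HALF OF (0.1) [B16] / (2.50) [III] BUYS at the density level: a pointwise bound `ρ_K ≤ exp c` on the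
unit lattice and the integral invariant give `Z ≤ exp c` (B10 (6) p.257: "they imply uniform in ε bounds for the partition
function Z^ε"; abstract sibling `B10.partition_upper`).  No integrability hypothesis is needed (a non-integrable `ρ_K`
has Bochner integral 0 < exp c).  Bookkeeping. [folklore] -/
theorem DensityRG.partitionFn_le_exp (D : DensityRG P G av) (K : ℕ) (c : ℝ)
    (hR : ∀ k, k < K → PreservesIntegral (D.R k)) (hup : ∀ V, D.ρ K V ≤ Real.exp c) :
    D.partitionFn ≤ Real.exp c := by
  rw [← D.integral_invariant K hR K le_rfl]
  by_cases hi : Integrable (D.ρ K) (fieldMeasure P K G)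
  · calc ∫ V, D.ρ K V ∂(fieldMeasure P K G)
        ≤ ∫ _V, Real.exp c ∂(fieldMeasure P K G) := integral_mono hi (integrable_const _) hup
      _ = Real.exp c := by simp
  · rw [integral_undef hi]; exact (Real.exp_pos c).le

/-- B14 p.262, the STEP ON SPACES (second remark after Thm 1, verbatim): "For a given index k we introduce the space of
all densities satisfying the conditions of the inductive assumption. The theorem states that the operation 𝐑T transforms
the space with the index k into the space with the index k+1."  Typed with the spaces as predicates `S k` on densities of
`T^{(k)}`. [cite: Balaban1988Convergent, remark after Thm 1 p.262] -/
def DensityRG.MapsSpaces (D : DensityRG P G av) (S : (k : ℕ) → Density P k G → Prop) (K : ℕ) : Prop :=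
  ∀ k, k < K → ∀ ρ : Density P k G, S k ρ → S (k+1) (D.R k ((D.T k).T ρ))

/-- The induction skeleton of B14 Thm 1 / B16 Thm 1 at the density level: a start in the space of index 0 and the
step-on-spaces property give `ρ_k` in the space of index `k` for all `k ≤ K`.  Pure logic. [folklore] -/
theorem DensityRG.inSpace_all (D : DensityRG P G av) (S : (k : ℕ) → Density P k G → Prop) (K : ℕ)
    (h0 : S 0 (D.ρ 0)) (hstep : D.MapsSpaces S K) : ∀ k, k ≤ K → S k (D.ρ k) := by
  intro k
  induction k with
  | zero => intro _; exact h0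
  | succ k ih =>
    intro hk
    have hk' : k < K := Nat.lt_of_succ_le hk
    rw [D.step k]
    exact hstep k hk' (D.ρ k) (ih (le_of_lt hk'))

end DensityLevel

/-! ### D2. The representation (2.18) [III] regrouped by the last large-field region = the decomposition (0.2) of [B15] -/

section Repr
variable {P : Params} {G : Type*} [GaugeGroup G]

/-- THE REPRESENTATION (2.18) [III] of the k-th density (p.257, verbatim): "(2.17) χ_k(Ω_k) = Π_{□⊂Ω_k} χ({sup_{p⊂□~}
|U_{k,□}(V_k,∂p) − 1| < ε_kη²}) … The density ρ_k(V_k) can be represented as (2.18) ρ_k(V_k) = Σ_{{Ω_j},{Λ_j}}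
χ_k(Ω_k) 𝐓_k({Ω_j},{Λ_j}) exp A_k(1/g_k², U_k), where the summation is over the admissible sequences of domains.
Summation over the sequences {S_j} is included in the operation 𝐓_k".  DATA: the finite index type `Adm` of admissible
sequences (2.1)–(2.3) (reader-level), for each index the characteristic function `χ a` (2.17) and the FUNCTION OF `V_k`
`TexpA a = 𝐓_k({Ω_j},{Λ_j}) exp A_k(1/g_k², U_k)` (the operation applied to the exponential of the action (2.23),
`LFActionData.action23`, integrates out all other variables), and the last large-field region `lastZ a = Z_k` of the
sequence, valued in a finite type `Zs`. [cite: Balaban1988Convergent, (2.17)–(2.18) p.257] -/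
structure Repr218 (P : Params) (G : Type*) [GaugeGroup G] (k : ℕ) where
  Adm : Type
  [finAdm : Fintype Adm]
  Zs : Type
  [finZs : Fintype Zs]
  [decZs : DecidableEq Zs]
  χ : Adm → Density P k G
  TexpA : Adm → Density P k G
  lastZ : Adm → Zs

/-- The index type of admissible sequences of a `Repr218` is finite (field `finAdm`), registered so that the sum (2.18) elaborates. [folklore] -/
instance Repr218.instFintypeAdm {k : ℕ} (D : Repr218 P G k) : Fintype D.Adm := D.finAdm

/-- The type of last large-field regions of a `Repr218` is finite (field `finZs`), registered so that `Σ_Z` of (0.2) elaborates. [folklore] -/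
instance Repr218.instFintypeZs {k : ℕ} (D : Repr218 P G k) : Fintype D.Zs := D.finZs

/-- Equality of last large-field regions of a `Repr218` is decidable (field `decZs`), registered for the fibrewise regrouping. [folklore] -/
instance Repr218.instDecidableEqZs {k : ℕ} (D : Repr218 P G k) : DecidableEq D.Zs := D.decZs

namespace Repr218
variable {k : ℕ}

/-- (2.18): `ρ_k(V_k) = Σ_a χ_k(a)(V_k) · (𝐓_k(a) exp A_k)(V_k)`. [cite: Balaban1988Convergent, (2.18) p.257] -/
def Holds (D : Repr218 P G k) (ρ : Density P k G) : Prop :=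
  ∀ V, ρ V = ∑ a : D.Adm, D.χ a V * D.TexpA a V

/-- The piece of the density with prescribed last large-field region `Z`: `ρ(Z, V) = Σ_{a : Z_k(a) = Z} χ_k(a)(V)(𝐓_k(a)e^{A_k})(V)`
(B15 (0.2) p.176: "ρ(V) = Σ_Z ρ(Z,V), where the sum is over large field regions Z"). [cite: Balaban1989LargeFieldI, (0.2) p.176] -/
noncomputable def piece (D : Repr218 P G k) (Z : D.Zs) : Density P k G :=
  fun V => ∑ a ∈ Finset.univ.filter (fun a => D.lastZ a = Z), D.χ a V * D.TexpA a V

/-- (2.18) [III] regrouped by the last large-field region IS the decomposition (0.2) of [B15]: `Σ_Z ρ(Z, V) = ρ(V)`.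
Bookkeeping (`Finset.sum_fiberwise`). [folklore] -/
theorem sum_piece (D : Repr218 P G k) {ρ : Density P k G} (h : D.Holds ρ) (V : GaugeField P k G) :
    ∑ Z : D.Zs, D.piece Z V = ρ V := by
  rw [h V]
  exact Finset.sum_fiberwise Finset.univ D.lastZ (fun a => D.χ a V * D.TexpA a V)

end Repr218

end Repr

/-! ### D3. The general properties (2.19)–(2.22) [III] of the operations `𝐓_k` (B14 p.258; B15 (1.1)–(1.2) p.177–178) -/

section TkOps
variable {ι : Type*} {M : Type*} [Monoid M]

/-- The "basic general properties" of the large-field integral operations `𝐓_k` (B14 p.254: "the operations corresponding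
to the operation 𝐓₁ in (1.29) are left undefined, only their basic general properties are formulated. Their inductive
definition will follow successively from the constructions of the subsequent section and forthcoming papers"; GAPS G-r2.2),
as DATA over an abstract monoid `M` of operations (composition) and regions = subsets of one ambient point type `ι` (all
regions live in `T_η`, unions of cubes of various sizes): `Z j` = the large-field regions `Z_j` ("The last large field
region is Z_k, and 𝐓_k is supported in it", p.258), `T k X` = `𝐓_k(X)` for a sub-region `X ⊆ Z_k`, and `T1 k j Y` = the
one-step operation `𝐓^{(j)}(Y)` AS IT STANDS AFTER STEP k ("If the operation 𝐓^{(j)} is changed by an 𝐑-operation, then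
the general form (2.21) is preserved, but the characteristic functions are changed", p.258 — hence the extra index `k`).
The integral formula (2.21) for an unchanged `𝐓^{(j)}` is reader-level (B14 §3, unit r2). [cite: Balaban1988Convergent, (2.19)–(2.21) p.258] -/
structure TkOps (ι : Type*) (M : Type*) [Monoid M] where
  Z : ℕ → Set ι
  T : ℕ → Set ι → M
  T1 : ℕ → ℕ → Set ι → M

/-- The ordered product `Π_{j = n−1}^{0} 𝐓^{(j)}(Z_{j+1} ∩ Y)` of one-step operations (after step `k`), leftmost factor
`j = n − 1` ("This is an ordered product, the order indicated in the product symbol", (2.20) p.258). [cite: Balaban1988Convergent, (2.20) p.258] -/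
def TkOps.tail (O : TkOps ι M) (k n : ℕ) (Y : Set ι) : M :=
  (((List.range n).reverse).map fun j => O.T1 k j (O.Z (j+1) ∩ Y)).prod

/-- (2.19)–(2.20) [III] p.258, verbatim: "If Z_k is represented as a union of disjoint regions, e.g. as a union of connected
components, Z_k = X₁ ∪ … ∪ X_n, X_i ∩ X_j = ∅ for i ≠ j, then (2.19) 𝐓_k(Z_k) = Π_{i=1}^n 𝐓_k(X_i). The operations
corresponding to disjoint regions commute, i.e., 𝐓_k(X_i)𝐓_k(X_j) = 𝐓_k(X_j)𝐓_k(X_i). For a given large field region X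
the operation 𝐓_k(X) can be factorized into a product of one-step operations, and has the form (2.20) 𝐓_k(X) =
Π^{0}_{j=k−1} 𝐓^{(j)}(Z_{j+1} ∩ X)."  (B15 (1.1) p.177 quotes (2.19) as "𝕋_k(Z_k) = 𝕋_k(Z_k ∩ Zᶜ)𝕋_k(Z) = 𝕋_k(Z_k ∩ Zᶜ)
Π_{i=1}^m 𝕋_k(X_i)".)  Typed: binary factorization + commutation for disjoint sub-regions of `Z_k`, and (2.20) as
`T k X = tail k k X`. [cite: Balaban1988Convergent, (2.19)–(2.20) p.258] -/
structure TkOps.Laws (O : TkOps ι M) (k : ℕ) : Prop where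
  factor219 : ∀ X Y : Set ι, X ⊆ O.Z k → Y ⊆ O.Z k → Disjoint X Y → O.T k (X ∪ Y) = O.T k X * O.T k Y
  comm219 : ∀ X Y : Set ι, X ⊆ O.Z k → Y ⊆ O.Z k → Disjoint X Y → O.T k X * O.T k Y = O.T k Y * O.T k X
  prod220 : ∀ X : Set ι, X ⊆ O.Z k → O.T k X = O.tail k k X

/-- Splitting the ordered product (2.20) at an intermediate scale `m ≤ k`: `Π_{j=k−1}^{0} = (Π_{j=k−1}^{m}) · (Π_{j=m−1}^{0})`.
List bookkeeping. [folklore] -/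
theorem TkOps.tail_split (O : TkOps ι M) (k m n : ℕ) (hmn : m ≤ n) (Y : Set ι) :
    O.tail k n Y = (((List.Ico m n).reverse).map fun j => O.T1 k j (O.Z (j+1) ∩ Y)).prod * O.tail k m Y := by
  unfold TkOps.tail
  rw [← List.Ico.zero_bot, ← List.Ico.append_consecutive (Nat.zero_le m) hmn, List.reverse_append, List.map_append,
    List.prod_append, List.Ico.zero_bot]

/-- (2.22) [III] p.258, verbatim: "We will use the factorization (2.20) in the form (2.22) 𝐓_k(X) = Π^{m}_{j=k−1}
𝐓^{(j)}(Z_{j+1} ∩ X) 𝐓_m(Z_m ∩ X), and in the case where the last k − m operations have the form (2.21)."  DERIVED here from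
(2.20) with `𝐓_m(Z_m ∩ X)` read as the tail product `Π_{j=m−1}^{0} 𝐓^{(j)}(Z_{j+1} ∩ Z_m ∩ X)` of the CURRENT one-step
operations, under the nesting `Z_{j+1} ⊆ Z_m` for `j < m` of the large-field regions (what the regrouping silently uses;
B15 p.177 "Each renormalization step adds at least ten layers of MR_k-cubes"). [cite: Balaban1988Convergent, (2.22) p.258] -/
theorem TkOps.prod222 (O : TkOps ι M) {k m : ℕ} (hL : O.Laws k) (hmk : m ≤ k)
    (hZ : ∀ j, j < m → O.Z (j+1) ⊆ O.Z m) (X : Set ι) (hX : X ⊆ O.Z k) :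
    O.T k X = (((List.Ico m k).reverse).map fun j => O.T1 k j (O.Z (j+1) ∩ X)).prod * O.tail k m (O.Z m ∩ X) := by
  rw [hL.prod220 X hX, O.tail_split k m k hmk X]
  congr 1
  unfold TkOps.tail
  congr 1
  apply List.map_congr_left
  intro j hj
  have hj' : j < m := by simpa using hj
  rw [← Set.inter_assoc, Set.inter_eq_left.mpr (hZ j hj')]

end TkOps

/-! ### D4. The large-field small factor `exp(−p₀(g))` (B15 (0.1) p.175, B16 (1.89) p.387, (1.100) p.390) against (2.31) [III] -/

section SmallFactor

/-- B15 (0.1) p.175 prints "exp(−p₀(g₀)) = g₀^{A₀(log g₀⁻²)^{p₀−1}}" with `p₀(g₀) = A₀(log g₀⁻²)^{p₀}` (Setup `p0Profile`).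
THE CORRECT IDENTITY has exponent `2A₀(log g⁻²)^{p₀−1}`: `exp(−A₀ℓ^{p₀}) = (e^{−ℓ})^{A₀ℓ^{p₀−1}} = (g²)^{A₀ℓ^{p₀−1}}`,
`ℓ = log g⁻²` (for `p₀ ≥ 1`, `g > 0`).  DIVERGENCE D-f2.10 (print slip by a square root; the printed right-hand side is
still an UPPER bound for `g ≤ 1`, see `exp_neg_p0Profile_le_printed`, which is the direction (0.1) is used in). [cite: Balaban1989LargeFieldI, (0.1) p.175] -/
theorem exp_neg_p0Profile_eq_rpow (A₀ g : ℝ) (p₀ : ℕ) (hp : 1 ≤ p₀) (hg : 0 < g) :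
    Real.exp (-(p0Profile A₀ p₀ g)) = g ^ (2 * A₀ * (Real.log (g ^ 2)⁻¹) ^ (p₀ - 1 : ℕ)) := by
  obtain ⟨q, rfl⟩ : ∃ q, p₀ = q + 1 := ⟨p₀ - 1, by omega⟩
  have hl : Real.log g = -(Real.log (g ^ 2)⁻¹) / 2 := by
    rw [Real.log_inv, Real.log_pow]; push_cast; ring
  rw [Real.rpow_def_of_pos hg, hl, p0Profile, Nat.add_sub_cancel, pow_succ]
  congr 1
  ring

/-- The printed right-hand side of B15 (0.1) is an upper bound: `exp(−p₀(g)) ≤ g^{A₀(log g⁻²)^{p₀−1}}` for `0 < g ≤ 1`,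
`A₀ ≥ 0`, `p₀ ≥ 1` (half of the true exponent; `g^{2x} ≤ g^{x}` for `x ≥ 0`, `g ≤ 1`). [cite: Balaban1989LargeFieldI, (0.1) p.175] -/
theorem exp_neg_p0Profile_le_printed (A₀ g : ℝ) (p₀ : ℕ) (hp : 1 ≤ p₀) (hg : 0 < g) (hg1 : g ≤ 1) (hA : 0 ≤ A₀) :
    Real.exp (-(p0Profile A₀ p₀ g)) ≤ g ^ (A₀ * (Real.log (g ^ 2)⁻¹) ^ (p₀ - 1 : ℕ)) := by
  rw [exp_neg_p0Profile_eq_rpow A₀ g p₀ hp hg]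
  have hl : 0 ≤ Real.log (g ^ 2)⁻¹ := by
    apply Real.log_nonneg
    have h2 : g ^ 2 ≤ 1 := by nlinarith
    exact one_le_inv_iff₀.mpr ⟨by positivity, h2⟩
  have hx : 0 ≤ A₀ * (Real.log (g ^ 2)⁻¹) ^ (p₀ - 1 : ℕ) := by positivity
  apply Real.rpow_le_rpow_of_exponent_ge hg hg1
  linarith

/-- B16 (1.100) p.390 delivers the newly created 𝐑-terms with the small factor `exp(−p₀(g_k))`: "|𝐑′^{(k)}(X,(𝐔,𝐉))| ≤
exp(−p₀(g_k)) exp(−κd_k(X))", while the inductive assumption (2.31) [III] asks for `g_k^{κ₀}` ("Here κ₀ can be chosen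
arbitrarily large").  THE LINK: `exp(−p₀(g)) ≤ g^{κ₀}` as soon as `κ₀ ≤ 2A₀(log g⁻²)^{p₀−1}` (`0 < g < 1`, `p₀ ≥ 1`) — for
fixed `κ₀` a smallness condition on `g`, i.e. one of the "numerous restrictions" on `γ` (GAPS G-r2.3).  Elementary. [cite: Balaban1989LargeFieldII, (1.100) p.390] -/
theorem exp_neg_p0Profile_le_pow (A₀ g : ℝ) (p₀ κ₀ : ℕ) (hp : 1 ≤ p₀) (hg : 0 < g) (hg1 : g < 1)
    (hκ : (κ₀ : ℝ) ≤ 2 * A₀ * (Real.log (g ^ 2)⁻¹) ^ (p₀ - 1 : ℕ)) :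
    Real.exp (-(p0Profile A₀ p₀ g)) ≤ g ^ κ₀ := by
  calc Real.exp (-(p0Profile A₀ p₀ g)) = g ^ (2 * A₀ * (Real.log (g ^ 2)⁻¹) ^ (p₀ - 1 : ℕ)) :=
        exp_neg_p0Profile_eq_rpow A₀ g p₀ hp hg
    _ ≤ g ^ (κ₀ : ℝ) := Real.rpow_le_rpow_of_exponent_ge hg hg1.le hκ
    _ = g ^ κ₀ := Real.rpow_natCast g κ₀

/-- SHAPE OF THE FUNDAMENTAL INEQUALITY (1.89) of B16 p.387, verbatim: "the domain X in the definition (1.71) satisfies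
the assumption of the statement with K = 0, therefore κ_k(X) ≥ 0, and we have the fundamental inequality 𝐓′_k(X)1 ≤
exp(−2(1+β₀)⁻¹p₀(g_k)). (1.89)" — the large-field operation of one component applied to the constant 1 is bounded by the
small factor; p.387: "This implies the inequality (2.50) [III], hence Corollary 3" (GAPS G-r2.5).  Typed pointwise for the
function `T1X = 𝐓′_k(X)1` of the remaining variables, with `p₀(g_k)` = Setup `p0Profile A₀ p₀ g_k`; the restriction on
`β₀` located in print is B16 p.389 "(for example, take β₀ = 1/7 …)". [cite: Balaban1989LargeFieldII, (1.89) p.387] -/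
def FundIneq189 {V : Type*} (T1X : V → ℝ) (A₀ : ℝ) (p₀ : ℕ) (β₀ gk : ℝ) : Prop :=
  ∀ v, T1X v ≤ Real.exp (-(2 * (1 + β₀)⁻¹ * p0Profile A₀ p₀ gk))

end SmallFactor

/-! ## Part E — THE FORWARD STEP OBLIGATIONS (v3): the clause list ONE step `k → k+1` must deliver for the new term(s)

B12 p.256 after (0.23): "In the second step a new expression of this type is created, in the old only a background field is
changed"; B12 p.268 (the step of §2 produces the one new term (2.13) with (2.14) and the coupling renormalization (2.15)); B14
p.262: "the expressions with indices j < k are exactly as described above" while the newly created terms satisfy the improved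
bounds; B16 p.390 (the one-sentence verification of all clauses of §2 [III] for the new terms — GAPS G-f2.4).  The cumulative
hypotheses `SFHyp T c k` / `LFHyp T c k` of Part B quantify over all indices `j ≤ k`; a step adds the index `k+1`.  This part
isolates, as `Prop`-structures, exactly the clauses AT THE NEW INDEX together with the coupling-constant renormalization condition
(2.15) [I] / (2.24) [III] that DEFINES `g_{k+1}` (`SFNewTerm`, `LFNewTerms`), proves the bookkeeping `SFHyp T c (k+1) ↔ SFHyp T c k ∧
SFNewTerm T c k` (`SFHyp.succ_iff`; `LFHyp.succ` under the sign conditions `LFSigns` that make the improved bounds of B14 p.262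
stronger than the ordinary ones), and shows that the theorem SHAPES of Part B are the statement "every step discharges the
obligation" (`B12Thm3Shape_iff_obligation`, kernel-checked `Iff`; `B14Thm1Shape_of_obligation` / `obligation_of_B14Thm1Shape`).  The
per-paper sub-cells (B12 §2; B15/B16) type their clause-by-clause verification tables (GAPS G-f2.3, G-f2.4) against `SFNewTerm` /
`LFNewTerms`.  PRESUMPTION made explicit (DIVERGENCE D-f2.11): the towers of Part B carry ONE function per index `j` — the old terms
are unchanged as functions of `(𝐔,𝐉)`, only their argument (the background field) changes — which is what the quoted sentences say;
a step that also rewrote old terms would need towers indexed by `(k, j)`.  The field `rg` records the coupling renormalization condition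
of the step; the EXISTENCE of a trajectory `g₀, …, g_K` ending at a prescribed `g` when `β_{k+1}` depends on the whole history
`g₀, …, g_k` (B12 Thm 2's forward shooting, GAPS G-ref2-1) is the downstream module `FlowStep` (`FlowStep.couplingTrajectory_exists_hist`,
`…_history`, unit strat-b12), which imports this one — not restated here (Part A's `couplingTrajectory_exists` is the Markov case). -/

section ObligationsSF
variable {P : Params} {G : Type*} [GaugeGroup G] {Φ 𝒢 : Type*}

/-- THE NEW-TERM OBLIGATION OF THE SMALL-FIELD STEP `k → k+1` (B12 §2): the clauses of `SFHyp` at the single new index `j = k+1` —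
(1.7) local dependence, (1.18) the bound `E₀exp(−κd_{k+1}(X))` on `U^c_{k+1}(X,α₀,α₁)`, (1.19) gauge invariance of the term and of the
space, p.264 smoothness and uniform boundedness of `β_{k+1}` on `[0,γ]` — plus the coupling-constant renormalization condition (2.15) =
(0.20) `1/g_k² = 1/g_{k+1}² + β_{k+1}(g_k)` DEFINING `g_{k+1}` ("We define the new coupling constant g_{k+1} by the equality (2.15)",
B12 p.268).  This is the list a B12 §2 verification must discharge for the term (2.13) (GAPS G-f2.3). [cite: Balaban1987RG1, (2.13)–(2.15) p.268] -/
structure SFNewTerm (T : SFTower P G Φ 𝒢) (c : SFConsts) (k : ℕ) : Prop where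
  rg : 1 / (T.flow.g k) ^ 2 = 1 / (T.flow.g (k+1)) ^ 2 + T.flow.β (k+1) (T.flow.g k)
  localDep : ∀ X g φ ψ, T.agreeOn (k+1) X φ ψ → T.E (k+1) X g φ = T.E (k+1) X g ψ
  bound118 : ∀ X g φ, 0 ≤ g → g ≤ c.γ → φ ∈ T.space (k+1) X c.α₀ c.α₁ →
    ‖T.E (k+1) X g φ‖ ≤ c.E₀ * Real.exp (-c.κ * (T.sys (k+1)).dj X)
  spaceInv : ∀ X u φ, φ ∈ T.space (k+1) X c.α₀ c.α₁ → T.act u φ ∈ T.space (k+1) X c.α₀ c.α₁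
  gaugeInv119 : ∀ X g u φ, T.E (k+1) X g (T.act u φ) = T.E (k+1) X g φ
  betaSmooth : ∀ n : ℕ, ContDiffOn ℝ n (T.flow.β (k+1)) (Set.Icc 0 c.γ)
  betaBound : ∀ x ∈ Set.Icc (0:ℝ) c.γ, |T.flow.β (k+1) x| ≤ c.β'

/-- At `k = 0` the cumulative small-field hypotheses are vacuous: `A₀ = −(1/g₀²)A` has no terms (B12 (0.17)). [folklore] -/
theorem SFHyp.zero (T : SFTower P G Φ 𝒢) (c : SFConsts) : SFHyp T c 0 where
  rg := fun j hj => absurd hj (Nat.not_lt_zero j)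
  localDep := fun j h1 hj => absurd hj (by omega)
  bound118 := fun j h1 hj => absurd hj (by omega)
  spaceInv := fun j h1 hj => absurd hj (by omega)
  gaugeInv119 := fun j h1 hj => absurd hj (by omega)
  betaSmooth := fun j h1 hj => absurd hj (by omega)
  betaBound := fun j h1 hj => absurd hj (by omega)

/-- ONE STEP of the small-field induction as bookkeeping: the hypotheses at `k` and the new-term obligation of the step `k → k+1`
give the hypotheses at `k+1` (the old terms are unchanged, B12 p.256; DIVERGENCE D-f2.11). [folklore] -/
theorem SFHyp.succ {T : SFTower P G Φ 𝒢} {c : SFConsts} {k : ℕ} (h : SFHyp T c k) (hn : SFNewTerm T c k) :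
    SFHyp T c (k+1) where
  rg := fun j hj => by
    rcases Nat.lt_succ_iff_lt_or_eq.mp hj with hj' | rfl
    · exact h.rg j hj'
    · exact hn.rg
  localDep := fun j h1 hj => by
    rcases Nat.of_le_succ hj with hj' | rfl
    · exact h.localDep j h1 hj'
    · exact hn.localDep
  bound118 := fun j h1 hj => by
    rcases Nat.of_le_succ hj with hj' | rfl
    · exact h.bound118 j h1 hj'
    · exact hn.bound118
  spaceInv := fun j h1 hj => by
    rcases Nat.of_le_succ hj with hj' | rfl
    · exact h.spaceInv j h1 hj'
    · exact hn.spaceInv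
  gaugeInv119 := fun j h1 hj => by
    rcases Nat.of_le_succ hj with hj' | rfl
    · exact h.gaugeInv119 j h1 hj'
    · exact hn.gaugeInv119
  betaSmooth := fun j h1 hj => by
    rcases Nat.of_le_succ hj with hj' | rfl
    · exact h.betaSmooth j h1 hj'
    · exact hn.betaSmooth
  betaBound := fun j h1 hj => by
    rcases Nat.of_le_succ hj with hj' | rfl
    · exact h.betaBound j h1 hj'
    · exact hn.betaBound

/-- Conversely, the hypotheses at `k+1` contain the new-term clauses of the step `k → k+1`. [folklore] -/
theorem SFHyp.newTerm {T : SFTower P G Φ 𝒢} {c : SFConsts} {k : ℕ} (h : SFHyp T c (k+1)) : SFNewTerm T c k where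
  rg := h.rg k (Nat.lt_succ_self k)
  localDep := h.localDep (k+1) k.succ_pos le_rfl
  bound118 := h.bound118 (k+1) k.succ_pos le_rfl
  spaceInv := h.spaceInv (k+1) k.succ_pos le_rfl
  gaugeInv119 := h.gaugeInv119 (k+1) k.succ_pos le_rfl
  betaSmooth := h.betaSmooth (k+1) k.succ_pos le_rfl
  betaBound := h.betaBound (k+1) k.succ_pos le_rfl

/-- `SFHyp T c (k+1) ↔ SFHyp T c k ∧ SFNewTerm T c k`: the inductive hypotheses advance by exactly one new-term obligation. [folklore] -/
theorem SFHyp.succ_iff {T : SFTower P G Φ 𝒢} {c : SFConsts} {k : ℕ} :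
    SFHyp T c (k+1) ↔ SFHyp T c k ∧ SFNewTerm T c k :=
  ⟨fun h => ⟨h.mono (Nat.le_succ k), h.newTerm⟩, fun h => h.1.succ h.2⟩

/-- THE INDUCTION ON `k`: if every step `k < K` discharges the new-term obligation GIVEN the hypotheses at `k`, then the
hypotheses hold at every `k ≤ K`. [folklore] -/
theorem sfHyp_all_of_steps {T : SFTower P G Φ 𝒢} {c : SFConsts} {K : ℕ}
    (hstep : ∀ k, k < K → SFHyp T c k → SFNewTerm T c k) : ∀ k, k ≤ K → SFHyp T c k := by
  intro k
  induction k with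
  | zero => intro _; exact SFHyp.zero T c
  | succ k ih =>
    intro hk
    have hk' : k < K := Nat.lt_of_succ_le hk
    exact (ih hk'.le).succ (hstep k hk' (ih hk'.le))

variable [MeasurableSpace G] [HaarData G]

/-- THE PER-STEP OBLIGATION FORM of B12 Theorem 3 (p.264 with §2 p.268): for the sequence generated by the small-field
transformations with the couplings in the interval, EACH step `k → k+1`, `k < K`, given the inductive hypotheses at `k`, delivers the
new-term obligation `SFNewTerm T c k` — "Let us write the result of the above calculations: (2.12) … where (2.13) … (2.14) … We define
the new coupling constant g_{k+1} by the equality (2.15)" (B12 p.268) followed by the verification of (1.18)–(1.19) for `E^{(k+1)}` in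
§§3–5.  A shape (`Prop`), not asserted. [cite: Balaban1987RG1, (2.12)–(2.15) p.268] -/
def SFStepObligation (av : ∀ j, Averaging P j G) (Tk : ∀ k, RTOp P k G (av k)) (χ GF : ∀ k, Density P k G)
    (bg : Background P G av) (A : ∀ k, Density P k G) (T : SFTower P G Φ 𝒢) (c : SFConsts) (K : ℕ) : Prop :=
  GeneratedBySmallFieldRT av Tk χ GF bg A T K → T.flow.InInterval c.γ K →
    ∀ k, k < K → SFHyp T c k → SFNewTerm T c k

/-- B12 THEOREM 3 (shape) IS EQUIVALENT TO THE PER-STEP OBLIGATION: `B12Thm3Shape ↔ SFStepObligation` — the reduction of the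
theorem to "the step produces one new term with the clauses (1.7), (1.18), (1.19), β_{k+1} smooth and bounded, and (2.15)"
(GAPS G-f2.3) is exact at the typed level.  Kernel-checked bookkeeping. [folklore] -/
theorem B12Thm3Shape_iff_obligation (av : ∀ j, Averaging P j G) (Tk : ∀ k, RTOp P k G (av k)) (χ GF : ∀ k, Density P k G)
    (bg : Background P G av) (A : ∀ k, Density P k G) (T : SFTower P G Φ 𝒢) (c : SFConsts) (K : ℕ) :
    B12Thm3Shape av Tk χ GF bg A T c K ↔ SFStepObligation av Tk χ GF bg A T c K := by
  constructor
  · intro h hgen hI k hk _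
    exact (h hgen hI (k+1) hk).newTerm
  · intro h hgen hI
    exact sfHyp_all_of_steps (h hgen hI)

end ObligationsSF

section ObligationsLF
variable {P : Params} {G : Type*} [GaugeGroup G] {Φ 𝒢 𝔄 : Type*}

/-- An improved decay rate `(1+4β)κ` (B14 p.262) dominates the ordinary rate `κ` for a non-negative prefactor: `a·exp(−(1+4β)κd) ≤
a·exp(−κd)` when `a, β, κ, d ≥ 0`.  Elementary. [folklore] -/
theorem improved_le_weak (a βc κ d : ℝ) (ha : 0 ≤ a) (hβ : 0 ≤ βc) (hκ : 0 ≤ κ) (hd : 0 ≤ d) :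
    a * Real.exp (-((1 + 4 * βc) * κ) * d) ≤ a * Real.exp (-κ * d) := by
  apply mul_le_mul_of_nonneg_left _ ha
  apply Real.exp_le_exp.mpr
  have : 0 ≤ 4 * βc * κ * d := by positivity
  nlinarith

/-- The improved 𝐑-bound at the newest scale implies the ordinary one (2.31) when `β, κ ≥ 0` and `g_k ≥ 0` (so that `g_k^{κ₀} ≥ 0`). [folklore] -/
theorem LFHypImproved.toWeak_R {T : LFTower P G Φ 𝒢 𝔄} {c : LFConsts} {βc : ℝ} {k : ℕ} (h : LFHypImproved T c βc k)
    (hβ : 0 ≤ βc) (hκ : 0 ≤ c.κ) (hk : 1 ≤ k) (hg : 0 ≤ T.flow.g k) (X : (T.sys k).Dom) (φ : Φ)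
    (hφ : φ ∈ T.space k X (c.alpha0 (T.flow.g k)) (c.alpha1 (T.flow.g k))) :
    ‖T.R k X φ‖ ≤ (T.flow.g k) ^ c.κ₀ * Real.exp (-c.κ * (T.sys k).dj X) :=
  le_trans (h.boundR hk X φ hφ)
    (improved_le_weak _ βc c.κ _ (pow_nonneg hg _) hβ hκ ((T.sys k).dj_nonneg X))

/-- The improved 𝐁-bound at the newest scale implies the ordinary one (2.42) when `β, κ, B₀ ≥ 0`. [folklore] -/
theorem LFHypImproved.toWeak_B {T : LFTower P G Φ 𝒢 𝔄} {c : LFConsts} {βc : ℝ} {k : ℕ} (h : LFHypImproved T c βc k)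
    (hβ : 0 ≤ βc) (hκ : 0 ≤ c.κ) (hk : 1 ≤ k) (hB₀ : 0 ≤ c.B₀) (X : (T.sys k).Dom) (φ : Φ) (a : 𝔄)
    (hφ : φ ∈ T.spaceB k X) :
    ‖T.B k X φ a‖ ≤ c.B₀ * Real.exp (-c.κ * (T.sys k).dj X) :=
  le_trans (h.boundB hk X φ a hφ) (improved_le_weak _ βc c.κ _ hB₀ hβ hκ ((T.sys k).dj_nonneg X))

/-- THE NEW-TERM OBLIGATIONS OF THE COMPLETE STEP `k → k+1` (B14 §2 p.262: "Let us consider the k-th step. All the inductive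
assumptions are formulated for the effective density obtained after the k-th operation 𝐑T … the newly created terms … are defined on
slightly larger spaces … and satisfy better bounds"; B16 p.390: "[the new terms] have all the properties required … in Sect. 2
[III]", GAPS G-f2.4): at the new index `k+1` — local dependence (i) and gauge invariance (iii) of `E^{(k+1)}`, `R^{(k+1)}`, the
IMPROVED bounds `LFHypImproved T c β (k+1)` (decay rate `(1+4β)κ`, "for example"), and the coupling renormalization condition
(2.24) = (I.0.20) defining `g_{k+1}`.  (Local dependence / gauge invariance of the boundary terms `B^{(k+1)}` are not separate clauses
of `LFHyp` — (i)–(iv) after (2.41) are carried by the bound and the `S`-data, DIVERGENCE D-f2.6/D-f2.7 — hence not here either.) [cite: Balaban1988Convergent, §2 p.262] -/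
structure LFNewTerms (T : LFTower P G Φ 𝒢 𝔄) (c : LFConsts) (βc : ℝ) (k : ℕ) : Prop where
  rg : 1 / (T.flow.g k) ^ 2 = 1 / (T.flow.g (k+1)) ^ 2 + T.flow.β (k+1) (T.flow.g k)
  localDepE : ∀ X z g φ ψ, T.agreeOn (k+1) X φ ψ → T.E (k+1) X z g φ = T.E (k+1) X z g ψ
  localDepR : ∀ X φ ψ, T.agreeOn (k+1) X φ ψ → T.R (k+1) X φ = T.R (k+1) X ψ
  gaugeInvE : ∀ X z g u φ, T.E (k+1) X z g (T.act u φ) = T.E (k+1) X z g φ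
  gaugeInvR : ∀ X u φ, T.R (k+1) X (T.act u φ) = T.R (k+1) X φ
  improved : LFHypImproved T c βc (k+1)

/-- The SIGN CONDITIONS under which the improved bounds of the newest terms imply the ordinary ones when the index becomes old at
the next step: `β ≥ 0` ("e.g., we can take β = 1/4", B14 p.261), `κ ≥ 0`, `E₀ ≥ 0`, `B₀ ≥ 0`, and `g_k ≥ 0` for `k ≤ K` (the
couplings lie in `]0,γ]`).  All hold in print; typed as hypotheses because the constants record `LFConsts` carries roles only. [folklore] -/
structure LFSigns (T : LFTower P G Φ 𝒢 𝔄) (c : LFConsts) (βc : ℝ) (K : ℕ) : Prop where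
  hβ : 0 ≤ βc
  hκ : 0 ≤ c.κ
  hE₀ : 0 ≤ c.E₀
  hB₀ : 0 ≤ c.B₀
  hg : ∀ k, k ≤ K → 0 ≤ T.flow.g k

/-- At `k = 0` the cumulative hypotheses of B14 §2 are vacuous (`ρ₀ = exp[−(1/g₀²)A − E]`, no terms). [folklore] -/
theorem LFHyp.zero (T : LFTower P G Φ 𝒢 𝔄) (c : LFConsts) : LFHyp T c 0 where
  rg := fun j hj => absurd hj (Nat.not_lt_zero j)
  localDepE := fun j h1 hj => absurd hj (by omega)
  localDepR := fun j h1 hj => absurd hj (by omega)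
  boundE := fun j h1 hj => absurd hj (by omega)
  boundR := fun j h1 hj => absurd hj (by omega)
  boundB := fun j h1 hj => absurd hj (by omega)
  gaugeInvE := fun j h1 hj => absurd hj (by omega)
  gaugeInvR := fun j h1 hj => absurd hj (by omega)

/-- At `k = 0` there is no newest term: the improved bounds are vacuous. [folklore] -/
theorem LFHypImproved.zero (T : LFTower P G Φ 𝒢 𝔄) (c : LFConsts) (βc : ℝ) : LFHypImproved T c βc 0 where
  boundE := fun h => absurd h (by omega)
  boundR := fun h => absurd h (by omega)
  boundB := fun h => absurd h (by omega)

/-- ONE STEP of the complete induction as bookkeeping: the bounds at `k`, the new-term obligations of the step `k → k+1` and the sign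
conditions give the bounds at `k+1` — the improved bounds of the new terms are weakened to the ordinary ones by `toWeak_E/R/B`
(B14 p.262 "the expressions with indices j < k are exactly as described above"; DIVERGENCE D-f2.11). [folklore] -/
theorem LFHyp.succ {T : LFTower P G Φ 𝒢 𝔄} {c : LFConsts} {βc : ℝ} {k : ℕ} (h : LFHyp T c k) (hn : LFNewTerms T c βc k)
    (hβ : 0 ≤ βc) (hκ : 0 ≤ c.κ) (hE₀ : 0 ≤ c.E₀) (hB₀ : 0 ≤ c.B₀) (hg : 0 ≤ T.flow.g (k+1)) :
    LFHyp T c (k+1) where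
  rg := fun j hj => by
    rcases Nat.lt_succ_iff_lt_or_eq.mp hj with hj' | rfl
    · exact h.rg j hj'
    · exact hn.rg
  localDepE := fun j h1 hj => by
    rcases Nat.of_le_succ hj with hj' | rfl
    · exact h.localDepE j h1 hj'
    · exact hn.localDepE
  localDepR := fun j h1 hj => by
    rcases Nat.of_le_succ hj with hj' | rfl
    · exact h.localDepR j h1 hj'
    · exact hn.localDepR
  boundE := fun j h1 hj => by
    rcases Nat.of_le_succ hj with hj' | rfl
    · exact h.boundE j h1 hj'
    · intro X z g φ hg0 hgγ hφ
      exact hn.improved.toWeak_E hβ hκ h1 X z g φ hg0 hgγ hφ hE₀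
  boundR := fun j h1 hj => by
    rcases Nat.of_le_succ hj with hj' | rfl
    · exact h.boundR j h1 hj'
    · intro X φ hφ
      exact hn.improved.toWeak_R hβ hκ h1 hg X φ hφ
  boundB := fun j h1 hj => by
    rcases Nat.of_le_succ hj with hj' | rfl
    · exact h.boundB j h1 hj'
    · intro X φ a hφ
      exact hn.improved.toWeak_B hβ hκ h1 hB₀ X φ a hφ
  gaugeInvE := fun j h1 hj => by
    rcases Nat.of_le_succ hj with hj' | rfl
    · exact h.gaugeInvE j h1 hj'
    · exact hn.gaugeInvE
  gaugeInvR := fun j h1 hj => by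
    rcases Nat.of_le_succ hj with hj' | rfl
    · exact h.gaugeInvR j h1 hj'
    · exact hn.gaugeInvR

/-- THE INDUCTION ON `k` for the complete description: if every step `k < K` delivers the new-term obligations GIVEN the bounds at
`k`, then `LFHyp T c k ∧ LFHypImproved T c β k` at every `k ≤ K` (under the sign conditions). [folklore] -/
theorem lfHyp_all_of_steps {T : LFTower P G Φ 𝒢 𝔄} {c : LFConsts} {βc : ℝ} {K : ℕ} (hs : LFSigns T c βc K)
    (hstep : ∀ k, k < K → LFHyp T c k → LFHypImproved T c βc k → LFNewTerms T c βc k) :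
    ∀ k, k ≤ K → LFHyp T c k ∧ LFHypImproved T c βc k := by
  intro k
  induction k with
  | zero => intro _; exact ⟨LFHyp.zero T c, LFHypImproved.zero T c βc⟩
  | succ k ih =>
    intro hk
    have hk' : k < K := Nat.lt_of_succ_le hk
    obtain ⟨h1, h2⟩ := ih hk'.le
    have hn := hstep k hk' h1 h2
    exact ⟨h1.succ hn hs.hβ hs.hκ hs.hE₀ hs.hB₀ (hs.hg (k+1) hk), hn.improved⟩

/-- THE PER-STEP OBLIGATION FORM of B14 Theorem 1 / B16 Theorem 1 (B14 p.262: "The theorem states that the operation 𝐑T transforms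
the space with the index k into the space with the index k+1"): under the coupling hypotheses, EACH step `k → k+1`, `k < K`, given the
representation (2.18) and the bounds at `k`, delivers the representation at `k+1` and the new-term obligations.  `H033` and `Repr`
are the parameters of `B14Thm1Shape` (`Repr k` = "ρ_k has the representation (2.18)", e.g. Part D's `Repr218`).  A shape, not asserted. [cite: Balaban1988Convergent, Thm 1 and remarks p.262] -/
def LFStepObligation (H033 : Flow → ℕ → Prop) (Repr : ℕ → Prop) (T : LFTower P G Φ 𝒢 𝔄) (c : LFConsts) (βc : ℝ)
    (K : ℕ) : Prop :=
  T.flow.SatisfiesRG K → H033 T.flow K →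
    ∀ k, k < K → Repr k → LFHyp T c k → LFHypImproved T c βc k → Repr (k+1) ∧ LFNewTerms T c βc k

/-- The per-step obligation, a represented start `Repr 0` (the Wilson density, no large fields) and the sign conditions give
the B14-Thm-1 shape.  Kernel-checked bookkeeping (induction on `k`). [folklore] -/
theorem B14Thm1Shape_of_obligation (H033 : Flow → ℕ → Prop) (Repr : ℕ → Prop) (T : LFTower P G Φ 𝒢 𝔄) (c : LFConsts)
    (βc : ℝ) (K : ℕ) (h0 : Repr 0) (hs : LFSigns T c βc K) (h : LFStepObligation H033 Repr T c βc K) :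
    B14Thm1Shape H033 Repr T c βc K := by
  intro hrg h033 k
  induction k with
  | zero => intro _; exact ⟨h0, LFHyp.zero T c, LFHypImproved.zero T c βc⟩
  | succ k ih =>
    intro hk
    have hk' : k < K := Nat.lt_of_succ_le hk
    obtain ⟨hr, h1, h2⟩ := ih hk'.le
    obtain ⟨hr', hn⟩ := h hrg h033 k hk' hr h1 h2
    exact ⟨hr', h1.succ hn hs.hβ hs.hκ hs.hE₀ hs.hB₀ (hs.hg (k+1) hk), hn.improved⟩

/-- Conversely the B14-Thm-1 shape contains the per-step obligation (no sign conditions needed). [folklore] -/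
theorem obligation_of_B14Thm1Shape (H033 : Flow → ℕ → Prop) (Repr : ℕ → Prop) (T : LFTower P G Φ 𝒢 𝔄) (c : LFConsts)
    (βc : ℝ) (K : ℕ) (h : B14Thm1Shape H033 Repr T c βc K) : LFStepObligation H033 Repr T c βc K := by
  intro hrg h033 k hk _ _ _
  obtain ⟨hr, h1, h2⟩ := h hrg h033 (k+1) hk
  exact ⟨hr,
    { rg := h1.rg k (Nat.lt_succ_self k)
      localDepE := h1.localDepE (k+1) k.succ_pos le_rfl
      localDepR := h1.localDepR (k+1) k.succ_pos le_rfl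
      gaugeInvE := h1.gaugeInvE (k+1) k.succ_pos le_rfl
      gaugeInvR := h1.gaugeInvR (k+1) k.succ_pos le_rfl
      improved := h2 }⟩

end ObligationsLF

/-! ## Part F — THE AUXILIARY INDUCTION OVER SCALES (v3): the small-factor budget `κ_j(Z)` of B16 pp.383–387, (1.79)–(1.89)

(Verbatim: STEP.md §7.6.)  After (1.77)–(1.78) the bound (1.79) on `𝐓′_k(X)1` is a product over the steps `j = 1, …, k` of COST
factors `exp{O(1)M^dR_j^{d+1}d′_j(Z_j)}` (volumes, sums over admissible sequences) and of SMALL factors `exp(−½γ₀A₁²p₀²(g_j)(d′_j(Z_j^{(i)})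
+ 1) − 2p₀(g_j))` per newly created large-field region.  B16 p.384 regroups the product of the first `j` factors per component `Z` of
`Z_j` as `exp(−κ_j(Z) − 2p₀(g_{j(Z)}))`, `j(Z)` = the index of a first large-field region in `Z`, and proves BY INDUCTION OVER `j`:
"The factor exp(−κ_j(Z)) controls K renormalization steps, under the assumption that no large fields are created in these steps, where
the number K is the smallest positive integer having the property that the domain S^K(Z) … satisfies the conditions (i), (ii), with
N = R_j. More precisely this means that (1.80) κ_j(Z) ≥ Σ_{n=j+1}^{j+K} O(1)M^dR_n^{d+1}d′_n(S^{n−j}(Z))" (after which the region is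
removed by the 𝐑 operation with a fresh factor `exp(−p₀(g_{j+K}))`).  THE NUMBERS `κ_j(Z)` ARE DATA CARRIED FROM SCALE `j` TO `j+1`
(update rules (1.83), p.386 line 2, (1.85)); at `j = k` with `K = 0`: `κ_k(X) ≥ 0`, whence the fundamental inequality (1.89)
(`FundIneq189`, Part D4).  Typed here: the carried data (`Budget.ScaleData`), the invariant (1.80) (`Budget.Controls`) and the
KERNEL-CHECKED ARITHMETIC of the printed proof; the geometry of the operation `S` enters through explicit hypotheses (growth of the
iterates p.384, scaling (6.31) [I], sub-additivity of `d′`, the endpoint of a maximal tree p.386 — the last one DISCHARGED in F4 (v5, end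
of file) over the graph `G` of p.386 by Mathlib's spanning-tree lemmas), and the LOCATED CONSTANT
RESTRICTIONS are explicit binders: p.383 "We assume that 2p₁ − (d+5)r₀ > p₀", p.385 "¼γ₀(14)^{−d}A₁²p₀²(g₁) ≥ O(1)2(64)^dM^dL^{d+1}R₁^{d+2}
… satisfied for p₀ large, and g₁ sufficiently small", p.387 "for p₀ large and γ small enough" (SMALLNESS.md).  The undisplayed input
of (1.81), `R_n ≤ LR_j` for `j < n ≤ j+K` ("for some steps we do not gain the scaling factor L⁻¹ (then R_{m+1} = LR_m)", p.385), is the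
binder `hR` of `Budget.majorant_181`.  Dimock's φ⁴₃ template does this bookkeeping GLOBALLY at the end of the flow ([Dimock2013BalabanIII]
§"convergence", TeX l.2156–2300: "We can assume 3r+2 < 2p₀", "N − i ≤ (N−i) log L − log λ = −log λ_i") — possible because the number of
remaining steps is ≤ −log λ_i for a relevant coupling; in d = 4 it is not, hence the per-scale budget (STEP.md §8 rows A25–A26). -/

namespace Budget

/-- Constants of the cost terms of (1.79)/(1.80): the `O(1)` (`C`), `M`, `d`, and the sequence `R_n` of B14 (2.5) (`B14.IsRj`, unit
r2).  Roles only. [cite: Balaban1989LargeFieldII, (1.79)–(1.80) p.383–384] -/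
structure Consts where
  C : ℝ
  M : ℝ
  d : ℕ
  R : ℕ → ℝ

/-- The cost `O(1)M^dR_n^{d+1}·s` of carrying a region of linear size `s` (in `MR_n`-cubes, `s = d′_n(·)`) through step `n`: the first
exponential of (1.79), the summand of (1.80). [cite: Balaban1989LargeFieldII, (1.80) p.384] -/
def Consts.cost (b : Consts) (n : ℕ) (s : ℝ) : ℝ := b.C * b.M ^ b.d * b.R n ^ (b.d + 1) * s

/-- The cost is additive in the size. [folklore] -/
theorem Consts.cost_add (b : Consts) (n : ℕ) (s t : ℝ) : b.cost n (s + t) = b.cost n s + b.cost n t := by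
  unfold Consts.cost; ring

/-- The cost is monotone in the size for non-negative constants. [folklore] -/
theorem Consts.cost_mono (b : Consts) (n : ℕ) {s t : ℝ} (hC : 0 ≤ b.C) (hM : 0 ≤ b.M) (hR : 0 ≤ b.R n) (hst : s ≤ t) :
    b.cost n s ≤ b.cost n t := by
  unfold Consts.cost
  have : 0 ≤ b.C * b.M ^ b.d * b.R n ^ (b.d + 1) := by positivity
  exact mul_le_mul_of_nonneg_left hst this

/-- (1.80) p.384, verbatim above: "κ_j(Z) ≥ Σ_{n=j+1}^{j+K} O(1)M^dR_n^{d+1}d′_n(S^{n−j}(Z))" — with the size profile `s n = d′_n(S^{n−j}(Z))`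
of the `S`-iterates: the budget `κ` at scale `j` CONTROLS `K` steps. [cite: Balaban1989LargeFieldII, (1.80) p.384] -/
def Controls (b : Consts) (j K : ℕ) (κ : ℝ) (s : ℕ → ℝ) : Prop :=
  ∑ n ∈ Finset.Ioc j (j + K), b.cost n (s n) ≤ κ

/-- THE DATA CARRIED FROM SCALE `j` TO `j+1` by the auxiliary induction (B16 p.384): the components `Z` of the large-field region `Z_j`
(an abstract index type `Comp`), for each its creation index `j(Z) ≤ j` ("the index of a first large field region contained in Z"),
its budget `κ_j(Z)`, the size profile `n ↦ d′_n(S^{n−j}(Z))` of its `S`-iterates and its control horizon `K(Z)` ("the smallest positive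
integer having the property that the domain S^K(Z) … satisfies the conditions (i), (ii), with N = R_j").  The regions themselves and the
operation `S(Z) = Z′^{~10}` are reader-level geometry (unit b02, `B16.lean`). [cite: Balaban1989LargeFieldII, statement before (1.80) p.384] -/
structure ScaleData (j : ℕ) where
  Comp : Type
  jZ : Comp → ℕ
  jZ_le : ∀ Z, jZ Z ≤ j
  κ : Comp → ℝ
  size : Comp → ℕ → ℝ
  K : Comp → ℕ

/-- The inductive statement at scale `j`: (1.80) for every component. [cite: Balaban1989LargeFieldII, (1.80) p.384] -/
def ScaleData.Invariant (b : Consts) {j : ℕ} (D : ScaleData j) : Prop :=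
  ∀ Z, Controls b j (D.K Z) (D.κ Z) (D.size Z)

/-- `K = 0`: the (1.80)-sum is empty and the statement reads `κ ≥ 0` (p.387: "the domain X in the definition (1.71) satisfies the
assumption of the statement with K = 0, therefore κ_k(X) ≥ 0"). [folklore] -/
theorem controls_zero_iff (b : Consts) (j : ℕ) (κ : ℝ) (s : ℕ → ℝ) : Controls b j 0 κ s ↔ 0 ≤ κ := by
  simp [Controls]

/-! ### F1. The geometric inputs of (1.81) as checked inequalities (p.384–385) -/

/-- p.384: "S^{n−j}(□) is a cube, which is a union of L^d_{n−j}MR_n-cubes, where L_{n−j} ≤ 42(1 − L^{−(n−j)})/(1 − L^{−1}) < 63."  The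
second inequality, cleared of the positive denominator `1 − 1/L`, holds for EVERY exponent `m` as soon as `L ≥ 3` (and fails for
`L = 2`, `m` large: 42(1 − 2^{−m})/(1/2) → 84).  Elementary. [cite: Balaban1989LargeFieldII, display after (1.80) p.384] -/
theorem L_iter_lt_63 (L : ℝ) (hL : 3 ≤ L) (m : ℕ) : 42 * (1 - 1 / L ^ m) < 63 * (1 - 1 / L) := by
  have hL0 : 0 < L := by linarith
  have h3 : 1 / L ≤ 1 / 3 := one_div_le_one_div_of_le (by norm_num) hL
  have hm : 0 < 1 / L ^ m := by positivity
  linarith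

/-- p.384–385: "From the scaling property (6.31) [I] we obtain d′_n(Z^{(n−j)}) ≤ L^{−½(n−j)}d′_j(Z) ≤ 2^{−(n−j)}d′_j(Z) for n − j > 1. The
square root appears here, because for some steps we do not gain the scaling factor L^{−1}".  The second inequality is `(√L)^{−m} ≤ 2^{−m}`,
true for every `m` iff `L ≥ 4`.  Elementary. [cite: Balaban1989LargeFieldII, display before (1.81) p.384–385] -/
theorem sqrt_scaling_le_half_pow (L : ℝ) (hL : 4 ≤ L) (m : ℕ) : 1 / Real.sqrt L ^ m ≤ 1 / (2 : ℝ) ^ m := by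
  have h2 : (2 : ℝ) ≤ Real.sqrt L := by
    have h4 : Real.sqrt 4 = 2 := by
      rw [show (4 : ℝ) = 2 ^ 2 by norm_num, Real.sqrt_sq (by norm_num)]
    rw [← h4]
    exact Real.sqrt_le_sqrt hL
  exact one_div_le_one_div_of_le (pow_pos two_pos m) (pow_le_pow_left₀ (by norm_num) h2 m)

/-- The geometric sum behind (1.81): `Σ_{n=j+1}^{N} 2^{−(n−j)} = 1 − 2^{−(N−j)}` for `j ≤ N`. [folklore] -/
theorem geom_sum_Ioc (j N : ℕ) (hjN : j ≤ N) :
    ∑ n ∈ Finset.Ioc j N, (1 / 2 : ℝ) ^ (n - j) = 1 - (1 / 2 : ℝ) ^ (N - j) := by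
  induction N, hjN using Nat.le_induction with
  | base => simp
  | succ N hjN ih =>
    rw [Finset.sum_Ioc_succ_top hjN, ih]
    have : N + 1 - j = (N - j) + 1 := by omega
    rw [this, pow_succ]
    ring

/-- `Σ_{n=j+1}^{N} 2^{−(n−j)} ≤ 1` (any `j`, `N`). [folklore] -/
theorem geom_sum_Ioc_le_one (j N : ℕ) : ∑ n ∈ Finset.Ioc j N, (1 / 2 : ℝ) ^ (n - j) ≤ 1 := by
  by_cases hjN : j ≤ N
  · rw [geom_sum_Ioc j N hjN]
    have : 0 ≤ (1 / 2 : ℝ) ^ (N - j) := by positivity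
    linarith
  · rw [Finset.Ioc_eq_empty (by omega), Finset.sum_empty]
    exact zero_le_one

/-- (1.81) p.385 AS A CHECKED INEQUALITY over its inputs: with `n₀` = "the last index n such that d′_n(Z^{(n−j)}) > 0", `r = R_j` further
steps ("K ≤ n₀ − j + R_j"), the growth-and-scaling bound `d′_n(S^{n−j}(Z)) ≤ A·2^{−(n−j)}·d′_j(Z)` for `j < n ≤ n₀` (`A = (63)^d·3·2^{d−1}`,
p.384) and `d′_n(S^{n−j}(Z)) ≤ B` for `n₀ < n ≤ n₀ + r` (`B = (64)^d`), and the UNDISPLAYED uniform bound `R_n^{d+1} ≤ ρ` on the whole range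
(`ρ = (LR_j)^{d+1}` from "R_n ≤ LR_j"): `Σ_{n=j+1}^{n₀+r} O(1)M^dR_n^{d+1}d′_n(S^{n−j}(Z)) ≤ O(1)M^d ρ (A·d′_j(Z) + B·r)` — the printed middle
expression of (1.81) (its last step `≤ O(1)(64)^dM^dL^{d+1}R_j^{d+2}(d′_j(Z)+1)` absorbs `3(126)^d ≤ O(1)(64)^dR_j` into an `O(1)` depending
on `d`).  Kernel-checked. [cite: Balaban1989LargeFieldII, (1.81) p.385] -/
theorem majorant_181 (b : Consts) (j n₀ r : ℕ) (hj : j ≤ n₀) (ρ A B s₀ : ℝ) (s : ℕ → ℝ)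
    (hC : 0 ≤ b.C) (hM : 0 ≤ b.M) (hA : 0 ≤ A) (hs₀ : 0 ≤ s₀) (hB : 0 ≤ B) (hρ : 0 ≤ ρ)
    (hR : ∀ n ∈ Finset.Ioc j (n₀ + r), 0 ≤ b.R n ∧ b.R n ^ (b.d + 1) ≤ ρ)
    (h1 : ∀ n ∈ Finset.Ioc j n₀, s n ≤ A * (1 / 2 : ℝ) ^ (n - j) * s₀)
    (h2 : ∀ n ∈ Finset.Ioc n₀ (n₀ + r), s n ≤ B) :
    ∑ n ∈ Finset.Ioc j (n₀ + r), b.cost n (s n) ≤ b.C * b.M ^ b.d * ρ * (A * s₀ + B * r) := by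
  rw [← Finset.sum_Ioc_consecutive _ hj (Nat.le_add_right n₀ r)]
  have e1 : ∑ n ∈ Finset.Ioc j n₀, b.cost n (s n) ≤ b.C * b.M ^ b.d * ρ * (A * s₀) := by
    calc ∑ n ∈ Finset.Ioc j n₀, b.cost n (s n)
        ≤ ∑ n ∈ Finset.Ioc j n₀, b.C * b.M ^ b.d * ρ * (A * s₀) * (1 / 2 : ℝ) ^ (n - j) := by
          apply Finset.sum_le_sum
          intro n hn
          have hn' : n ∈ Finset.Ioc j (n₀ + r) := by
            simp only [Finset.mem_Ioc] at hn ⊢; omega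
          obtain ⟨hR0, hRρ⟩ := hR n hn'
          unfold Consts.cost
          calc b.C * b.M ^ b.d * b.R n ^ (b.d + 1) * s n
              ≤ b.C * b.M ^ b.d * b.R n ^ (b.d + 1) * (A * (1 / 2 : ℝ) ^ (n - j) * s₀) :=
                mul_le_mul_of_nonneg_left (h1 n hn) (by positivity)
            _ ≤ b.C * b.M ^ b.d * ρ * (A * (1 / 2 : ℝ) ^ (n - j) * s₀) := by
                apply mul_le_mul_of_nonneg_right _ (by positivity)
                exact mul_le_mul_of_nonneg_left hRρ (by positivity)
            _ = b.C * b.M ^ b.d * ρ * (A * s₀) * (1 / 2 : ℝ) ^ (n - j) := by ring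
      _ = b.C * b.M ^ b.d * ρ * (A * s₀) * ∑ n ∈ Finset.Ioc j n₀, (1 / 2 : ℝ) ^ (n - j) := by
          rw [Finset.mul_sum]
      _ ≤ b.C * b.M ^ b.d * ρ * (A * s₀) * 1 :=
          mul_le_mul_of_nonneg_left (geom_sum_Ioc_le_one j n₀) (by positivity)
      _ = b.C * b.M ^ b.d * ρ * (A * s₀) := mul_one _
  have e2 : ∑ n ∈ Finset.Ioc n₀ (n₀ + r), b.cost n (s n) ≤ b.C * b.M ^ b.d * ρ * (B * r) := by
    calc ∑ n ∈ Finset.Ioc n₀ (n₀ + r), b.cost n (s n)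
        ≤ ∑ n ∈ Finset.Ioc n₀ (n₀ + r), b.C * b.M ^ b.d * ρ * B := by
          apply Finset.sum_le_sum
          intro n hn
          have hn' : n ∈ Finset.Ioc j (n₀ + r) := by
            simp only [Finset.mem_Ioc] at hn ⊢; omega
          obtain ⟨hR0, hRρ⟩ := hR n hn'
          unfold Consts.cost
          calc b.C * b.M ^ b.d * b.R n ^ (b.d + 1) * s n
              ≤ b.C * b.M ^ b.d * b.R n ^ (b.d + 1) * B := mul_le_mul_of_nonneg_left (h2 n hn) (by positivity)
            _ ≤ b.C * b.M ^ b.d * ρ * B := by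
                apply mul_le_mul_of_nonneg_right _ hB
                exact mul_le_mul_of_nonneg_left hRρ (by positivity)
      _ = (r : ℝ) * (b.C * b.M ^ b.d * ρ * B) := by
          rw [Finset.sum_const, Nat.card_Ioc, Nat.add_sub_cancel_left, nsmul_eq_mul]
      _ = b.C * b.M ^ b.d * ρ * (B * r) := by ring
  calc ∑ n ∈ Finset.Ioc j n₀, b.cost n (s n) + ∑ n ∈ Finset.Ioc n₀ (n₀ + r), b.cost n (s n)
      ≤ b.C * b.M ^ b.d * ρ * (A * s₀) + b.C * b.M ^ b.d * ρ * (B * r) := add_le_add e1 e2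
    _ = b.C * b.M ^ b.d * ρ * (A * s₀ + B * r) := by ring

/-! ### F2. The three cases of the induction over `j` (p.385–387) as arithmetic skeletons -/

/-- THE BASE CASE `j = 1` (p.385): from (1.82) "κ₁(Z) ≥ ¼γ₀(14)^{−d}A₁²p₀²(g₁)(d′₁(Z) + 1) − O(1)M^dR₁^{d+1}d′₁(Z)" (`hκ`, `a` = the
coefficient, `s = d′₁(Z)`), the majorant (1.81) `RHS(1.80) ≤ Q(d′₁(Z) + 1)` (`hrhs`, `Q = O(1)(64)^dM^dL^{d+1}R₁^{d+2}`), the same bound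
for the subtracted cost (`hcost`), and the LOCATED CONDITION "¼γ₀(14)^{−d}A₁²p₀²(g₁) ≥ O(1)2(64)^dM^dL^{d+1}R₁^{d+2}" (`hcond`: `2Q ≤ a`;
"This condition is satisfied for p₀ large, and g₁ sufficiently small") follows (1.80) at `j = 1`.  Arithmetic. [cite: Balaban1989LargeFieldII, (1.82) p.385] -/
theorem base_182 (κ a Q cost rhs s : ℝ) (hs : 0 ≤ s) (hκ : a * (s + 1) - cost ≤ κ) (hrhs : rhs ≤ Q * (s + 1))
    (hcost : cost ≤ Q * (s + 1)) (hcond : 2 * Q ≤ a) : rhs ≤ κ := by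
  have h := mul_le_mul_of_nonneg_right hcond (show (0 : ℝ) ≤ s + 1 by linarith)
  linarith

/-- CASE 1 of the step `j → j+1` (p.385, (1.83)): "no large fields were introduced in the last step, hence Z = S(Z₀) … (1.83)
κ_{j+1}(Z) = κ_j(Z₀) − O(1)M^dR_{j+1}^{d+1}d′_{j+1}(Z). The equality Z = S(Z₀), and the inequality (1.80) holding for j and Z₀, imply
that this inequality holds for j+1 and Z": the `S`-iterates of `Z` are those of `Z₀` (same profile `s`), the horizon drops by one and
the budget by exactly the `n = j+1` summand.  Kernel-checked. [cite: Balaban1989LargeFieldII, (1.83) p.385] -/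
theorem case1_183 (b : Consts) (j K : ℕ) (hK : 1 ≤ K) (κ : ℝ) (s : ℕ → ℝ) (h : Controls b j K κ s) :
    Controls b (j + 1) (K - 1) (κ - b.cost (j + 1) (s (j + 1))) s := by
  unfold Controls at *
  have hsplit := Finset.sum_Ioc_consecutive (fun n => b.cost n (s n)) (Nat.le_succ j)
    (show j + 1 ≤ j + K by omega)
  rw [Nat.Ioc_succ_singleton, Finset.sum_singleton] at hsplit
  have hjK : j + 1 + (K - 1) = j + K := by omega
  rw [hjK]
  linarith

/-- CASE 1′ (p.385 bottom – p.386 line 2): "Z = S(Z₀), Z₀ satisfies the conditions (i), (ii), and a new large field was introduced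
in the preparatory operations. Then κ_j(Z₀) ≥ 0, and we do not have a better bound for it, but we have the new factor exp(−p₀(g_j)).
We define κ_{j+1}(Z) = p₀(g_j) − O(1)M^dR_{j+1}^{d+1}d′_{j+1}(Z). It satisfies (1.80), because Z is a small domain, it is contained in
a cube of the size 100MR_{j+1}, hence K = R_{j+1} for Z."  The RESET: the fresh factor `p = p₀(g_j)` must pay the costs of the small
domain for the `K′ + 1` steps `n = j+1, …, j+1+K′` (`hsmall`, the smallness condition the sentence asserts; `K′ = R_{j+1}`).
Kernel-checked. [cite: Balaban1989LargeFieldII, §1 p.386] -/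
theorem reset_p386 (b : Consts) (j K' : ℕ) (p : ℝ) (s : ℕ → ℝ)
    (hsmall : ∑ n ∈ Finset.Ioc j (j + 1 + K'), b.cost n (s n) ≤ p) :
    Controls b (j + 1) K' (p - b.cost (j + 1) (s (j + 1))) s := by
  unfold Controls
  have hsplit := Finset.sum_Ioc_consecutive (fun n => b.cost n (s n)) (Nat.le_succ j)
    (show j + 1 ≤ j + 1 + K' by omega)
  rw [Nat.Ioc_succ_singleton, Finset.sum_singleton] at hsplit
  linarith

/-- (1.85) p.386, CASE 2 (a merger): "κ_{j+1}(Z) = Σ_n(κ_j(Z_j^{(n)}) + 2p₀(g_{j(Z_j^{(n)})})) + Σ_i(γ₀A₁²p₀²(g_{j+1})(d′_{j+1}(Z_{j+1}^{(i)}) + 1) +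
2p₀(g_{j+1})) − O(1)M^dR_{j+1}^{d+1}d′_{j+1}(Z) − 2p₀(g_{j(Z)})": over an index type `ι` of PIECES (old components and new regions alike,
with `contrib q` the bracket each contributes), the budget of the family `S` with the cost `costS` of its union and `PS = 2p₀(g_{j(Z)})`.
(The new-region bracket carries `γ₀A₁²p₀²` where (1.79) has `½γ₀A₁²p₀²` — print-level, DIVERGENCE D-f2.12/D-b02.7.) [cite: Balaban1989LargeFieldII, (1.85) p.386] -/
def merge {ι : Type*} (contrib : ι → ℝ) (S : Finset ι) (costS PS : ℝ) : ℝ :=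
  (∑ q ∈ S, contrib q) - costS - PS

/-- (1.86) p.386: splitting one piece `x` off the family — "κ_{j+1}(Z) = κ_{j+1}(X) + κ_{j+1}(Y) + 2p₀(g_{j(X)}) + 2p₀(g_{j(Y)}) − 2p₀(g_{j(Z)}) +
O(1)M^dR_{j+1}^{d+1}d′_{j+1}(X) + O(1)M^dR_{j+1}^{d+1}d′_{j+1}(Y) − O(1)M^dR_{j+1}^{d+1}d′_{j+1}(Z)".  Pure algebra from (1.85). [cite: Balaban1989LargeFieldII, (1.86) p.386] -/
theorem merge_eq_186 {ι : Type*} [DecidableEq ι] (contrib : ι → ℝ) (S : Finset ι) (x : ι) (hx : x ∈ S)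
    (costS PS costX PX costY PY : ℝ) :
    merge contrib S costS PS = merge contrib {x} costX PX + merge contrib (S.erase x) costY PY
      + (PX + PY - PS) + (costX + costY - costS) := by
  unfold merge
  rw [← Finset.add_sum_erase S contrib hx, Finset.sum_singleton]
  ring

/-- (1.87)–(1.88) p.387, THE BINARY STEP of the induction on the number of pieces, as arithmetic: from (1.86) (`h186`), "The index j(Z)
is equal to one of the indices j(X), j(Y), hence 2p₀(g_{j(X)}) + 2p₀(g_{j(Y)}) − 2p₀(g_{j(Z)}) ≥ 2(1+β₀)⁻¹p₀(g_{j+1})" (`hP`, `q` = the right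
side), "d′_{j+1}(X) + d′_{j+1}(Y) + 2d ≥ d′_{j+1}(Z)" in cost form (`hc`, `D = O(1)2dM^dR_{j+1}^{d+1}`), the sub-additivity of the
(1.80)-sums over the `S`-iterates with the overshoot `E = O(1)·(100M)^dR_{j+1}^{d+2}`-terms (`hsub`, p.387 lines 3–12), (1.80) for `X`
and for `Y` (`hX`, `hY`), and the LOCATED CONDITION "for p₀ large and γ small enough" (`hbudget`: `E + D ≤ q`) follows (1.80) for `Z`
— the chain (1.88).  Kernel-checked. [cite: Balaban1989LargeFieldII, (1.87)–(1.88) p.387] -/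
theorem merge_step (κZ κX κY PX PY PZ cX cY cZ rhsZ rhsX rhsY q E D : ℝ)
    (h186 : κZ = κX + κY + (PX + PY - PZ) + (cX + cY - cZ)) (hP : q ≤ PX + PY - PZ) (hc : cZ ≤ cX + cY + D)
    (hsub : rhsZ ≤ rhsX + rhsY + E) (hX : rhsX ≤ κX) (hY : rhsY ≤ κY) (hbudget : E + D ≤ q) : rhsZ ≤ κZ := by
  linarith

/-- THE INDUCTION ON THE NUMBER OF PIECES (p.386: "We show that this number satisfies (1.80) by an induction with respect to the
number of domains in {Z_j^{(n)}, Z_{j+1}^{(i)}} … Take a maximal tree graph contained in the graph G. This tree graph has some nonzero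
number of endpoints … denote the corresponding domain … by X. Remove the vertex … the union of the domains … corresponding to the
vertices of the obtained graph is a connected domain. Denote this domain by Y"), REDUCED TO ITS INPUTS: a connectedness predicate
`Conn` on families with the endpoint property (`hleaf`), (1.80) for single pieces (`hsingle`: "(1.80) holds also for X and
κ_{j+1}(X), because there is the exactly one domain in X" — cases 1/1′ or the first step), the three local inequalities of
`merge_step` for every split (`hP`, `hc`, `hsub`) and ONE budget condition (`hbudget`).  Conclusion: (1.80), in the form
`rhs S ≤ merge contrib S (cost S) (P S)`, for every connected non-empty family.  Kernel-checked (strong induction on the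
family). [cite: Balaban1989LargeFieldII, proof of (1.80) p.386–387] -/
theorem merge_controls {ι : Type*} [DecidableEq ι] (contrib : ι → ℝ) (cost P rhs : Finset ι → ℝ)
    (Conn : Finset ι → Prop) (q E D : ℝ)
    (hleaf : ∀ S, Conn S → 2 ≤ S.card → ∃ x ∈ S, Conn (S.erase x))
    (hsingle : ∀ x, rhs {x} ≤ merge contrib {x} (cost {x}) (P {x}))
    (hP : ∀ S x, x ∈ S → 2 ≤ S.card → q ≤ P {x} + P (S.erase x) - P S)
    (hc : ∀ S x, x ∈ S → 2 ≤ S.card → cost S ≤ cost {x} + cost (S.erase x) + D)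
    (hsub : ∀ S x, x ∈ S → 2 ≤ S.card → Conn S → Conn (S.erase x) →
      rhs S ≤ rhs {x} + rhs (S.erase x) + E)
    (hbudget : E + D ≤ q) :
    ∀ S, Conn S → S.Nonempty → rhs S ≤ merge contrib S (cost S) (P S) := by
  intro S
  induction S using Finset.strongInduction with
  | H S ih =>
    intro hconn hne
    by_cases h2 : 2 ≤ S.card
    · obtain ⟨x, hx, hconnY⟩ := hleaf S hconn h2
      have hYne : (S.erase x).Nonempty := by
        rw [← Finset.card_pos, Finset.card_erase_of_mem hx]
        omega
      have ihY := ih (S.erase x) (Finset.erase_ssubset hx) hconnY hYne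
      exact merge_step _ _ _ _ _ _ _ _ _ _ _ _ q E D
        (merge_eq_186 contrib S x hx (cost S) (P S) (cost {x}) (P {x}) (cost (S.erase x)) (P (S.erase x)))
        (hP S x hx h2) (hc S x hx h2) (hsub S x hx h2 hconn hconnY) (hsingle x) ihY hbudget
    · have hcard : S.card = 1 := by
        have := Finset.card_pos.mpr hne
        omega
      obtain ⟨y, rfl⟩ := Finset.card_eq_one.mp hcard
      exact hsingle y

/-! ### F3. The conclusion at `j = k` (p.387): `K = 0` ⇒ `κ_k(X) ≥ 0` ⇒ the fundamental inequality (1.89) -/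

/-- p.387: "At first, the domain X in the definition (1.71) satisfies the assumption of the statement with K = 0, therefore κ_k(X) ≥ 0,
and we have the fundamental inequality (1.89) 𝐓′_k(X)1 ≤ exp(−2(1+β₀)⁻¹p₀(g_k))."  From the factor form `𝐓′_k(X)1 ≤ exp(−κ_k(X) −
2p₀(g_{j(X)}))` of p.384 (`hT`), `κ_k(X) ≥ 0` (`hκ`, = `controls_zero_iff`) and `2p₀(g_{j(X)}) ≥ 2(1+β₀)⁻¹p₀(g_k)` (`hP`, the monotonicity
with slack of `p₀(g_j)` along the flow, [III] §2) follows `FundIneq189` of Part D4.  Kernel-checked. [cite: Balaban1989LargeFieldII, (1.89) p.387] -/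
theorem fundIneq189_of_budget {V : Type*} (T1X : V → ℝ) (A₀ : ℝ) (p₀ : ℕ) (β₀ gk κ Pj : ℝ)
    (hT : ∀ v, T1X v ≤ Real.exp (-κ - Pj)) (hκ : 0 ≤ κ) (hP : 2 * (1 + β₀)⁻¹ * p0Profile A₀ p₀ gk ≤ Pj) :
    FundIneq189 T1X A₀ p₀ β₀ gk := by
  intro v
  refine le_trans (hT v) (Real.exp_le_exp.mpr ?_)
  linarith

end Budget

/-! ## Part G — THE REMAINING CLAUSES OF B14 §2 (v4): symmetry data the bare carriers lack; (2.41)(i),(iii) and the component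
localization of p.262 for the boundary terms; the Euclidean covariance (2.29), (2.32)–(2.33); the vacuum-energy constant `E` pinned

B14 §2 [Balaban1988Convergent] states four properties of the terms of (2.23) that `LFHyp` (Part B3) does not carry, recorded by the
reader unit r2 as DIVERGENCE D-r2.7 ("nothing asserted, nothing lost").  For the boundary terms, (2.41) p.261: "(i) it depends on U_k, A
restricted to X; … (iii) the extended function is invariant with respect to (G-valued) gauge transformations of 𝐔, 𝐉, A (the variables
𝐉, A are transformed by the adjoint representation of the gauge transformations)", and p.262: "The terms have a bit more precise
localization property. Denote Ω₀ = Ω₁~, and consider X∩Ω₀. It is a union of components. If a component does not connect to Ω_j, i.e., if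
the intersection of this component with Ω_j is empty, then the functions does ⟦sic⟧ not depend on the fields (𝐔, 𝐉), A restricted to
this component."  For the other terms, the Euclidean covariance (2.29) p.260 of the point functions `𝐄^{(j)}(U_j, z)` — "𝐄^{(j)}(rU_j, rz)
= 𝐄^{(j)}(U_j, z) for arbitrary Euclidean transformations r of the lattice T^{(j)}, and for regular configurations U_j. This implies that
the function 𝐄^{(j)}(U_j, z) is invariant with respect to the Euclidean transformations of U_j leaving the point z invariant" — and
(2.32)–(2.33) p.260 of the 𝐑-terms — "𝐑^{(j)}(rX, rU_j) = 𝐑^{(j)}(X, U_j) holding for these Euclidean transformations r, which leave the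
partition of the lattice T_ξ in MR_j-cubes invariant. The above property will follow immediately from the construction of the 𝐑-terms
given in the next paper. If we sum up all these terms over all the admissible domains X in T_ξ, we get a Euclidean invariant function
𝐑^{(j)}(U_j), i.e., 𝐑^{(j)}(rU_j) = 𝐑^{(j)}(U_j), where 𝐑^{(j)}(U_j) = Σ_X 𝐑^{(j)}(X, U_j), and the transformations r are as above."  They could not be
FIELDS of `LFHyp`: the abstract carriers of `LFTower` — `Φ` (the configurations `(𝐔,𝐉)`), `𝔄` (the fluctuation fields `A` with the
`S`-data), `(sys j).Dom` (the localization domains `𝐃_j`), `Pt j` (the points of `T_1^{(j)}`) — have no restriction of `𝔄` to a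
domain, no gauge action on `𝔄`, no distinguished `G`-valued transformations inside `𝒢`, and no Euclidean group.  Part G supplies exactly
this as SEPARATE DATA `LFSymm T` (G1) — no landed record changes; every importer of `LFTower` / `LFHyp` / `LFNewTerms` is unaffected, a
reader binding the 𝐑-operation adds the predicates below BY NAME — and types the clauses as the cumulative predicates `LFHypB T S k`
(G2: (2.41)(i), (iii), p.262) and `LFCov T S k` (G3: (2.29), (2.32)) with the same bookkeeping as Part E (`zero` / `mono` / `succ`,
`…_all_of_steps`), plus the remarks the print makes in words, kernel-checked: the p.262 property REFINES (2.41)(i)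
(`LFHypB.ofCompLoc`); the invariance of `𝐄^{(j)}(U_j, z)` under the transformations fixing `z` FOLLOWS from (2.29) (`LFCov.inv229_of_fix`);
(2.33) FOLLOWS from (2.32) by re-indexing the sum over the admissible domains (`LFCov.inv233`).  The fifth item of D-r2.7, (2.9) p.256,
is typed in the sibling `B14FlowStep` (`FlowIneq29`, `flowIneq29_of_27`, `third_member_29_sharp`; unit strat-b14) and is not restated.
G4 records, at the density level of Part D, the elementary fact behind the cell's question GAPS G-pv06-1 (1): with the Wilson start
`ρ₀ = exp[−(1/g₀²)A − E]` (Thm 1 p.262) the integral invariant turns a pointwise UPPER bound `ρ_K ≤ exp c` on `T^{(K)}` (the upper half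
of (0.1) [Balaban1989LargeFieldII] / (2.50), `c = E₊|T_η|`) into `exp(−E)·Z_W(g₀) ≤ exp c`, `Z_W(g₀) = ∫dU exp[−(1/g₀²)A(U)]` the Wilson
partition function — the printed bounds PIN the vacuum-energy constant `E` (p.262: "The constant E_k (depending on {Ω_j}, {Λ_j} also) is
obtained by subtracting one-step vacuum energy expressions, generated in small field regions, from the initial constant E. This initial
constant is defined in fact as a sum of all such expressions for all the lattices T^{(k)} as the small field regions") from below by
`log Z_W(g₀) − c ≤ E`, and any integrable pointwise minorant of `ρ_K` (the lower half of (0.1)) bounds `exp(−E)·Z_W(g₀)` from below.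
-/

section Symmetries
variable {P : Params} {G : Type*} [GaugeGroup G] {Φ 𝒢 𝔄 : Type*}

/-- G1. SYMMETRY DATA over a complete tower — what B14 §2 uses in words and the carriers of `LFTower` do not have:
* `agreeOnA j X a a'` — the systems of fluctuation fields (with their `S`-data) `a, a'` agree "restricted to X" ((2.41)(i) p.261);
* `actA u a` — the action of a gauge transformation `u` on `A`, "by the adjoint representation" ((2.41)(iii)); on `(𝐔,𝐉)` the action is
  `T.act` ((I.1.10) `(𝐔,𝐉)^u = (u₋𝐔u₊⁻¹, R(u₋)𝐉)`);
* `isG u` — `u` is `G`-valued ((2.41)(iii): the 𝐁-terms are invariant "with respect to (G-valued) gauge transformations", whereas (iii)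
  after (2.27) for the 𝐄-, 𝐑-terms is the full (I.1.10), all `G^c`-valued `u`);
* `coreAgree j X φ a ψ a'` — `(φ, a)` and `(ψ, a')` agree on `X` MINUS the components of `X ∩ Ω₀`, `Ω₀ = Ω₁~`, not connecting to `Ω_j`
  (p.262); these components depend on the sequence `{Ω_j}`, which at this level enters through `𝔄` (it carries the `S`-data already) or
  through a per-history instantiation of this record (DIVERGENCE D-f2.13); axiom `core_of_agree`: agreement on all of `X` implies
  agreement on its essential part;
* `Euc j` — the Euclidean transformations `r` of the lattice `T^{(j)}` ((2.29)), acting on domains `smulDom`, points `smulPt` and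
  configurations `smulΦ`; `cubePres j r` — `r` leaves "the partition of the lattice T_ξ in MR_j-cubes invariant" ((2.32)); `regular j` —
  the "regular configurations U_j" of (2.29); `mem j z X` — `z ∈ X` (the UNRESTRICTED sum of (2.27) "over all X ∈ 𝐃_j containing the point
  z", p.260); `admAll j X` — `X` is one of "all the admissible domains X in T_ξ" of (2.33) (a union of `MR_j`-cubes); axioms: incidence is
  preserved (`mem_smul`), a cube-preserving `r` permutes the admissible domains (`admAll_smul`), `r` is a bijection of `𝐃_j` (`smulDom_bijective`).
No group structure on `Euc j` is needed by any clause and none is imposed. [cite: Balaban1988Convergent, (2.27)–(2.29) p.259–260, (2.32)–(2.33) p.260, (2.41) p.261, p.262] -/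
structure LFSymm (T : LFTower P G Φ 𝒢 𝔄) where
  agreeOnA : (j : ℕ) → (T.sys j).Dom → 𝔄 → 𝔄 → Prop
  actA : 𝒢 → 𝔄 → 𝔄
  isG : 𝒢 → Prop
  coreAgree : (j : ℕ) → (T.sys j).Dom → Φ → 𝔄 → Φ → 𝔄 → Prop
  core_of_agree : ∀ (j : ℕ) (X : (T.sys j).Dom) (φ : Φ) (a : 𝔄) (ψ : Φ) (a' : 𝔄),
    T.agreeOn j X φ ψ → agreeOnA j X a a' → coreAgree j X φ a ψ a'
  Euc : ℕ → Type
  smulDom : (j : ℕ) → Euc j → (T.sys j).Dom → (T.sys j).Dom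
  smulPt : (j : ℕ) → Euc j → T.Pt j → T.Pt j
  smulΦ : (j : ℕ) → Euc j → Φ → Φ
  cubePres : (j : ℕ) → Euc j → Prop
  regular : (j : ℕ) → Set Φ
  mem : (j : ℕ) → T.Pt j → (T.sys j).Dom → Bool
  admAll : (j : ℕ) → (T.sys j).Dom → Bool
  mem_smul : ∀ (j : ℕ) (r : Euc j) (z : T.Pt j) (X : (T.sys j).Dom), mem j (smulPt j r z) (smulDom j r X) = mem j z X
  admAll_smul : ∀ (j : ℕ) (r : Euc j), cubePres j r → ∀ X : (T.sys j).Dom, admAll j (smulDom j r X) = admAll j X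
  smulDom_bijective : ∀ (j : ℕ) (r : Euc j), Function.Bijective (smulDom j r)

namespace LFSymm
variable {T : LFTower P G Φ 𝒢 𝔄}

/-- The point function `𝐄^{(j)}(U_j, z) := Σ_{X ∋ z} 𝐄^{(j)}(X, U_j, z)` "defined by the equality (2.27) with the unrestricted summation,
i.e., with the sum over all X ∈ 𝐃_j containing the point z" (p.260) — the object of the covariance (2.29) ("We have it only for
functions 𝐄^{(j)}(U_j, z) defined by … the unrestricted summation"). [cite: Balaban1988Convergent, (2.27) p.259, p.260] -/
noncomputable def Ez (S : LFSymm T) (j : ℕ) (z : T.Pt j) (g : ℝ) (φ : Φ) : ℂ :=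
  ∑ X : (T.sys j).Dom, if S.mem j z X then T.E j X z g φ else 0

/-- `𝐑^{(j)}(U_j) := Σ_X 𝐑^{(j)}(X, U_j)`, the sum "over all the admissible domains X in T_ξ" ((2.33) p.260). [cite: Balaban1988Convergent, (2.33) p.260] -/
noncomputable def Rtot (S : LFSymm T) (j : ℕ) (φ : Φ) : ℂ :=
  ∑ X : (T.sys j).Dom, if S.admAll j X then T.R j X φ else 0

end LFSymm

/-- G2. THE BOUNDARY-TERM CLAUSES (2.41)(i), (iii) AND THE COMPONENT LOCALIZATION OF p.262 on the scales `j = 1, …, k`, exactly as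
stated (quotations in the Part G header): `localDepB` = (i) "it depends on U_k, A restricted to X"; `gaugeInvB` = (iii), for `G`-valued `u`
only, `(𝐔,𝐉) ↦ (𝐔,𝐉)^u` by `T.act` and `A ↦ R(u)A` by `S.actA`; `compLocB` = p.262 (no dependence on `(𝐔,𝐉), A` restricted to the
components of `X ∩ Ω₀` not connecting to `Ω_j`).  ((ii) analyticity on `Ũ^c_j(X, α̃₀, α̃₁)` is the space `LFTower.spaceB`, (iv) = (2.42)
is `LFHyp.boundB`; DIVERGENCE D-f2.1, D-f2.6.)  The 𝐄-, 𝐑-analogues of (i), (iii) are `LFHyp.localDepE/R`, `gaugeInvE/R`. [cite: Balaban1988Convergent, (2.41)(i),(iii) p.261, p.262] -/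
structure LFHypB (T : LFTower P G Φ 𝒢 𝔄) (S : LFSymm T) (k : ℕ) : Prop where
  localDepB : ∀ j, 1 ≤ j → j ≤ k → ∀ (X : (T.sys j).Dom) (φ ψ : Φ) (a a' : 𝔄),
    T.agreeOn j X φ ψ → S.agreeOnA j X a a' → T.B j X φ a = T.B j X ψ a'
  gaugeInvB : ∀ j, 1 ≤ j → j ≤ k → ∀ (X : (T.sys j).Dom) (u : 𝒢) (φ : Φ) (a : 𝔄),
    S.isG u → T.B j X (T.act u φ) (S.actA u a) = T.B j X φ a
  compLocB : ∀ j, 1 ≤ j → j ≤ k → ∀ (X : (T.sys j).Dom) (φ : Φ) (a : 𝔄) (ψ : Φ) (a' : 𝔄),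
    S.coreAgree j X φ a ψ a' → T.B j X φ a = T.B j X ψ a'

/-- p.262 REFINES (2.41)(i) ("The terms have a bit more precise localization property"): gauge invariance and the component
localization alone give all three clauses, `localDepB` through `LFSymm.core_of_agree`.  Bookkeeping. [folklore] -/
theorem LFHypB.ofCompLoc {T : LFTower P G Φ 𝒢 𝔄} {S : LFSymm T} {k : ℕ}
    (hg : ∀ j, 1 ≤ j → j ≤ k → ∀ (X : (T.sys j).Dom) (u : 𝒢) (φ : Φ) (a : 𝔄),
      S.isG u → T.B j X (T.act u φ) (S.actA u a) = T.B j X φ a)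
    (hc : ∀ j, 1 ≤ j → j ≤ k → ∀ (X : (T.sys j).Dom) (φ : Φ) (a : 𝔄) (ψ : Φ) (a' : 𝔄),
      S.coreAgree j X φ a ψ a' → T.B j X φ a = T.B j X ψ a') :
    LFHypB T S k where
  localDepB := fun j h1 hj X φ ψ a a' hφ ha => hc j h1 hj X φ a ψ a' (S.core_of_agree j X φ a ψ a' hφ ha)
  gaugeInvB := hg
  compLocB := hc

/-- The boundary-term clauses on the scales `≤ k` restrict to the scales `≤ j` for `j ≤ k`. [folklore] -/
theorem LFHypB.mono {T : LFTower P G Φ 𝒢 𝔄} {S : LFSymm T} {k j : ℕ} (h : LFHypB T S k) (hjk : j ≤ k) : LFHypB T S j where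
  localDepB := fun i h1 hi => h.localDepB i h1 (le_trans hi hjk)
  gaugeInvB := fun i h1 hi => h.gaugeInvB i h1 (le_trans hi hjk)
  compLocB := fun i h1 hi => h.compLocB i h1 (le_trans hi hjk)

/-- At `k = 0` there are no boundary terms: the clauses are vacuous. [folklore] -/
theorem LFHypB.zero (T : LFTower P G Φ 𝒢 𝔄) (S : LFSymm T) : LFHypB T S 0 where
  localDepB := fun j h1 hj => absurd hj (by omega)
  gaugeInvB := fun j h1 hj => absurd hj (by omega)
  compLocB := fun j h1 hj => absurd hj (by omega)

/-- THE NEW-TERM OBLIGATIONS of the step `k → k+1` for the boundary terms `𝐁^{(k+1)}` (B14 p.262; B16 p.390: the new boundary terms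
"have the form (2.40) [III], and satisfy the conditions formulated after these equalities in [III]"): (2.41)(iii) and p.262 at the new
index — (i) then follows (`LFHypB.ofCompLoc`).  The companion of Part E's `LFNewTerms` (which carries the 𝐄-, 𝐑-clauses and the
bounds). [cite: Balaban1988Convergent, §2 p.262] -/
structure LFNewTermsB (T : LFTower P G Φ 𝒢 𝔄) (S : LFSymm T) (k : ℕ) : Prop where
  gaugeInvB : ∀ (X : (T.sys (k+1)).Dom) (u : 𝒢) (φ : Φ) (a : 𝔄),
    S.isG u → T.B (k+1) X (T.act u φ) (S.actA u a) = T.B (k+1) X φ a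
  compLocB : ∀ (X : (T.sys (k+1)).Dom) (φ : Φ) (a : 𝔄) (ψ : Φ) (a' : 𝔄),
    S.coreAgree (k+1) X φ a ψ a' → T.B (k+1) X φ a = T.B (k+1) X ψ a'

/-- ONE STEP of the boundary-term bookkeeping: the clauses at `k` and the new-term obligations of the step `k → k+1` give the clauses at
`k+1` (B14 p.262 "the expressions with indices j < k are exactly as described above"). [folklore] -/
theorem LFHypB.succ {T : LFTower P G Φ 𝒢 𝔄} {S : LFSymm T} {k : ℕ} (h : LFHypB T S k) (hn : LFNewTermsB T S k) :
    LFHypB T S (k+1) := by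
  refine LFHypB.ofCompLoc (fun j h1 hj => ?_) (fun j h1 hj => ?_)
  · rcases Nat.of_le_succ hj with hj' | rfl
    · exact h.gaugeInvB j h1 hj'
    · exact hn.gaugeInvB
  · rcases Nat.of_le_succ hj with hj' | rfl
    · exact h.compLocB j h1 hj'
    · exact hn.compLocB

/-- Conversely the clauses at `k+1` contain the new-term obligations of the step `k → k+1`. [folklore] -/
theorem LFHypB.newTerm {T : LFTower P G Φ 𝒢 𝔄} {S : LFSymm T} {k : ℕ} (h : LFHypB T S (k+1)) : LFNewTermsB T S k where
  gaugeInvB := h.gaugeInvB (k+1) k.succ_pos le_rfl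
  compLocB := h.compLocB (k+1) k.succ_pos le_rfl

/-- `LFHypB T S (k+1) ⟺ LFHypB T S k ∧ LFNewTermsB T S k`. [folklore] -/
theorem LFHypB.succ_iff (T : LFTower P G Φ 𝒢 𝔄) (S : LFSymm T) (k : ℕ) :
    LFHypB T S (k+1) ↔ LFHypB T S k ∧ LFNewTermsB T S k :=
  ⟨fun h => ⟨h.mono k.le_succ, h.newTerm⟩, fun h => h.1.succ h.2⟩

/-- THE INDUCTION ON `k` for the boundary-term clauses: if every step `k < K` delivers `LFNewTermsB T S k`, the clauses hold at every
`k ≤ K`. [folklore] -/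
theorem lfHypB_all_of_steps {T : LFTower P G Φ 𝒢 𝔄} {S : LFSymm T} {K : ℕ} (hstep : ∀ k, k < K → LFHypB T S k → LFNewTermsB T S k) :
    ∀ k, k ≤ K → LFHypB T S k := by
  intro k
  induction k with
  | zero => intro _; exact LFHypB.zero T S
  | succ k ih =>
    intro hk
    have hk' : k < K := Nat.lt_of_succ_le hk
    exact (ih hk'.le).succ (hstep k hk' (ih hk'.le))

/-- G3. THE EUCLIDEAN COVARIANCE CLAUSES on the scales `j = 1, …, k`, exactly as stated (quotations in the Part G header): `cov229` =
(2.29) for the point functions `LFSymm.Ez` (the unrestricted sum), for all Euclidean transformations `r` of `T^{(j)}` and the regular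
configurations; `cov232` = (2.32) for the 𝐑-terms and the transformations preserving the partition in `MR_j`-cubes — typed, as (2.29), for
the regular configurations `U_j` (the background configurations of §2; DIVERGENCE D-f2.13).  B16 p.390 delivers (2.32) for the new
𝐑-terms: "By their construction it is also clear that they are Euclidean covariant, i.e., they have the property (2.32) [III]". [cite: Balaban1988Convergent, (2.29), (2.32) p.260] -/
structure LFCov (T : LFTower P G Φ 𝒢 𝔄) (S : LFSymm T) (k : ℕ) : Prop where
  cov229 : ∀ j, 1 ≤ j → j ≤ k → ∀ (r : S.Euc j) (z : T.Pt j) (g : ℝ) (φ : Φ), φ ∈ S.regular j →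
    S.Ez j (S.smulPt j r z) g (S.smulΦ j r φ) = S.Ez j z g φ
  cov232 : ∀ j, 1 ≤ j → j ≤ k → ∀ (r : S.Euc j), S.cubePres j r → ∀ (X : (T.sys j).Dom) (φ : Φ), φ ∈ S.regular j →
    T.R j (S.smulDom j r X) (S.smulΦ j r φ) = T.R j X φ

/-- The sentence after (2.29): "This implies that the function 𝐄^{(j)}(U_j, z) is invariant with respect to the Euclidean transformations
of U_j leaving the point z invariant."  Kernel-checked from `cov229`. [cite: Balaban1988Convergent, p.260 after (2.29)] -/
theorem LFCov.inv229_of_fix {T : LFTower P G Φ 𝒢 𝔄} {S : LFSymm T} {k : ℕ} (h : LFCov T S k) {j : ℕ} (h1 : 1 ≤ j) (hj : j ≤ k)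
    (r : S.Euc j) (z : T.Pt j) (hz : S.smulPt j r z = z) (g : ℝ) (φ : Φ) (hφ : φ ∈ S.regular j) :
    S.Ez j z g (S.smulΦ j r φ) = S.Ez j z g φ := by
  have := h.cov229 j h1 hj r z g φ hφ
  rwa [hz] at this

/-- (2.33) FOLLOWS FROM (2.32): "If we sum up all these terms over all the admissible domains X in T_ξ, we get a Euclidean invariant
function 𝐑^{(j)}(U_j), i.e., 𝐑^{(j)}(rU_j) = 𝐑^{(j)}(U_j)".  Kernel-checked by re-indexing the sum over `𝐃_j` along the bijection `X ↦ rX`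
(`LFSymm.smulDom_bijective`), which preserves admissibility (`admAll_smul`). [cite: Balaban1988Convergent, (2.33) p.260] -/
theorem LFCov.inv233 {T : LFTower P G Φ 𝒢 𝔄} {S : LFSymm T} {k : ℕ} (h : LFCov T S k) {j : ℕ} (h1 : 1 ≤ j) (hj : j ≤ k)
    (r : S.Euc j) (hr : S.cubePres j r) (φ : Φ) (hφ : φ ∈ S.regular j) :
    S.Rtot j (S.smulΦ j r φ) = S.Rtot j φ := by
  unfold LFSymm.Rtot
  rw [← (S.smulDom_bijective j r).sum_comp (fun X => if S.admAll j X then T.R j X (S.smulΦ j r φ) else 0)]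
  refine Finset.sum_congr rfl fun X _ => ?_
  rw [S.admAll_smul j r hr X, h.cov232 j h1 hj r hr X φ hφ]

/-- The covariance clauses on the scales `≤ k` restrict to the scales `≤ j` for `j ≤ k`. [folklore] -/
theorem LFCov.mono {T : LFTower P G Φ 𝒢 𝔄} {S : LFSymm T} {k j : ℕ} (h : LFCov T S k) (hjk : j ≤ k) : LFCov T S j where
  cov229 := fun i h1 hi => h.cov229 i h1 (le_trans hi hjk)
  cov232 := fun i h1 hi => h.cov232 i h1 (le_trans hi hjk)

/-- At `k = 0` the covariance clauses are vacuous. [folklore] -/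
theorem LFCov.zero (T : LFTower P G Φ 𝒢 𝔄) (S : LFSymm T) : LFCov T S 0 where
  cov229 := fun j h1 hj => absurd hj (by omega)
  cov232 := fun j h1 hj => absurd hj (by omega)

/-- THE NEW-TERM COVARIANCE OBLIGATIONS of the step `k → k+1`: (2.29) for `𝐄^{(k+1)}(U_{k+1}, z)` and (2.32) for the new 𝐑-terms
(B16 p.390, quoted at `LFCov`). [cite: Balaban1988Convergent, (2.29), (2.32) p.260] -/
structure LFNewCov (T : LFTower P G Φ 𝒢 𝔄) (S : LFSymm T) (k : ℕ) : Prop where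
  cov229 : ∀ (r : S.Euc (k+1)) (z : T.Pt (k+1)) (g : ℝ) (φ : Φ), φ ∈ S.regular (k+1) →
    S.Ez (k+1) (S.smulPt (k+1) r z) g (S.smulΦ (k+1) r φ) = S.Ez (k+1) z g φ
  cov232 : ∀ (r : S.Euc (k+1)), S.cubePres (k+1) r → ∀ (X : (T.sys (k+1)).Dom) (φ : Φ), φ ∈ S.regular (k+1) →
    T.R (k+1) (S.smulDom (k+1) r X) (S.smulΦ (k+1) r φ) = T.R (k+1) X φ

/-- ONE STEP of the covariance bookkeeping. [folklore] -/
theorem LFCov.succ {T : LFTower P G Φ 𝒢 𝔄} {S : LFSymm T} {k : ℕ} (h : LFCov T S k) (hn : LFNewCov T S k) : LFCov T S (k+1) where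
  cov229 := fun j h1 hj => by
    rcases Nat.of_le_succ hj with hj' | rfl
    · exact h.cov229 j h1 hj'
    · exact hn.cov229
  cov232 := fun j h1 hj => by
    rcases Nat.of_le_succ hj with hj' | rfl
    · exact h.cov232 j h1 hj'
    · exact hn.cov232

/-- Conversely the clauses at `k+1` contain the new-term covariance obligations. [folklore] -/
theorem LFCov.newTerm {T : LFTower P G Φ 𝒢 𝔄} {S : LFSymm T} {k : ℕ} (h : LFCov T S (k+1)) : LFNewCov T S k where
  cov229 := h.cov229 (k+1) k.succ_pos le_rfl
  cov232 := h.cov232 (k+1) k.succ_pos le_rfl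

/-- `LFCov T S (k+1) ⟺ LFCov T S k ∧ LFNewCov T S k`. [folklore] -/
theorem LFCov.succ_iff (T : LFTower P G Φ 𝒢 𝔄) (S : LFSymm T) (k : ℕ) : LFCov T S (k+1) ↔ LFCov T S k ∧ LFNewCov T S k :=
  ⟨fun h => ⟨h.mono k.le_succ, h.newTerm⟩, fun h => h.1.succ h.2⟩

/-- THE INDUCTION ON `k` for the covariance clauses. [folklore] -/
theorem lfCov_all_of_steps {T : LFTower P G Φ 𝒢 𝔄} {S : LFSymm T} {K : ℕ} (hstep : ∀ k, k < K → LFCov T S k → LFNewCov T S k) :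
    ∀ k, k ≤ K → LFCov T S k := by
  intro k
  induction k with
  | zero => intro _; exact LFCov.zero T S
  | succ k ih =>
    intro hk
    have hk' : k < K := Nat.lt_of_succ_le hk
    exact (ih hk'.le).succ (hstep k hk' (ih hk'.le))

/-- THE COMPLETE PER-STEP OBLIGATION including the Part G clauses: Part E's `LFStepObligation` conjoined with the boundary-term and
covariance obligations at the new index.  A shape, not asserted. [cite: Balaban1988Convergent, Thm 1 and remarks p.262] -/
def LFStepObligationG (H033 : Flow → ℕ → Prop) (Repr : ℕ → Prop) (T : LFTower P G Φ 𝒢 𝔄) (S : LFSymm T) (c : LFConsts)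
    (βc : ℝ) (K : ℕ) : Prop :=
  T.flow.SatisfiesRG K → H033 T.flow K →
    ∀ k, k < K → Repr k → LFHyp T c k → LFHypImproved T c βc k → LFHypB T S k → LFCov T S k →
      Repr (k+1) ∧ LFNewTerms T c βc k ∧ LFNewTermsB T S k ∧ LFNewCov T S k

/-- The complete per-step obligation, a represented start and the sign conditions give, at every `k ≤ K`, the representation, the
bounds of Part B3 (ordinary and improved) AND the Part G clauses.  Kernel-checked bookkeeping (induction on `k`). [folklore] -/
theorem all_of_obligationG (H033 : Flow → ℕ → Prop) (Repr : ℕ → Prop) (T : LFTower P G Φ 𝒢 𝔄) (S : LFSymm T) (c : LFConsts)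
    (βc : ℝ) (K : ℕ) (h0 : Repr 0) (hs : LFSigns T c βc K) (h : LFStepObligationG H033 Repr T S c βc K)
    (hrg : T.flow.SatisfiesRG K) (h033 : H033 T.flow K) :
    ∀ k, k ≤ K → Repr k ∧ LFHyp T c k ∧ LFHypImproved T c βc k ∧ LFHypB T S k ∧ LFCov T S k := by
  intro k
  induction k with
  | zero => intro _; exact ⟨h0, LFHyp.zero T c, LFHypImproved.zero T c βc, LFHypB.zero T S, LFCov.zero T S⟩
  | succ k ih =>
    intro hk
    have hk' : k < K := Nat.lt_of_succ_le hk
    obtain ⟨hr, h1, h2, h3, h4⟩ := ih hk'.le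
    obtain ⟨hr', hn, hnB, hnC⟩ := h hrg h033 k hk' hr h1 h2 h3 h4
    exact ⟨hr', h1.succ hn hs.hβ hs.hκ hs.hE₀ hs.hB₀ (hs.hg (k+1) hk), hn.improved, h3.succ hnB, h4.succ hnC⟩

/-- Part E's per-step obligation and separate per-step deliveries of the boundary-term and covariance clauses assemble into the
complete per-step obligation.  Pure logic. [folklore] -/
theorem obligationG_of_parts (H033 : Flow → ℕ → Prop) (Repr : ℕ → Prop) (T : LFTower P G Φ 𝒢 𝔄) (S : LFSymm T) (c : LFConsts)
    (βc : ℝ) (K : ℕ) (hE : LFStepObligation H033 Repr T c βc K)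
    (hB : ∀ k, k < K → LFHypB T S k → LFNewTermsB T S k) (hC : ∀ k, k < K → LFCov T S k → LFNewCov T S k) :
    LFStepObligationG H033 Repr T S c βc K :=
  fun hrg h033 k hk hr h1 h2 h3 h4 => ⟨(hE hrg h033 k hk hr h1 h2).1, (hE hrg h033 k hk hr h1 h2).2, hB k hk h3, hC k hk h4⟩

end Symmetries

/-! ### G4. The vacuum-energy constant `E` pinned by the UV bounds (density level; cell GAPS G-pv06-1 (1)) -/

section VacuumEnergy
open _root_.MeasureTheory

variable {P : Params} {G : Type*} [GaugeGroup G] [MeasurableSpace G] [HaarData G] {av : ∀ j, Averaging P j G}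

/-- The WILSON PARTITION FUNCTION of the finest lattice, `Z_W(g₀) = ∫ dU exp[−(1/g₀²)A(U)]` over the product Haar measure (B10 (1), (6)
p.256–257: `Z^ε`; B14 p.264 "we estimate the integral ∫dV_kρ_k"), i.e. `DensityRG.partitionFn` of a Wilson start with `E = 0`. [cite: Balaban1985UV3, (1), (6) p.256–257] -/
noncomputable def wilsonZ (P : Params) (G : Type*) [GaugeGroup G] [MeasurableSpace G] [HaarData G] (g₀ : ℝ) : ℝ :=
  ∫ U, Real.exp (-(1 / g₀ ^ 2) * wilsonAction4 U) ∂(fieldMeasure P 0 G)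

/-- With the Wilson start `ρ₀ = exp[−(1/g₀²)A − E]` (B14 Thm 1 p.262) the partition function of Part D1 is `exp(−E)·Z_W(g₀)` — the
constant `E` factors out of the integral (no integrability needed).  Bookkeeping. [folklore] -/
theorem DensityRG.partitionFn_eq_of_wilsonStart (D : DensityRG P G av) {g₀ E : ℝ} (h : D.IsWilsonStart g₀ E) :
    D.partitionFn = Real.exp (-E) * wilsonZ P G g₀ := by
  unfold DensityRG.partitionFn wilsonZ
  have hρ : (fun U => D.ρ 0 U) = fun U => Real.exp (-(1 / g₀ ^ 2) * wilsonAction4 U) * Real.exp (-E) := by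
    funext U
    rw [h U, sub_eq_add_neg, Real.exp_add]
  rw [hρ, integral_mul_const, mul_comm]

/-- THE UPPER UV BOUND PINS `E` FROM BELOW: a pointwise bound `ρ_K ≤ exp c` on `T^{(K)}` (the upper half of (0.1) [B16] / (2.50) [III],
`c = E₊|T_η|`), the normalization of the 𝐑-operations and the Wilson start give `exp(−E)·Z_W(g₀) ≤ exp c` (from Part D1's
`partitionFn_le_exp`).  The vacuum-energy constant is therefore not free: B14 p.262 defines it as the sum of all one-step vacuum
energies, and the printed bounds force `E ≥ log Z_W(g₀) − c` (next theorem).  Bookkeeping. [folklore] -/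
theorem DensityRG.exp_neg_mul_wilsonZ_le (D : DensityRG P G av) (K : ℕ) {g₀ E c : ℝ} (h0 : D.IsWilsonStart g₀ E)
    (hR : ∀ k, k < K → PreservesIntegral (D.R k)) (hup : ∀ V, D.ρ K V ≤ Real.exp c) :
    Real.exp (-E) * wilsonZ P G g₀ ≤ Real.exp c := by
  rw [← D.partitionFn_eq_of_wilsonStart h0]
  exact D.partitionFn_le_exp K c hR hup

/-- The logarithmic form: if `Z_W(g₀) > 0` then `log Z_W(g₀) − c ≤ E`. [folklore] -/
theorem DensityRG.log_wilsonZ_sub_le (D : DensityRG P G av) (K : ℕ) {g₀ E c : ℝ} (h0 : D.IsWilsonStart g₀ E)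
    (hR : ∀ k, k < K → PreservesIntegral (D.R k)) (hup : ∀ V, D.ρ K V ≤ Real.exp c) (hZ : 0 < wilsonZ P G g₀) :
    Real.log (wilsonZ P G g₀) - c ≤ E := by
  have h := D.exp_neg_mul_wilsonZ_le K h0 hR hup
  have hlog : Real.log (Real.exp (-E) * wilsonZ P G g₀) ≤ c := by
    rw [← Real.log_exp c]
    exact Real.log_le_log (mul_pos (Real.exp_pos _) hZ) h
  rw [Real.log_mul (Real.exp_pos _).ne' hZ.ne', Real.log_exp] at hlog
  linarith

/-- THE LOWER UV BOUND PINS `E` FROM ABOVE: any integrable pointwise minorant `l ≤ ρ_K` (the lower half of (0.1) [B16]: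
`χ_k exp[−(1/g_k²)A(U_k) − E₋|T_η|]`) has `∫dV l ≤ exp(−E)·Z_W(g₀)`, given integrability of `ρ_K`.  Bookkeeping. [folklore] -/
theorem DensityRG.integral_minorant_le (D : DensityRG P G av) (K : ℕ) {g₀ E : ℝ} (h0 : D.IsWilsonStart g₀ E)
    (hR : ∀ k, k < K → PreservesIntegral (D.R k)) {l : Density P K G} (hl : Integrable l (fieldMeasure P K G))
    (hρ : Integrable (D.ρ K) (fieldMeasure P K G)) (hlo : ∀ V, l V ≤ D.ρ K V) :
    ∫ V, l V ∂(fieldMeasure P K G) ≤ Real.exp (-E) * wilsonZ P G g₀ := by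
  rw [← D.partitionFn_eq_of_wilsonStart h0, ← D.integral_invariant K hR K le_rfl]
  exact integral_mono hl hρ hlo

end VacuumEnergy

/-! ## Part F4 (v5, append-only) — THE ENDPOINT OF A MAXIMAL TREE (B16 p.386): the hypothesis `hleaf` of `Budget.merge_controls`
DISCHARGED over the graph `G` of the domains

B16 p.386 [Balaban1989LargeFieldII]: "Define the graph G in the following way: the set of vertices of G is {Z_j^{(n)}, Z_{j+1}^{(i)}},
and a pair of domains is a line in G if the union of corresponding domains in (1.84) is a connected domain, i.e., if the corresponding
domains intersect, or touch each other. By (1.84) the graph G is connected. Take a maximal tree graph contained in the graph G. This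
tree graph has some nonzero number of endpoints, i.e., vertices which are connected by one line with the rest of the graph. Take one of
them, and denote the corresponding domain in (1.84) by X. Remove the vertex, and the connecting line, from the graph. The obtained graph
is still a connected tree graph, hence the union of the domains in (1.84) corresponding to the vertices of the obtained graph is a
connected domain. Denote this domain by Y."  Part F2 (`merge_controls`) carried this as the HYPOTHESIS `hleaf` on an abstract
connectedness predicate `Conn`.  Here `Conn S` := "the subgraph of `G` induced on the family `S` is connected" (`GConn`), and `hleaf`
is PROVED (`gconn_leaf`) by exactly the printed argument as it stands in Mathlib: a finite connected graph has a spanning tree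
(`SimpleGraph.Connected.exists_isTree_le`), a finite non-trivial tree has a vertex of degree one
(`SimpleGraph.IsTree.exists_vert_degree_one_of_nontrivial`), and removing it leaves the graph connected
(`SimpleGraph.Connected.induce_compl_singleton_of_degree_eq_one`; packaged as
`SimpleGraph.Connected.exists_connected_induce_compl_singleton_of_finite_nontrivial`).  Also p.387 line 2, "The domains X, Y
intersect, or at least touch each other" (`gconn_adj`), and `merge_controls` with `hleaf` discharged (`merge_controls_graph`).  The
graph `G` itself (vertices = the domains, lines = "intersect, or touch") is any `SimpleGraph` on the index type; its construction from
the geometry of (1.84) is the consumer's (b02 lineage). -/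

namespace Budget

/-- p.386: connectedness of a FAMILY of domains `S` = the subgraph of the graph `G` ("a pair of domains is a line in G if … the
corresponding domains intersect, or touch each other") induced on `S` is connected. [cite: Balaban1989LargeFieldII, proof of (1.80) p.386] -/
def GConn {ι : Type*} (G : SimpleGraph ι) (S : Finset ι) : Prop :=
  (G.induce (S : Set ι)).Connected

/-- A one-domain family is connected ("there is the exactly one domain in X", p.386). [folklore] -/
theorem gconn_singleton {ι : Type*} (G : SimpleGraph ι) (x : ι) : GConn G {x} := by
  unfold GConn
  haveI : Nonempty ↥(({x} : Finset ι) : Set ι) := ⟨⟨x, by simp⟩⟩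
  haveI : Subsingleton ↥(({x} : Finset ι) : Set ι) := ⟨fun a b => Subtype.ext (by
    have ha := a.2
    have hb := b.2
    simp only [Finset.coe_singleton, Set.mem_singleton_iff] at ha hb
    rw [ha, hb])⟩
  exact SimpleGraph.Connected.of_subsingleton

/-- A connected family is non-empty. [folklore] -/
theorem gconn_nonempty {ι : Type*} (G : SimpleGraph ι) (S : Finset ι) (h : GConn G S) : S.Nonempty := by
  obtain ⟨⟨x, hx⟩⟩ := h.nonempty
  exact ⟨x, Finset.mem_coe.mp hx⟩

/-- "Remove the vertex, and the connecting line, from the graph" (p.386): the subgraph induced on `S ∖ {w}` IS the subgraph induced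
on `S` with the vertex `w` removed (a graph isomorphism, by definition of induced subgraphs). [folklore] -/
def eraseIso {ι : Type*} [DecidableEq ι] (G : SimpleGraph ι) (S : Finset ι) (w : ↥(S : Set ι)) :
    G.induce ((S.erase w.1 : Finset ι) : Set ι) ≃g (G.induce (S : Set ι)).induce ({w}ᶜ : Set ↥(S : Set ι)) where
  toFun a := ⟨⟨a.1, Finset.mem_of_mem_erase (Finset.mem_coe.mp a.2)⟩, Set.mem_compl_singleton_iff.mpr
    (fun h => Finset.ne_of_mem_erase (Finset.mem_coe.mp a.2) (congrArg Subtype.val h))⟩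
  invFun b := ⟨b.1.1, Finset.mem_coe.mpr (Finset.mem_erase.mpr
    ⟨fun h => Set.mem_compl_singleton_iff.mp b.2 (Subtype.ext h), Finset.mem_coe.mp b.1.2⟩)⟩
  left_inv _ := rfl
  right_inv _ := rfl
  map_rel_iff' := Iff.rfl

/-- THE ENDPOINT OF A MAXIMAL TREE (p.386: "By (1.84) the graph G is connected. Take a maximal tree graph contained in the graph G. This
tree graph has some nonzero number of endpoints, i.e., vertices which are connected by one line with the rest of the graph. Take one of
them … Remove the vertex, and the connecting line, from the graph. The obtained graph is still a connected tree graph, hence the union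
of the domains … is a connected domain. Denote this domain by Y") = the hypothesis `hleaf` of `merge_controls` for `Conn := GConn G`,
PROVED: Mathlib's `SimpleGraph.Connected.exists_connected_induce_compl_singleton_of_finite_nontrivial` (spanning tree, vertex of degree
one, removal keeps connectedness) transported along `eraseIso`.  Kernel-checked. [cite: Balaban1989LargeFieldII, proof of (1.80) p.386] -/
theorem gconn_leaf {ι : Type*} [DecidableEq ι] (G : SimpleGraph ι) (S : Finset ι) (hS : GConn G S) (h2 : 2 ≤ S.card) :
    ∃ x ∈ S, GConn G (S.erase x) := by
  unfold GConn at hS ⊢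
  haveI : Finite ↥(S : Set ι) := S.finite_toSet.to_subtype
  haveI : Nontrivial ↥(S : Set ι) :=
    Set.nontrivial_coe_sort.mpr (Finset.one_lt_card_iff_nontrivial.mp (by omega))
  obtain ⟨v, hv⟩ := hS.exists_connected_induce_compl_singleton_of_finite_nontrivial
  exact ⟨v.1, Finset.mem_coe.mp v.2, (eraseIso G S v).connected_iff.mpr hv⟩

/-- p.387 line 2: "The domains X, Y intersect, or at least touch each other" — in a connected family of at least two domains every
domain is joined by a line of `G` to another domain of the family.  Kernel-checked (`SimpleGraph.Preconnected.exists_adj_of_nontrivial`).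
[cite: Balaban1989LargeFieldII, p.387] -/
theorem gconn_adj {ι : Type*} [DecidableEq ι] (G : SimpleGraph ι) (S : Finset ι) (hS : GConn G S) (h2 : 2 ≤ S.card)
    {x : ι} (hx : x ∈ S) : ∃ y ∈ S.erase x, G.Adj x y := by
  unfold GConn at hS
  haveI : Nontrivial ↥(S : Set ι) :=
    Set.nontrivial_coe_sort.mpr (Finset.one_lt_card_iff_nontrivial.mp (by omega))
  obtain ⟨u, hu⟩ := hS.preconnected.exists_adj_of_nontrivial ⟨x, Finset.mem_coe.mpr hx⟩
  exact ⟨u.1, Finset.mem_erase.mpr ⟨fun h => G.ne_of_adj hu h.symm, Finset.mem_coe.mp u.2⟩, hu⟩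

/-- `merge_controls` (Part F2) WITH THE ENDPOINT HYPOTHESIS DISCHARGED: for `Conn := GConn G` the binder `hleaf` is `gconn_leaf` and
non-emptiness is `gconn_nonempty`; what remains are (1.80) for single domains (`hsingle`), the three local inequalities of the binary
step (`hP`, `hc`, `hsub` — the last now over graph-connected families, its geometric premise "X, Y intersect, or at least touch"
being `gconn_adj`) and the one located budget condition (`hbudget`, p.387 "for p₀ large and γ small enough").  Kernel-checked.
[cite: Balaban1989LargeFieldII, proof of (1.80) p.386–387] -/
theorem merge_controls_graph {ι : Type*} [DecidableEq ι] (G : SimpleGraph ι) (contrib : ι → ℝ) (cost P rhs : Finset ι → ℝ)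
    (q E D : ℝ)
    (hsingle : ∀ x, rhs {x} ≤ merge contrib {x} (cost {x}) (P {x}))
    (hP : ∀ S x, x ∈ S → 2 ≤ S.card → q ≤ P {x} + P (S.erase x) - P S)
    (hc : ∀ S x, x ∈ S → 2 ≤ S.card → cost S ≤ cost {x} + cost (S.erase x) + D)
    (hsub : ∀ S x, x ∈ S → 2 ≤ S.card → GConn G S → GConn G (S.erase x) →
      rhs S ≤ rhs {x} + rhs (S.erase x) + E)
    (hbudget : E + D ≤ q) :
    ∀ S, GConn G S → rhs S ≤ merge contrib S (cost S) (P S) :=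
  fun S hS => merge_controls contrib cost P rhs (GConn G) q E D (fun T hT h2 => gconn_leaf G T hT h2)
    hsingle hP hc hsub hbudget S hS (gconn_nonempty G S hS)

end Budget

/-! ### G4 (v5 addendum). `0 < Z_W(g₀)` from integrability -/

section VacuumEnergyPos
open _root_.MeasureTheory

variable {P : Params} {G : Type*} [GaugeGroup G] [MeasurableSpace G] [HaarData G]

/-- The hypothesis `hZ : 0 < Z_W(g₀)` of `DensityRG.log_wilsonZ_sub_le` holds as soon as the Wilson weight `exp[−(1/g₀²)A(U)]` is
integrable for the product Haar measure (a probability measure, `fieldMeasure_isProbabilityMeasure`): the integrand is a strictly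
positive exponential (`MeasureTheory.integral_exp_pos`).  Integrability itself (a bounded measurable action on a compact group) is
the consumer's (`MissingProofs` lineage; not imported here).  Bookkeeping. [folklore] -/
theorem wilsonZ_pos_of_integrable {g₀ : ℝ}
    (h : Integrable (fun U : GaugeField P 0 G => Real.exp (-(1 / g₀ ^ 2) * wilsonAction4 U)) (fieldMeasure P 0 G)) :
    0 < wilsonZ P G g₀ := by
  unfold wilsonZ
  exact integral_exp_pos h

end VacuumEnergyPos

/-! ## Part F5 (v6, append-only) — THE INDEX OF THE FIRST REGION AND THE INEQUALITY `hP` OF THE BINARY STEP (B16 p.384,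
p.386), FROM B14 (2.7)

B16 p.384 [Balaban1989LargeFieldII]: "If Z is a component of Z_j, and j(Z) is the index of a first large field region contained in Z,
then we write the factor connected with Z in the form exp(−κ_j(Z) − 2p₀(g_{j(Z)}))"; p.386, after (1.86): "The index j(Z) is equal to
one of the indices j(X), j(Y), hence 2p₀(g_{j(X)}) + 2p₀(g_{j(Y)}) − 2p₀(g_{j(Z)}) ≥ 2(1+β₀)⁻¹p₀(g_{j+1})."  Parts F2/F4
(`merge_controls`, `merge_controls_graph`) and F3 (`fundIneq189_of_budget`) carried this as the HYPOTHESIS `hP` over an abstract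
`P : Finset ι → ℝ`.  Here `j(S)` := the smallest creation index in the family `S` (`firstIndex`; for a split `Z = X ∪ Y`,
`j(Z) = min(j(X), j(Y))`, `firstIndex_erase`), `P(S) := 2p₀(g_{j(S)})` (`pFam`), and `hP` is PROVED (`hP_of_logPowMono`) from the first
inequality of B14 (2.7) p.255 [Balaban1988Convergent] — "(log g_n^{−2})^p ≤ (1+β_0)(log g_m^{−2})^p", n > m — typed as the raw-sequence
property `LogPowMono` (verbatim the first member of `B14.FlowIneq27`; restated because `Step` imports `Setup` only): the left side of
the printed inequality is `2p₀(g_m)` for the surviving index `m = max(j(X), j(Y)) ≤ j+1`.  Corollaries: `merge_controls_index`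
(`merge_controls_graph` with `hP` discharged too — what remains of the induction on the number of domains is (1.80) for single pieces,
the two geometric inequalities `hc`, `hsub`, and the one located condition `hbudget`) and `fundIneq189_of_budget_index` (F3 with its
`hP` discharged: `j(X) ≤ k`). -/

namespace Budget

/-- B14 (2.7) p.255, first inequality, verbatim: "(log g_n^{−2})^p ≤ (1+β_0)(log g_m^{−2})^p", "where n > m" (p.255) and "where p is a
positive integer" (p.256) — the monotonicity WITH SLACK of the powers of `log g_j⁻²` along the flow, as a property of a raw sequence
(Part A style; here for the pairs `m < n ≤ K`).  It is literally the first member of `B14.FlowIneq27` (module `B14`; [III] p.255: the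
inequalities (2.6) "imply the following inequalities"; unit strat-b14's `B14FlowStep.flowIneq27_of_26` derives it from the typed
(2.6), and the same module derives (2.7a) from (0.31) [I]); restated here because `Step` imports `Setup` only.
[cite: Balaban1988Convergent, (2.7) p.255] -/
def LogPowMono (g : ℕ → ℝ) (β₀ : ℝ) (p₀ K : ℕ) : Prop :=
  ∀ m n, m < n → n ≤ K → (Real.log ((g n) ^ 2)⁻¹) ^ p₀ ≤ (1 + β₀) * (Real.log ((g m) ^ 2)⁻¹) ^ p₀

/-- `p₀(g) = A₀(log g⁻²)^{p₀} ≥ 0` for `0 < g ≤ 1`, `A₀ ≥ 0`. Elementary. [folklore] -/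
theorem profile_nonneg_of_le_one (A₀ g : ℝ) (p₀ : ℕ) (hA : 0 ≤ A₀) (hg : 0 < g) (hg1 : g ≤ 1) :
    0 ≤ p0Profile A₀ p₀ g := by
  unfold p0Profile
  have hlog : 0 ≤ Real.log ((g ^ 2)⁻¹) := by
    apply Real.log_nonneg
    have hg2 : g ^ 2 ≤ 1 := by nlinarith
    have hg2pos : 0 < g ^ 2 := by positivity
    rw [le_inv_comm₀ one_pos hg2pos, inv_one]
    exact hg2
  positivity

/-- (2.7a) in profile form with the slack moved to the left: `(1+β₀)⁻¹ p₀(g_n) ≤ p₀(g_m)` for ALL `m ≤ n ≤ K` (for `m = n` it is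
`p₀(g_n) ≥ 0` and `β₀ ≥ 0`).  Elementary. [cite: Balaban1988Convergent, (2.7) p.255] -/
theorem profile_slack_le (A₀ β₀ : ℝ) (p₀ K : ℕ) (g : ℕ → ℝ) (hA : 0 ≤ A₀) (hβ₀ : 0 ≤ β₀)
    (h27 : LogPowMono g β₀ p₀ K) {m n : ℕ} (hmn : m ≤ n) (hn : n ≤ K) (hnn : 0 ≤ p0Profile A₀ p₀ (g n)) :
    (1 + β₀)⁻¹ * p0Profile A₀ p₀ (g n) ≤ p0Profile A₀ p₀ (g m) := by
  have hb : 0 < 1 + β₀ := by linarith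
  rw [inv_mul_le_iff₀ hb]
  rcases Nat.lt_or_ge m n with hlt | hge
  · have := h27 m n hlt hn
    unfold p0Profile
    calc A₀ * (Real.log ((g n) ^ 2)⁻¹) ^ p₀ ≤ A₀ * ((1 + β₀) * (Real.log ((g m) ^ 2)⁻¹) ^ p₀) :=
          mul_le_mul_of_nonneg_left this hA
      _ = (1 + β₀) * (A₀ * (Real.log ((g m) ^ 2)⁻¹) ^ p₀) := by ring
  · have hmn' : m = n := le_antisymm hmn hge
    subst hmn'
    nlinarith

/-- p.384: `j(Z)` = "the index of a first large field region contained in Z" — for a FAMILY `S` of pieces (old components and new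
regions) with creation indices `jr`, the smallest creation index in the family (the value `0` on the empty family is never used).
[cite: Balaban1989LargeFieldII, statement before (1.80) p.384] -/
def firstIndex {ι : Type*} (jr : ι → ℕ) (S : Finset ι) : ℕ :=
  if h : S.Nonempty then S.inf' h jr else 0

/-- Unfolding `firstIndex` on a non-empty family. [folklore] -/
theorem firstIndex_of_nonempty {ι : Type*} (jr : ι → ℕ) (S : Finset ι) (h : S.Nonempty) :
    firstIndex jr S = S.inf' h jr := by
  unfold firstIndex
  rw [dif_pos h]

/-- One piece: `j({x}) = j(x)`. [folklore] -/
theorem firstIndex_singleton {ι : Type*} (jr : ι → ℕ) (x : ι) : firstIndex jr {x} = jr x := by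
  rw [firstIndex_of_nonempty jr {x} (Finset.singleton_nonempty x), Finset.inf'_singleton]

/-- The first index of a non-empty family is the creation index of one of its pieces. [folklore] -/
theorem firstIndex_mem {ι : Type*} (jr : ι → ℕ) (S : Finset ι) (h : S.Nonempty) :
    ∃ y ∈ S, jr y = firstIndex jr S := by
  rw [firstIndex_of_nonempty jr S h]
  obtain ⟨y, hy, hyeq⟩ := Finset.exists_mem_eq_inf' h jr
  exact ⟨y, hy, hyeq.symm⟩

/-- p.386: splitting one piece `X = {x}` off the family `Z = S`, `Y = S ∖ {x}`: "The index j(Z) is equal to one of the indices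
j(X), j(Y)" — precisely `j(Z) = min(j(X), j(Y))`. [cite: Balaban1989LargeFieldII, after (1.86) p.386] -/
theorem firstIndex_erase {ι : Type*} [DecidableEq ι] (jr : ι → ℕ) (S : Finset ι) {x : ι} (hx : x ∈ S) (h2 : 2 ≤ S.card) :
    firstIndex jr S = min (jr x) (firstIndex jr (S.erase x)) := by
  have hYne : (S.erase x).Nonempty := by
    rw [← Finset.card_pos, Finset.card_erase_of_mem hx]
    omega
  have hSne : S.Nonempty := ⟨x, hx⟩
  apply le_antisymm
  · apply le_min
    · rw [firstIndex_of_nonempty jr S hSne]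
      exact Finset.inf'_le jr hx
    · rw [firstIndex_of_nonempty jr S hSne, firstIndex_of_nonempty jr (S.erase x) hYne]
      exact Finset.inf'_mono jr (Finset.erase_subset x S) hYne
  · obtain ⟨y, hy, hyeq⟩ := firstIndex_mem jr S hSne
    rw [← hyeq]
    by_cases hyx : y = x
    · subst hyx
      exact min_le_left _ _
    · have hy' : y ∈ S.erase x := Finset.mem_erase.mpr ⟨hyx, hy⟩
      refine le_trans (min_le_right _ _) ?_
      rw [firstIndex_of_nonempty jr (S.erase x) hYne]
      exact Finset.inf'_le jr hy'

/-- All pieces at scale `j+1` were created at an index `≤ j+1` (old components: `j(Z_j^{(n)}) ≤ j`; new regions: `j+1`), hence so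
was every non-empty family. [folklore] -/
theorem firstIndex_le {ι : Type*} (jr : ι → ℕ) (S : Finset ι) (h : S.Nonempty) {N : ℕ} (hjr : ∀ y ∈ S, jr y ≤ N) :
    firstIndex jr S ≤ N := by
  obtain ⟨y, hy, hyeq⟩ := firstIndex_mem jr S h
  rw [← hyeq]
  exact hjr y hy

/-- `P(S) = 2p₀(g_{j(S)})`: the term "2p₀(g_{j(Z)})" of (1.85)–(1.86) as a function of the family. [cite: Balaban1989LargeFieldII, (1.85) p.386] -/
noncomputable def pFam {ι : Type*} (A₀ : ℝ) (p₀ : ℕ) (g : ℕ → ℝ) (jr : ι → ℕ) (S : Finset ι) : ℝ :=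
  2 * p0Profile A₀ p₀ (g (firstIndex jr S))

/-- One piece: `P({x}) = 2p₀(g_{j(x)})` (the term of `X` in (1.86)). [cite: Balaban1989LargeFieldII, (1.86) p.386] -/
theorem pFam_singleton {ι : Type*} (A₀ : ℝ) (p₀ : ℕ) (g : ℕ → ℝ) (jr : ι → ℕ) (x : ι) :
    pFam A₀ p₀ g jr {x} = 2 * p0Profile A₀ p₀ (g (jr x)) := by
  unfold pFam
  rw [firstIndex_singleton]

/-- THE HYPOTHESIS `hP` OF THE BINARY STEP, DISCHARGED (p.386, last lines: "The index j(Z) is equal to one of the indices j(X),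
j(Y), hence 2p₀(g_{j(X)}) + 2p₀(g_{j(Y)}) − 2p₀(g_{j(Z)}) ≥ 2(1+β₀)⁻¹p₀(g_{j+1})"): with `j(Z) = min(j(X), j(Y))` the left side is
`2p₀(g_m)` for the other index `m = max(j(X), j(Y)) ≤ j+1`, and (2.7a) [III] (`LogPowMono`, pairs up to `K ≥ j+1`) gives the bound.
Inputs: `A₀ ≥ 0`, `β₀ ≥ 0`, `p₀(g_{j+1}) ≥ 0` (e.g. `0 < g_{j+1} ≤ 1`, `profile_nonneg_of_le_one`), creation indices `≤ j+1`.
Kernel-checked. [cite: Balaban1989LargeFieldII, after (1.86) p.386] -/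
theorem hP_of_logPowMono {ι : Type*} [DecidableEq ι] (A₀ β₀ : ℝ) (p₀ K j : ℕ) (g : ℕ → ℝ) (jr : ι → ℕ)
    (hA : 0 ≤ A₀) (hβ₀ : 0 ≤ β₀) (h27 : LogPowMono g β₀ p₀ K) (hjK : j + 1 ≤ K)
    (hnn : 0 ≤ p0Profile A₀ p₀ (g (j + 1))) (hjr : ∀ y, jr y ≤ j + 1)
    (S : Finset ι) (x : ι) (hx : x ∈ S) (h2 : 2 ≤ S.card) :
    2 * (1 + β₀)⁻¹ * p0Profile A₀ p₀ (g (j + 1)) ≤ pFam A₀ p₀ g jr {x} + pFam A₀ p₀ g jr (S.erase x) - pFam A₀ p₀ g jr S := by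
  have hYne : (S.erase x).Nonempty := by
    rw [← Finset.card_pos, Finset.card_erase_of_mem hx]
    omega
  rw [pFam_singleton]
  unfold pFam
  rw [firstIndex_erase jr S hx h2]
  set a := jr x with ha
  set b := firstIndex jr (S.erase x) with hb
  have ha1 : a ≤ j + 1 := hjr x
  have hb1 : b ≤ j + 1 := firstIndex_le jr (S.erase x) hYne (fun y _ => hjr y)
  have key : ∀ m, m ≤ j + 1 → 2 * (1 + β₀)⁻¹ * p0Profile A₀ p₀ (g (j + 1)) ≤ 2 * p0Profile A₀ p₀ (g m) := by
    intro m hm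
    have := profile_slack_le A₀ β₀ p₀ K g hA hβ₀ h27 hm hjK hnn
    linarith
  rcases le_total a b with hab | hba
  · rw [min_eq_left hab]
    have := key b hb1
    linarith
  · rw [min_eq_right hba]
    have := key a ha1
    linarith

/-- `merge_controls_graph` (F4) WITH `hP` DISCHARGED AS WELL: over pieces with creation indices `jr ≤ j+1`, `P = pFam` (the printed
"2p₀(g_{j(Z)})" with `j(Z)` the first index), the flow input (2.7a) [III] up to `K ≥ j+1` and `p₀(g_{j+1}) ≥ 0`, what remains of the
induction on the number of domains is: (1.80) for single pieces (`hsingle`), the two GEOMETRIC inequalities of the binary step (`hc`: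
"d′_{j+1}(X) + d′_{j+1}(Y) + 2d ≥ d′_{j+1}(Z)"; `hsub`: the sub-additivity of the (1.80)-sums over the S-iterates with overshoot `E`,
p.387 lines 3–12) and the ONE located condition `hbudget` (p.387 "for p₀ large and γ small enough": `E + D ≤ 2(1+β₀)⁻¹p₀(g_{j+1})`).
Kernel-checked. [cite: Balaban1989LargeFieldII, proof of (1.80) p.386–387] -/
theorem merge_controls_index {ι : Type*} [DecidableEq ι] (G : SimpleGraph ι) (contrib : ι → ℝ) (cost rhs : Finset ι → ℝ)
    (A₀ β₀ : ℝ) (p₀ K j : ℕ) (g : ℕ → ℝ) (jr : ι → ℕ) (E D : ℝ)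
    (hA : 0 ≤ A₀) (hβ₀ : 0 ≤ β₀) (h27 : LogPowMono g β₀ p₀ K) (hjK : j + 1 ≤ K)
    (hnn : 0 ≤ p0Profile A₀ p₀ (g (j + 1))) (hjr : ∀ y, jr y ≤ j + 1)
    (hsingle : ∀ x, rhs {x} ≤ merge contrib {x} (cost {x}) (pFam A₀ p₀ g jr {x}))
    (hc : ∀ S x, x ∈ S → 2 ≤ S.card → cost S ≤ cost {x} + cost (S.erase x) + D)
    (hsub : ∀ S x, x ∈ S → 2 ≤ S.card → GConn G S → GConn G (S.erase x) →
      rhs S ≤ rhs {x} + rhs (S.erase x) + E)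
    (hbudget : E + D ≤ 2 * (1 + β₀)⁻¹ * p0Profile A₀ p₀ (g (j + 1))) :
    ∀ S, GConn G S → rhs S ≤ merge contrib S (cost S) (pFam A₀ p₀ g jr S) :=
  merge_controls_graph G contrib cost (pFam A₀ p₀ g jr) rhs (2 * (1 + β₀)⁻¹ * p0Profile A₀ p₀ (g (j + 1))) E D hsingle
    (fun S x hx h2 => hP_of_logPowMono A₀ β₀ p₀ K j g jr hA hβ₀ h27 hjK hnn hjr S x hx h2) hc hsub hbudget

/-- `fundIneq189_of_budget` (F3) WITH ITS `hP` DISCHARGED: p.387, "2p₀(g_{j(X)}) ≥ 2(1+β₀)⁻¹p₀(g_k)" for the creation index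
`j(X) ≤ k` — from (2.7a) [III] up to `K ≥ k` and `p₀(g_k) ≥ 0`.  Remaining inputs: the factor form of (1.79) (`hT`) and `κ_k(X) ≥ 0`
(`hκ`, `controls_zero_iff`).  Kernel-checked. [cite: Balaban1989LargeFieldII, (1.89) p.387] -/
theorem fundIneq189_of_budget_index {V : Type*} (T1X : V → ℝ) (A₀ β₀ : ℝ) (p₀ K k jX : ℕ) (g : ℕ → ℝ) (κ : ℝ)
    (hA : 0 ≤ A₀) (hβ₀ : 0 ≤ β₀) (h27 : LogPowMono g β₀ p₀ K) (hjX : jX ≤ k) (hk : k ≤ K)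
    (hnn : 0 ≤ p0Profile A₀ p₀ (g k))
    (hT : ∀ v, T1X v ≤ Real.exp (-κ - 2 * p0Profile A₀ p₀ (g jX))) (hκ : 0 ≤ κ) :
    FundIneq189 T1X A₀ p₀ β₀ (g k) := by
  refine fundIneq189_of_budget T1X A₀ p₀ β₀ (g k) κ (2 * p0Profile A₀ p₀ (g jX)) hT hκ ?_
  have := profile_slack_le A₀ β₀ p₀ K g hA hβ₀ h27 hjX hk hnn
  linarith

end Budget


/-! ## Part H (v7, append-only) — (1.101) [B16] VERSUS (2.23)/(2.30) [III]: THE UNSUBTRACTED 𝐑-SUM AND THE SHIFT OF `E_k`;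
(2.19) DERIVED FROM (2.20)

H1.  B16 p.390 [Balaban1989LargeFieldII], verbatim: "A_k = A′_k + Σ_X 𝐑′^{(k)}(X, U_k) + Σ_X 𝐁′^{(k)}(X, U_k). (1.101) This new
action satisfies the induction hypothesis, as it follows from the construction and the properties of the new terms."  The clause of
the hypothesis it must satisfy, [III] p.260 [Balaban1988Convergent] verbatim: "𝐑_k(U_k) = Σ_{j=1}^{k} [𝐑^{(j)}(Λ_j, U_k) −
𝐑^{(j)}(Λ_j, 1)] (2.30)", the bound (2.31) being stated for the UNSUBTRACTED term "|𝐑^{(j)}(X, (𝐔,𝐉))| ≤ g_j^{κ₀} exp(−κd_j(X))" —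
which is how `LFHyp.boundR` (Part B3) types it, consistently with B16 (1.100) "|𝐑′^{(k)}(X, (𝐔_k,𝐉))| < exp(−p₀(g_k) − κd_k(X))"
(Part D4 `exp_neg_p0Profile_le_pow` converts the prefactor).  `LFActionData.action23` (Part B3) types (2.23) with (2.30)
substituted, i.e. SUBTRACTED at `U = 1` (`T.ofBackground 1`), the constant `E_k` being the free datum `Econst`.  This Part records
the Step-side bookkeeping of the one displayed discrepancy (cell GAPS G-adv3-8 (A), C-f2.10; DIVERGENCE D-f2.15): `action1101` =
(2.23) with the 𝐑-part in the printed form (1.101), `rConst` = the `U`-independent constant `Σ_{j≤k} Σ_X Re 𝐑^{(j)}(X, 1)`, and the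
identities `action23 = action1101 − rConst` (`action23_eq_action1101_sub`), `action23 = (shiftE rConst).action1101`
(`action23_eq_action1101_shift`; conversely `action1101_eq_action23_unshift`): THE TWO FORMS ARE THE SAME FAMILY OF ACTIONS AND
DIFFER ONLY IN THE VALUE OF THE DATUM `E_k`, whose size is controlled separately ([III] p.258 "E_k" a constant in (2.23); p.264 the
vacuum-energy counterterms; Part G4).  Bounds: every subtracted term obeys TWICE (2.31) provided the trivial configuration lies in
the analyticity space (`LFHyp.norm_R_sub_R_one_le`, hypothesis `hone` — reader-level, not typed: `T.space j X α₀ α₁` is the space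
`U^c_j(X, α_{0,j}, α_{1,j})` of [III] p.259 (ii), i.e. [Balaban1987RG1] p.262 (1.11)–(1.16) with the radii (2.28), and each of its defining
conditions — like those of `Ũ^c` (2.34)–(2.39) p.261 for the new terms' (1.100) — is a STRICT upper bound on a quantity (`|∂U − 1|`, `|A|`,
`|A′|`, `|𝐉|`, `|∂U_n(M(𝐔)) − 1|`, `|J_n(M(𝐔))|`) vanishing at `(𝐔, 𝐉) = (1, 0)`, the last two given that the iterated background fields of
the unit configuration are the unit configuration; v7.1 DOCFIX of the v7 pointer, which named (2.34)–(2.39) only), and `|rConst| ≤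
Σ_{j≤k} Σ_{X adm} g_j^{κ₀} e^{−κd_j(X)}` (`abs_rConst_le`, `abs_action23_sub_action1101_le`) — the input of the p.264 budget.  The B16-side
instantiation with the anchored tree-graph bound of the second-group domains is the sibling module `B16Eq1101Subtraction`
(`B16.Eq1101.eq1101_in_form230`, unit adv3; it imports `B14RelBoundary`, hence cannot be imported here — `Step` imports `Setup` only).

H2.  [III] p.258 states (2.19) (factorization of `𝐓_k(Z_k)` over disjoint regions, commutation) and (2.20) (`𝐓_k(X)` = the ordered
product of one-step operations) side by side — two of the "basic general properties" (the phrase of p.254) of the operations `𝐓_k` left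
undefined there (`TkOps.Laws`, Part D3; GAPS G-r2.2).  Recorded here: the operations
DEFINED by (2.20) from a family of one-step operations (`TkOps.ofOneStep`) satisfy (2.19) as soon as each one-step operation is
multiplicative on disjoint unions inside its region and one-step operations of disjoint regions commute across scales
(`TkOps.laws_ofOneStep`; the list bookkeeping `prod_map_mul_of_commute`).  A construction template for the undefined `𝐓_k` (B14 p.254,
GAPS G-r2.2) and a non-vacuity witness for `TkOps.Laws`; nothing about the integral formula (2.21) is asserted. -/

section Form1101

variable {P : Params} {G : Type*} [GaugeGroup G] {Φ 𝒢 𝔄 : Type*} {T : LFTower P G Φ 𝒢 𝔄}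

/-- The `U`-independent constant `Σ_{j=1}^{k} Σ_{X adm} Re 𝐑^{(j)}(X, 1)` by which the 𝐑-parts of (1.101) [B16] p.390 and of
(2.23)/(2.30) [III] p.258, p.260 differ (same index sets `admR` as `action23`). [cite: Balaban1988Convergent, (2.30) p.260] -/
noncomputable def LFActionData.rConst (D : LFActionData P G T) (k : ℕ) : ℝ :=
  ∑ j ∈ Finset.Icc 1 k, ∑ X : (T.sys j).Dom, (if D.admR j X then (T.R j X (T.ofBackground 1)).re else 0)

/-- (2.23) [III] with the 𝐑-part in the form printed in (1.101) [B16] p.390, "A_k = A′_k + Σ_X 𝐑′^{(k)}(X, U_k) + Σ_X 𝐁′^{(k)}(X,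
U_k)": `… + Σ_{j=1}^{k} Σ_X Re 𝐑^{(j)}(X, U_k) + …`, NOT subtracted at `U = 1`; all other parts exactly as in `LFActionData.action23`.
[cite: Balaban1989LargeFieldII, (1.101) p.390] -/
noncomputable def LFActionData.action1101 (D : LFActionData P G T) (k : ℕ) (U : GaugeField P 0 G) : ℝ :=
  - D.wilsonLocal U
  + ∑ j ∈ Finset.Icc 1 k,
      ( (∑ X : (T.sys j).Dom, ∑ z : T.Pt j,
          if D.admE j X z then ((T.E j X z (T.flow.g (j-1)) (T.ofBackground U)).re
                                - (T.E j X z (T.flow.g (j-1)) (T.ofBackground 1)).re) else 0)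
        - T.flow.β j (T.flow.g (j-1)) * D.wilsonPhi j U )
  + ∑ j ∈ Finset.Icc 1 k, ∑ X : (T.sys j).Dom,
      (if D.admR j X then (T.R j X (T.ofBackground U)).re else 0)
  + ∑ j ∈ Finset.Icc 1 k, ∑ X : (T.sys j).Dom,
      (if D.admB j X then (T.B j X (T.ofBackground U) D.fluct).re else 0)
  - D.Econst

/-- The shift `E_k ↦ E_k + c` of the vacuum-energy datum of (2.23), all other data unchanged. [folklore] -/
def LFActionData.shiftE (D : LFActionData P G T) (c : ℝ) : LFActionData P G T :=
  { D with Econst := D.Econst + c }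

/-- `shiftE` changes `Econst` only. [folklore] -/
theorem LFActionData.shiftE_Econst (D : LFActionData P G T) (c : ℝ) : (D.shiftE c).Econst = D.Econst + c := rfl

/-- `shiftE` leaves the constant `rConst` unchanged (it does not involve `E_k`). [folklore] -/
theorem LFActionData.rConst_shiftE (D : LFActionData P G T) (c : ℝ) (k : ℕ) :
    (D.shiftE c).rConst k = D.rConst k := rfl

/-- The subtracted 𝐑-sum of (2.23)/(2.30) is the unsubtracted one of (1.101) minus the constant `rConst`: finite-sum algebra
`Σ [a − b] = Σ a − Σ b` under the same index selector. [cite: Balaban1988Convergent, (2.30) p.260] -/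
theorem LFActionData.rSum_sub (D : LFActionData P G T) (k : ℕ) (U : GaugeField P 0 G) :
    ∑ j ∈ Finset.Icc 1 k, ∑ X : (T.sys j).Dom,
        (if D.admR j X then ((T.R j X (T.ofBackground U)).re - (T.R j X (T.ofBackground 1)).re) else 0)
      = (∑ j ∈ Finset.Icc 1 k, ∑ X : (T.sys j).Dom, (if D.admR j X then (T.R j X (T.ofBackground U)).re else 0))
        - D.rConst k := by
  rw [LFActionData.rConst, ← Finset.sum_sub_distrib]
  refine Finset.sum_congr rfl fun j _ => ?_
  rw [← Finset.sum_sub_distrib]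
  refine Finset.sum_congr rfl fun X _ => ?_
  split_ifs <;> simp

/-- (2.23) WITH (2.30) = (2.23) WITH (1.101) MINUS THE CONSTANT: `action23 D k U = action1101 D k U − rConst D k` for every `U`.
Kernel-checked bookkeeping of GAPS G-adv3-8 (A) on the Step side. [cite: Balaban1989LargeFieldII, (1.101) p.390] -/
theorem LFActionData.action23_eq_action1101_sub (D : LFActionData P G T) (k : ℕ) (U : GaugeField P 0 G) :
    D.action23 k U = D.action1101 k U - D.rConst k := by
  rw [LFActionData.action23, LFActionData.action1101, LFActionData.rSum_sub]
  ring

/-- Shifting `E_k` by `c` lowers the (1.101)-form action by `c`. [folklore] -/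
theorem LFActionData.action1101_shiftE (D : LFActionData P G T) (c : ℝ) (k : ℕ) (U : GaugeField P 0 G) :
    (D.shiftE c).action1101 k U = D.action1101 k U - c := by
  simp only [LFActionData.action1101, LFActionData.shiftE]
  ring

/-- Shifting `E_k` by `c` lowers the (2.23)-form action by `c`. [folklore] -/
theorem LFActionData.action23_shiftE (D : LFActionData P G T) (c : ℝ) (k : ℕ) (U : GaugeField P 0 G) :
    (D.shiftE c).action23 k U = D.action23 k U - c := by
  simp only [LFActionData.action23, LFActionData.shiftE]
  ring

/-- THE CONSTANT IS ABSORBED INTO `E_k`: the subtracted action (2.23)/(2.30) with datum `E_k` IS the unsubtracted action (1.101)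
with datum `E_k + Σ_{j≤k}Σ_X Re 𝐑^{(j)}(X, 1)` — as functions of `U_k`, identically.  (So "this new action satisfies the induction
hypothesis" p.390 holds for the clause (2.30) exactly up to the value of the constant `E_k` in (2.23), which (2.23) leaves free and
p.264 budgets.) [cite: Balaban1989LargeFieldII, (1.101) p.390] -/
theorem LFActionData.action23_eq_action1101_shift (D : LFActionData P G T) (k : ℕ) (U : GaugeField P 0 G) :
    D.action23 k U = (D.shiftE (D.rConst k)).action1101 k U := by
  rw [LFActionData.action1101_shiftE, LFActionData.action23_eq_action1101_sub]

/-- Conversely: the unsubtracted action (1.101) with datum `E_k` is the subtracted action (2.23)/(2.30) with datum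
`E_k − Σ_{j≤k}Σ_X Re 𝐑^{(j)}(X, 1)`. [cite: Balaban1989LargeFieldII, (1.101) p.390] -/
theorem LFActionData.action1101_eq_action23_unshift (D : LFActionData P G T) (k : ℕ) (U : GaugeField P 0 G) :
    D.action1101 k U = (D.shiftE (-(D.rConst k))).action23 k U := by
  rw [LFActionData.action23_shiftE, LFActionData.action23_eq_action1101_sub]
  ring

/-- A SUBTRACTED TERM OBEYS TWICE (2.31): `|𝐑^{(j)}(X, φ) − 𝐑^{(j)}(X, 1)| ≤ 2 g_j^{κ₀} exp(−κ d_j(X))` on `U^c_j(X, α_{0,j}, α_{1,j})`,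
PROVIDED the trivial configuration `T.ofBackground 1` lies in that space (`hone` — reader-level: the defining conditions of that space,
[Balaban1987RG1] p.262 (1.11)–(1.16) with the radii (2.28) [III], are strict upper bounds on quantities vanishing at `(𝐔, 𝐉) = (1, 0)`, as
are those of `Ũ^c` (2.34)–(2.39) p.261; see the Part H header).  The factor 2 is harmless for the
inductive hypothesis only because (2.31) is stated for the UNSUBTRACTED term (as `LFHyp.boundR` types it); it is recorded so that no
consumer silently uses (2.31) for the difference. [cite: Balaban1988Convergent, (2.31) p.260] -/
theorem LFHyp.norm_R_sub_R_one_le {c : LFConsts} {k : ℕ} (h : LFHyp T c k) (j : ℕ) (hj1 : 1 ≤ j) (hjk : j ≤ k)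
    (X : (T.sys j).Dom) (φ : Φ) (hφ : φ ∈ T.space j X (c.alpha0 (T.flow.g j)) (c.alpha1 (T.flow.g j)))
    (hone : T.ofBackground 1 ∈ T.space j X (c.alpha0 (T.flow.g j)) (c.alpha1 (T.flow.g j))) :
    ‖T.R j X φ - T.R j X (T.ofBackground 1)‖ ≤ 2 * ((T.flow.g j) ^ c.κ₀ * Real.exp (-c.κ * (T.sys j).dj X)) := by
  have h1 := h.boundR j hj1 hjk X φ hφ
  have h2 := h.boundR j hj1 hjk X (T.ofBackground 1) hone
  calc ‖T.R j X φ - T.R j X (T.ofBackground 1)‖ ≤ ‖T.R j X φ‖ + ‖T.R j X (T.ofBackground 1)‖ := norm_sub_le _ _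
    _ ≤ _ := by linarith

/-- THE SIZE OF THE CONSTANT: under the inductive bounds `LFHyp T c k` and `hone` (the trivial configuration in the space of every
ADMISSIBLE domain of the sums (2.30)), `|Σ_{j≤k}Σ_{X adm} Re 𝐑^{(j)}(X, 1)| ≤ Σ_{j≤k}Σ_{X adm} g_j^{κ₀} exp(−κ d_j(X))` — the (2.31)
majorants, term by term (`|Re z| ≤ ‖z‖`).  Summing the right side into the p.264 shape `O(1)Σ_n|Γ_n|` needs the tree-graph /
anchoring inputs of the reader-level geometry (sibling `B16Eq1101Subtraction`, `B14RelBoundary`); not done here.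
[cite: Balaban1988Convergent, (2.31) p.260, p.264] -/
theorem LFActionData.abs_rConst_le (D : LFActionData P G T) {c : LFConsts} {k : ℕ} (h : LFHyp T c k)
    (hone : ∀ j, 1 ≤ j → j ≤ k → ∀ X : (T.sys j).Dom, D.admR j X = true →
      T.ofBackground 1 ∈ T.space j X (c.alpha0 (T.flow.g j)) (c.alpha1 (T.flow.g j))) :
    |D.rConst k| ≤ ∑ j ∈ Finset.Icc 1 k, ∑ X : (T.sys j).Dom,
      (if D.admR j X then (T.flow.g j) ^ c.κ₀ * Real.exp (-c.κ * (T.sys j).dj X) else 0) := by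
  unfold LFActionData.rConst
  refine (Finset.abs_sum_le_sum_abs _ _).trans (Finset.sum_le_sum fun j hj => ?_)
  have hj' := Finset.mem_Icc.mp hj
  refine (Finset.abs_sum_le_sum_abs _ _).trans (Finset.sum_le_sum fun X _ => ?_)
  split_ifs with hX
  · exact (Complex.abs_re_le_norm _).trans (h.boundR j hj'.1 hj'.2 X _ (hone j hj'.1 hj'.2 X hX))
  · simp

/-- Corollary: the two forms of the action differ, uniformly in `U_k`, by at most the sum of the (2.31) majorants over the
admissible domains: `|action23 D k U − action1101 D k U| ≤ Σ_{j≤k}Σ_{X adm} g_j^{κ₀} exp(−κ d_j(X))`.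
[cite: Balaban1988Convergent, (2.31) p.260] -/
theorem LFActionData.abs_action23_sub_action1101_le (D : LFActionData P G T) {c : LFConsts} {k : ℕ} (h : LFHyp T c k)
    (hone : ∀ j, 1 ≤ j → j ≤ k → ∀ X : (T.sys j).Dom, D.admR j X = true →
      T.ofBackground 1 ∈ T.space j X (c.alpha0 (T.flow.g j)) (c.alpha1 (T.flow.g j)))
    (U : GaugeField P 0 G) :
    |D.action23 k U - D.action1101 k U| ≤ ∑ j ∈ Finset.Icc 1 k, ∑ X : (T.sys j).Dom,
      (if D.admR j X then (T.flow.g j) ^ c.κ₀ * Real.exp (-c.κ * (T.sys j).dj X) else 0) := by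
  rw [D.action23_eq_action1101_sub k U, sub_sub_cancel_left, abs_neg]
  exact D.abs_rConst_le h hone

end Form1101

/-! ### H2. (2.19) from (2.20): the laws of the operations generated by one-step operations -/

section TkOpsGen
variable {ι : Type*} {M : Type*} [Monoid M]

/-- List bookkeeping in a (non-commutative) monoid: `Π_j (f_j g_j) = (Π_j f_j)(Π_j g_j)` along a list, as soon as every `g_i`
commutes with every `f_j` (`i, j` in the list). [folklore] -/
theorem prod_map_mul_of_commute {α : Type*} (l : List α) (f g : α → M)
    (h : ∀ i ∈ l, ∀ j ∈ l, Commute (g i) (f j)) :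
    (l.map fun j => f j * g j).prod = (l.map f).prod * (l.map g).prod := by
  induction l with
  | nil => simp
  | cons a l ih =>
    simp only [List.map_cons, List.prod_cons]
    have hc : Commute (g a) (l.map f).prod := Commute.list_prod_right _ _ fun x hx => by
      obtain ⟨j, hj, rfl⟩ := List.mem_map.mp hx
      exact h a (by simp) j (by simp [hj])
    rw [ih fun i hi j hj => h i (by simp [hi]) j (by simp [hj])]
    rw [mul_assoc (f a), ← mul_assoc (g a), hc.eq]
    simp only [mul_assoc]

/-- The operations `𝐓_k` DEFINED by (2.20) p.258 from the large-field regions `Z j` and a family of one-step operations `T1 k j Y`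
(= `𝐓^{(j)}(Y)` as it stands after step `k`): `𝐓_k(X) := Π_{j=k−1}^{0} 𝐓^{(j)}(Z_{j+1} ∩ X)` (ordered, leftmost `j = k − 1`).
[cite: Balaban1988Convergent, (2.20) p.258] -/
def TkOps.ofOneStep (Z : ℕ → Set ι) (T1 : ℕ → ℕ → Set ι → M) : TkOps ι M where
  Z := Z
  T := fun k X => (((List.range k).reverse).map fun j => T1 k j (Z (j+1) ∩ X)).prod
  T1 := T1

/-- (2.19) FROM (2.20): the operations `TkOps.ofOneStep Z T1` satisfy `TkOps.Laws k` — factorization `𝐓_k(X ∪ Y) = 𝐓_k(X)𝐓_k(Y)`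
and commutation for disjoint `X, Y ⊆ Z_k`, and (2.20) by construction — GIVEN (i) `hfac`: each one-step operation `𝐓^{(j)}`, `j < k`,
is multiplicative on disjoint unions inside `Z_{j+1}`, and (ii) `hcomm`: one-step operations of disjoint sub-regions commute, also
across scales ("The operations corresponding to disjoint regions commute", p.258, read at the one-step level).  Bookkeeping (the list
lemma `prod_map_mul_of_commute`); (2.21) is not involved. [cite: Balaban1988Convergent, (2.19)–(2.20) p.258] -/
theorem TkOps.laws_ofOneStep (Z : ℕ → Set ι) (T1 : ℕ → ℕ → Set ι → M) (k : ℕ)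
    (hfac : ∀ j, j < k → ∀ A B : Set ι, A ⊆ Z (j+1) → B ⊆ Z (j+1) → Disjoint A B →
      T1 k j (A ∪ B) = T1 k j A * T1 k j B)
    (hcomm : ∀ i, i < k → ∀ j, j < k → ∀ A B : Set ι, A ⊆ Z (i+1) → B ⊆ Z (j+1) → Disjoint A B →
      T1 k i A * T1 k j B = T1 k j B * T1 k i A) :
    (TkOps.ofOneStep Z T1).Laws k := by
  have hmem : ∀ j, j ∈ (List.range k).reverse → j < k := fun j hj => by simpa using hj
  have hcm : ∀ X Y : Set ι, Disjoint X Y → ∀ i ∈ (List.range k).reverse, ∀ j ∈ (List.range k).reverse,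
      Commute (T1 k i (Z (i+1) ∩ Y)) (T1 k j (Z (j+1) ∩ X)) := fun X Y hXY i hi j hj =>
    hcomm i (hmem i hi) j (hmem j hj) _ _ Set.inter_subset_left Set.inter_subset_left
      (hXY.symm.mono Set.inter_subset_right Set.inter_subset_right)
  refine ⟨fun X Y _ _ hXY => ?_, fun X Y _ _ hXY => ?_, fun X _ => rfl⟩
  · show (((List.range k).reverse).map fun j => T1 k j (Z (j+1) ∩ (X ∪ Y))).prod =
      (((List.range k).reverse).map fun j => T1 k j (Z (j+1) ∩ X)).prod *
        (((List.range k).reverse).map fun j => T1 k j (Z (j+1) ∩ Y)).prod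
    rw [← prod_map_mul_of_commute _ _ _ (hcm X Y hXY)]
    congr 1
    apply List.map_congr_left
    intro j hj
    rw [Set.inter_union_distrib_left]
    exact hfac j (hmem j hj) _ _ Set.inter_subset_left Set.inter_subset_left
      (hXY.mono Set.inter_subset_right Set.inter_subset_right)
  · show (((List.range k).reverse).map fun j => T1 k j (Z (j+1) ∩ X)).prod *
        (((List.range k).reverse).map fun j => T1 k j (Z (j+1) ∩ Y)).prod =
      (((List.range k).reverse).map fun j => T1 k j (Z (j+1) ∩ Y)).prod *
        (((List.range k).reverse).map fun j => T1 k j (Z (j+1) ∩ X)).prod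
    refine (Commute.list_prod_right _ _ fun y hy => Commute.list_prod_left _ _ fun x hx => ?_).eq
    obtain ⟨i, hi, rfl⟩ := List.mem_map.mp hx
    obtain ⟨j, hj, rfl⟩ := List.mem_map.mp hy
    exact hcm Y X hXY.symm i hi j hj

/-- The one-step product `tail` of `TkOps.ofOneStep Z T1` at `(k, k)` is its `T k` (so `prod220` holds by construction). [folklore] -/
theorem TkOps.ofOneStep_T (Z : ℕ → Set ι) (T1 : ℕ → ℕ → Set ι → M) (k : ℕ) (X : Set ι) :
    (TkOps.ofOneStep Z T1).T k X = (TkOps.ofOneStep Z T1).tail k k X := rfl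

end TkOpsGen

end Literature.MathematicalPhysics.QuantumFieldTheory.Balaban1983to89.Step
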